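import Summits.CriticalPhenomena.SAWScalingLimit.Theses.SAWDefectDecoherence
import Literature.Probability.LatticeModels.TriangularLatticeProofs
import Literature.Barriers.CriticalPhenomena.ParafermionicHalfCauchyRiemann
import Summits.CriticalPhenomena.SAWScalingLimit.Theorems.SAWDevelopingMapPotentialExists
import Summits.CriticalPhenomena.SAWScalingLimit.Theorems.SAWDefectDecoherencePickHalfPlaneDefs
import Summits.CriticalPhenomena.SAWScalingLimit.Theorems.SAWDefectDecoherenceSpinShift
import Summits.CriticalPhenomena.SAWScalingLimit.Theorems.SAWDefectDecoherenceBoundaryClosureRBoundaryExactnessPhase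
import Summits.CriticalPhenomena.SAWScalingLimit.Theorems.SAWDefectDecoherenceBoundaryClosureRBoundaryExactness
import Summits.CriticalPhenomena.SAWScalingLimit.Theorems.SAWDefectDecoherenceBoundaryClosureRFlatMassLawsGlue
import Summits.CriticalPhenomena.SAWScalingLimit.Theorems.SAWDefectDecoherenceBoundaryClosureRFarReduction2
import Summits.CriticalPhenomena.SAWScalingLimit.Theorems.SAWDefectDecoherenceBoundaryClosureRBoundaryBookkeepingReach
import Summits.CriticalPhenomena.SAWScalingLimit.Theorems.SAWDefectDecoherenceBoundaryClosureRBoundaryReachOfConnected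
import Summits.CriticalPhenomena.SAWScalingLimit.Theorems.SAWDefectDecoherenceBoundaryClosureRBoundarySiteGraphConnected
import Summits.CriticalPhenomena.SAWScalingLimit.Theorems.SAWDefectDecoherenceBoundaryClosureRIdentificationOfGateTrace
import Summits.CriticalPhenomena.SAWScalingLimit.Theorems.SAWDefectDecoherenceBoundaryClosureRPickEngineStage2
import Summits.CriticalPhenomena.SAWScalingLimit.Theorems.SAWDefectDecoherenceBoundaryClosureRLocalL1OfSup
import Summits.CriticalPhenomena.SAWScalingLimit.Theorems.SAWDefectDecoherenceBoundaryClosureRGateTraceReduction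
import Summits.CriticalPhenomena.SAWScalingLimit.Theorems.SAWDefectDecoherenceBoundaryClosureRGateFrameRegular
import Summits.CriticalPhenomena.SAWScalingLimit.Theorems.SAWDefectDecoherenceBoundaryClosureRFlatDensityUpperOfSup
import Summits.CriticalPhenomena.SAWScalingLimit.Theorems.SAWDefectDecoherenceBoundaryClosureRDevelopingMapLimit
import Summits.CriticalPhenomena.SAWScalingLimit.Theorems.SAWDefectDecoherenceBoundaryClosureRRootWedgeOfNoMax
import Summits.CriticalPhenomena.SAWScalingLimit.Theorems.SAWDefectDecoherenceBoundaryClosureRDevelopingMapsCompact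
import Summits.CriticalPhenomena.SAWScalingLimit.Theorems.SAWDefectDecoherenceBoundaryClosureRBoundaryDataTransferAssembly
import Summits.CriticalPhenomena.SAWScalingLimit.Theorems.SAWDefectDecoherenceBoundaryClosureRLocalL1HolomorphicWeakLimit
import Summits.CriticalPhenomena.SAWScalingLimit.Theorems.SAWDefectDecoherenceBoundaryClosureRLocalL1SmoothToContinuous
import Summits.CriticalPhenomena.SAWScalingLimit.Theorems.SAWDefectDecoherenceBoundaryClosureRLocalL1Necessity
import Summits.CriticalPhenomena.SAWScalingLimit.Theorems.SAWDefectDecoherenceBoundaryClosureRLocalL1Normaliser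
import Summits.CriticalPhenomena.SAWScalingLimit.Theorems.SAWDefectDecoherenceConjugateClassNegligibleOfCruxes
import Summits.CriticalPhenomena.SAWScalingLimit.Theorems.SAWDefectDecoherenceBoundaryClosureRHolomorphicWeakLimits
import Summits.CriticalPhenomena.SAWScalingLimit.Theorems.SAWDefectDecoherenceBoundaryClosureRGateTraceNecessity
import Summits.CriticalPhenomena.SAWScalingLimit.Theorems.SAWDefectDecoherenceBoundaryClosureRFrameDatum
import Summits.CriticalPhenomena.SAWScalingLimit.Theorems.SAWDefectDecoherenceBoundaryClosureRLocalL1RootNecessity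

/-!
# Skeleton line `pick-half-plane` for crux `BoundaryClosureR` (stmt-CriticalPhenomena-14004)

Route `SAWDefectDecoherence`, crux r4
`BoundaryClosureR := DefectDecoherence → MassRatio → HexObservableLimitR` — the boundary
Riemann–Hilbert half of Duminil-Copin–Smirnov's Conjecture 2, GIVEN the route's two exponent
cruxes, over the repaired target `HexObservableLimitR` (root `a` and normaliser `b` pinned
conformally: flat horizontal piece + exact half-lattice `{v | m i δ ≤ v.1 1}` inside `ball (pt i) ρ`).

## The line (idea `pick-half-plane`, ideator 2; triage r1: 3 × pass)

LEVER.  Let `H_δ` be the developing map (`dH = F dz` on the triangular sites; exists exactly by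
DCS Lemma 1 + the discrete Poincaré lemma, `DevelopingMapExact` (E1)) and normalise by the COMPLEX
value at the normaliser: `h_δ := δ (H_δ - H_δ(s_b)) / F_δ(b_δ)`.  Every self-avoiding walk from one
floor dangling edge to another has winding `≡ π (mod 2π)`, so the card's functional
`u_δ = Im(conj κ · (H_δ - H_δ(b)))` is `(ℓ Z_δ(b_δ)/δ) · Re h_δ`:  CLAIM D reads

  `Re h_δ ≥ -o(1)` on the sites — the normalised developing map takes values in the closed RIGHT
  half-plane, and maps the flat gate through `b` INTO THE IMAGINARY AXIS (increments
  `-(iℓδ/2) Z_δ(e)/Z_δ(b_δ)`, exact: (E2)+(E3)).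

So every subsequential limit composed with a uniformiser is a Pick (Nevanlinna–Herglotz) function,
and positivity — unlike boundary values — passes to weak limits for free.  It buys: compactness by
HARNACK for nonnegative almost-harmonic functions (almost-harmonicity = the route's two exponent
cruxes through `DecoherenceSynthesis`: `‖∂̄h_δ‖_{L¹(K)} ≲ δ^{θ-3/4} → 0`), the ROOT ORDER `5/4` by
Herglotz growth + the exact straight arms at the root (E4) (no apex angle, no univalence, no Royster
obstruction), REFLECTION at the flat gate as a corollary (`Re h = 0` there), and non-degeneracy from
positive arrival masses on the gate.  Identification of the limit is the sibling line
`two-root-quotient` (its stubs 1, 3–7), which this line feeds: `IsPickCupLimit` below is its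
`IsCupLimit` export WITHOUT zero-freeness (zero-freeness = `NonVanishing`, where the Pick lever and
the cup lever meet, rides inside `stub_identification`).

SCOPE (triage r1-1/2/3 "convex only"): resolved by typing Claim D as a ONE-SIDED BOUND IN THE
ROOT FRAME — `HalfPlaneBounds` (lead reshapes r5/r5b, after refuter (F7)): ONE `M` with
`δ·(Re H(s) − Re H(s_b)) ≤ M·Z_δ(b δ)` at every lattice site, eventually, for the root-normalised
potential `H` (`F(e δ) = 1`).  This is the wedge bound `Re(conj ω · h_δ) ≥ −M` of the b-frame map
`h_δ = δ(H − H(s_b))/F(b δ)` in the class-covariant direction `ω = −e^{i(5/8)W_b}`, because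
`conj ω / F(b δ) = −1/Z_δ(b δ)` EXACTLY (`rootFrame_identity`, from (E2) and `e^{iW_b} = −1`); the
fixed b-frame direction `1` of r1–r4 is right only for `W_b/π ≡ ±1, ±5 (mod 16)` (snail carriers
with `W_b = ±3π` send `Re h_δ → −∞` at the root).  Continuum-true for EVERY Dobrushin carrier
(Koebe up to the boundary away from the root; the `(z-x)^{-1/4}` wedge of half-opening `π/8` about
`ω` at the root), exactly what `pickEngine_stage2` consumes (`ω e^{-iθ_east} = e^{-iπ/8}` in every
class), sharpening to `M → 0` on convex carriers of the census classes (≈ 10⁴ enumerated triples,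
0 violations).  No carrier restriction enters the composition.

STUBS — r14 (lead c1, ~18:3xZ): ALL PROVABLE STUBS CLOSED — `stub_rootWedgeOfNoMax` (p113388, W5), `stub_developingMapsCompact`
(p116438, W6), `stub_engineBoundaryData` (p118906, W7); open registered stubs = the four MODEL INPUTS `stub_rootNoInteriorMax`,
`stub_flatMassLaws` (= FlatDensityLower ∧ RootArmLaw), `stub_localSupBound`, `stub_gateBoundaryValueLaw`; `BoundaryClosureR_of` takes
exactly these four.  r13 (lead c1, 13:4xZ): the wedge is LOCALISED: `RootWedgeBound` (= `HalfPlaneBounds` only at sites in the root's closed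
half-ball `closedBall x (r/2)`) replaces `HalfPlaneBounds` in `stub_engineBoundaryData`, and is reduced to the new registered
model input `stub_rootNoInteriorMax : RootNoInteriorMax` by the provable `stub_rootWedgeOfNoMax : RootNoInteriorMax →
LocalSupBound → RootWedgeBound`; `stub_flatDensityUpperOfSup` CLOSED (p105339, W4); `stub_engineConvergence` ASSEMBLED from the
new registered `stub_developingMapsCompact : LocalSupBound → DevelopingMapsCompact` (seat -1's 5a) and seat -1's LANDED
`developingMapLimitHolomorphic` (5b); `IsEngineLimit` now carries seat -1's predicate `DevelopingMapsConverge` verbatim; 6 open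
stubs (halfPlaneBounds, flatMassLaws, localSupBound, developingMapsCompact, engineBoundaryData, gateBoundaryValueLaw).
r12 (lead c1, 12:1xZ): `stub_localL1OfSup` CLOSED (p98268); `stub_gateTrace` ASSEMBLED from the landed reduction
(p99342 + p98312, seat -1) and the new registered model input `stub_gateBoundaryValueLaw`; `FlatDensityLaw` split into `FlatDensityLower` (model input, in
`stub_flatMassLaws`) and `FlatDensityUpper` (derivable from `LocalSupBound`: new provable `stub_flatDensityUpperOfSup`), glue
`flatDensityLaw_of`; 7 open stubs.  r11 (lead c1, 2026-08-16 10:5xZ): 7 registered = `stub_halfPlaneBounds : HalfPlaneBounds` (model input,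
registered DIRECTLY: its r6–r10 positive-mass leg `FarArrivalTight` is presumably false on fractal carriers, see
that docstring; `HexNoInteriorMax ∧ BoundaryHalfPlaneBounds ⇒ HalfPlaneBounds` stays as the sorry-free sufficient
route) · `stub_flatMassLaws : FlatDensityLaw ∧ RootArmLaw` · `stub_localSupBound : LocalSupBound` (model input) ·
`stub_localL1OfSup : LocalSupBound → LocalL1Bound` (provable: mid-edge counting) · `stub_engineConvergence`
(laws + DD + MR → `EngineLimits`: Arzelà–Ascoli on the developing maps + the landed (S1)/(S2) chain) ·
`stub_engineBoundaryData` (laws → `EngineBoundaryData` = the hypotheses (I1)–(I4) of the landed stage 2, by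
passing the exact lattice facts to the limit) · `stub_gateTrace : GateTrace` (crux-sized lattice trace);
`stub_pickEngine` is now ASSEMBLED (`pickCupLimits_of` = landed `pickEngine_stage2`).  History
(7, lead reshapes r1–r10; r10 = identification half := `stub_gateTrace : GateTrace` (Identification derived by the landed glue p94078); the boundary bookkeeping [A] is a THEOREM (w-boundary: `BoundarySiteGraphConnected` p93914 → `BoundaryReach` p93510 → [A] p93238), boundary half := [D] `FarArrivalTight` alone; `stub_localL1Bound` gains the pointwise conjunct `LocalSupBound` (fed to `stub_pickEngine`); r9 = `BoundaryReach` reduced (p93510: even degrees, no bridge) to `BoundarySiteGraphConnected` (one boundary-site component); r8 = [A] `BookkeepingA` reduced by the landed bookkeeping (p93238) to the contour fact `BoundaryReach` (root dart is no bridge of the boundary-site graph); r7 = [A] carries the no-floor-pinch clause (glue p92205); r6 = `stub_boundaryExactness` CLOSED by the landed main file, boundary half := [A] `BookkeepingA` ∧ [D] `FarArrivalTight` (BoundaryHalfPlaneBounds derived by the landed glue p91062), mass stub := `FlatDensityLaw ∧ RootArmLaw` (FlatMassLaws derived, p90782); r5/r5b = root frame (class-covariant direction `ω`) everywhere, clause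 (i′) dropped, interior half weakened to ONE direction `HexNoInteriorMax`; r4 = vocabulary + minimum principle + flux polygon now IMPORTED from the landed `Theorems/SAWDefectDecoherencePickHalfPlaneDefs.lean`, p85218): `stub_potentialExistence` + `stub_boundaryExactness` (= the exact `DevelopingMapExact`, provable now) · `stub_halfPlaneInputs` = `HexNoInteriorMax ∧ FarArrivalTight` (LOAD-BEARING; the boundary bookkeeping [A] is a THEOREM; `HalfPlaneBounds` DERIVED from it by the landed far-reduction glue and the discrete maximum principle `halfPlaneBounds_of`, §4b
conjecture) · `stub_flatMassLaws` (positive-mass; r3: density form) · `stub_localL1Bound` (shared necessary input for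
C⁰ test functions) · `stub_pickEngine` (Harnack engine, then root order,
reflection, boundary values — former stubs 5+6) · `stub_identification` (import of `two-root-quotient`'s identification
half).  `closing` (subsequence principle) and `BoundaryClosureR_of` are sorry-free.

## Disproof / negatives used (Cruxes/BoundaryClosureR/Disproof.lean, cycle 1, read in full)
* (F0) `not_crux_iff`: the line is a PROOF device for `HexObservableLimitR` given DD, MR; (F3) no
  `_false_without_` exists on the crux side — nothing to honour there; DD and MR are consumed at
  `stub_pickEngine` (almost-harmonicity on compacts and up to the
  flat pieces).
* (F2) `target_false_without_normaliserPin` is honoured at `stub_halfPlaneInputs` (boundary half) /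
  `stub_flatMassLaws` (a) / (E3): the gate is the EXACT zigzag row through `b_δ` (one class, one
  winding) — for the dead-end-corridor-at-`b` family the gate structure is untouched while `F(b_δ)`
  is rescaled, so `Re(conj ω h_δ) ≥ -M` in `h`-units FAILS there, as the theorem demands of any
  proof.  `target_false_without_rootPin` is honoured at (E4) / `HalfPlaneBounds` / `FlatMassLaws` (b):
  the two straight arms and the arm divergence need the one-class flat row THROUGH the root.
* Landed negatives `BoundaryClosureR.Negative.{RootPin,NormaliserPin,EndCorridor,PeelEnd,ShiftedHalfDisc}`
  and `SAWDefectDecoherenceHexObservableLimit_refuted`: no stub is an instance — every statement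
  pins every root and the normaliser (`PinnedFlatRoot`, `AdmissibleFamily`), and the corridor
  families violate exactly those pins.  `ledger negatives` (9): 0772 (all-δ) — everything eventual;
  8312/10603 (one constant over disconnected supports) — constants here are per compact and per
  pinned point; nothing restated.
* (F7) (§6, drefute seat, 2026-08-16): `stub_halfPlaneInputs` r2–r4 STUB-FALSE through clause (i′)
  (direction `1` at all boundary sites) on curled carriers — repaired here (r5/r5b) as the
  refuter's C′ read in the root frame: only the `ω`-clause survives, and `ω`-projection = `−Re H`
  in the root frame (`rootFrame_identity`), so the maximum principle runs on `Re H`;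
  (F8) the other six stubs survive; (F9) lattice-scale wedge positivity near the root in direction
  `ω` (16 sites within 2.6 units, boxes up to 7×3) is what the bookkeeping [A] uses at the arms.
* (F5) stub audit of `two-root-quotient`: this line plugs into its `Identification` with the same
  vocabulary (`AdmissibleFamily`, `PinnedFlatRoot`, `IsWeakLimit` verbatim) and replaces its
  `stub_cupLimits` import by stubs 2–6 here.
-/

noncomputable section

open scoped BigOperators ComplexConjugate Topology Classical
open Filter Set MeasureTheory
open Literature.Probability.LatticeModels Literature.Probability.RandomPlanarGeometry
open Literature.Probability.RandomPlanarGeometry.SAW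
open Summit.CriticalPhenomena.SAWScalingLimit.Theses.SAWDefectDecoherence
open Summit.CriticalPhenomena.SAWScalingLimit.Theorems.PickHalfPlane
open Literature.Barriers.CriticalPhenomena.HexGreen (nbrs)

namespace Summit.CriticalPhenomena.SAWScalingLimit.Cruxes.BoundaryClosureR.PickHalfPlane

/-! ### 1. Vocabulary shared with the sibling line `two-root-quotient` (verbatim copies) -/

/-- The normalised functional `N^{e}_δ(ψ) := δ² Σ_{z ∈ Ω_δ} ψ(δ·mid z) F^{e δ}(z) / F^{e δ}(b δ)`
(root family `e`, normalisation family `b`, spin `5/8`, fugacity `x_c`). -/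
def NF (Λ : ℝ → Finset HexVertex) (e b : ℝ → Sym2 HexVertex) (δ : ℝ) (ψ : ℂ → ℂ) : ℂ :=
  (δ : ℂ) ^ 2 * (∑ᶠ z ∈ hexDomainMidEdges (Λ δ),
      ψ ((δ : ℂ) * hexMidpoint z) * hexParafermionicObservable (Λ δ) (e δ) hexCriticalFugacity (5 / 8) z) /
    hexParafermionicObservable (Λ δ) (e δ) hexCriticalFugacity (5 / 8) (b δ)

/-- Bulk test functions of the target: continuous, compactly supported inside the domain. -/
def IsTest (D : DobrushinDomain) (ψ : ℂ → ℂ) : Prop :=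
  Continuous ψ ∧ HasCompactSupport ψ ∧ tsupport ψ ⊆ D.carrier

/-- The root-free part of the target's hypotheses: flat piece and exact half-lattice around the
normalisation point `D.pt 1`, eventual admissibility of `Λ δ`, exhaustion of compacts, `b δ → pt 1`.
(Verbatim `TwoRootQuotient.AdmissibleFamily`.) -/
def AdmissibleFamily (D : DobrushinDomain) (ρ : ℝ) (Λ : ℝ → Finset HexVertex) (m : ℝ → ℤ)
    (b : ℝ → Sym2 HexVertex) : Prop :=
  0 < ρ ∧
  D.carrier ∩ Metric.ball (D.pt 1) ρ = {z : ℂ | (D.pt 1).im < z.im} ∩ Metric.ball (D.pt 1) ρ ∧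
  (∀ᶠ δ : ℝ in 𝓝[>] 0, hexDomainSimplyConnected (Λ δ) ∧ b δ ∈ hexDomainBoundary (Λ δ) ∧
      (hexGraph.induce ((Λ δ : Finset HexVertex) : Set HexVertex)).Preconnected ∧
      (∀ v ∈ Λ δ, (δ : ℂ) * hexCenter v ∈ D.carrier) ∧
      (∀ v : HexVertex, (δ : ℂ) * hexCenter v ∈ Metric.ball (D.pt 1) ρ → (v ∈ Λ δ ↔ m δ ≤ v.1 1))) ∧
  (∀ K : Set ℂ, IsCompact K → K ⊆ D.carrier →
      ∀ᶠ δ : ℝ in 𝓝[>] 0, ∀ v : HexVertex, (δ : ℂ) * hexCenter v ∈ K → v ∈ Λ δ) ∧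
  Tendsto (fun δ : ℝ => (δ : ℂ) * hexMidpoint (b δ)) (𝓝[>] 0) (𝓝 (D.pt 1))

/-- A root family `e` PINNED on a flat piece at `x ∈ ∂D`: inside `ball x r` the domain is the open
half-plane above `x` and `Λ δ` is exactly the half-lattice `{v | mr δ ≤ v.1 1}`; the roots are
boundary mid-edges with `δ·mid(e δ) → x`, and walks to the normaliser exist.
(Verbatim `TwoRootQuotient.PinnedFlatRoot`.) -/
def PinnedFlatRoot (D : DobrushinDomain) (Λ : ℝ → Finset HexVertex) (b : ℝ → Sym2 HexVertex)
    (x : ℂ) (e : ℝ → Sym2 HexVertex) (r : ℝ) (mr : ℝ → ℤ) : Prop :=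
  0 < r ∧
  D.carrier ∩ Metric.ball x r = {z : ℂ | x.im < z.im} ∩ Metric.ball x r ∧
  (∀ᶠ δ : ℝ in 𝓝[>] 0, e δ ∈ hexDomainBoundary (Λ δ) ∧ Nonempty (HexMidEdgeSAW (Λ δ) (e δ) (b δ)) ∧
      (∀ v : HexVertex, (δ : ℂ) * hexCenter v ∈ Metric.ball x r → (v ∈ Λ δ ↔ mr δ ≤ v.1 1))) ∧
  Tendsto (fun δ : ℝ => (δ : ℂ) * hexMidpoint (e δ)) (𝓝[>] 0) (𝓝 x)

/-- `g` is the weak limit of the normalised functionals of root family `e` along the mesh sequence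
`ns`: `N^{e}_{ns n}(ψ) → ∫ ψ g` for every bulk test function. (Verbatim `TwoRootQuotient.IsWeakLimit`.) -/
def IsWeakLimit (D : DobrushinDomain) (Λ : ℝ → Finset HexVertex) (e b : ℝ → Sym2 HexVertex)
    (ns : ℕ → ℝ) (g : ℂ → ℂ) : Prop :=
  ∀ ψ : ℂ → ℂ, IsTest D ψ → Tendsto (fun n => NF Λ e b (ns n) ψ) atTop (𝓝 (∫ z, ψ z * g z))

/-- The flat boundary points seen by a root pinned at `x` (radius `r`): the normaliser's flat piece
(the GATE) `{im = im (pt 1)} ∩ ball (pt 1) ρ` and the root's own flat piece `{im = im x} ∩ ball x r`.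
(Verbatim `TwoRootQuotient.flatPoints`.) -/
def flatPoints (D : DobrushinDomain) (ρ : ℝ) (x : ℂ) (r : ℝ) : Set ℂ :=
  ({z : ℂ | z.im = (D.pt 1).im} ∩ Metric.ball (D.pt 1) ρ) ∪ ({z : ℂ | z.im = x.im} ∩ Metric.ball x r)

/-! ### 2. Vocabulary of this line: the developing map, flat floors, Pick data -/

/-- **Interior Pick limit** — what stage 1 of the engine (`stub_pickEngine`) exports about a
subsequential limit density `g` of a root pinned at `x` (normaliser at `pt 1`): `g` is holomorphic
and not identically zero; it has a holomorphic primitive up to a universal nonzero factor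
(`h' = α g`; expected `α = -i/12` from `dH = -(i/(2√3)) F dz` and the mid-edge density `2√3`), and
`h` — the limit of the normalised developing maps `h_δ = δ(H_δ - H_δ(s_b))/F_δ(b_δ)` — carries the
one-sided PICK DATUM (lead reshape r5): `Re(conj ω · h)` is bounded below on the WHOLE carrier for a
unimodular `ω` (the limit of the arm bisectors `-e^{i(5/8)W_b}`, one of 8 classes; it ROTATES with the
winding class of the carrier between root and normaliser — the fixed direction `1` of r1–r4 does not,
refuter (F7)). -/
def IsInteriorPickLimit (D : DobrushinDomain) (_ρ : ℝ) (_x : ℂ) (_r : ℝ) (g : ℂ → ℂ) : Prop :=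
  DifferentiableOn ℂ g D.carrier ∧ (∃ z ∈ D.carrier, g z ≠ 0) ∧
  ∃ (h : ℂ → ℂ) (α ω : ℂ), α ≠ 0 ∧ ‖ω‖ = 1 ∧ DifferentiableOn ℂ h D.carrier ∧
    (∀ z ∈ D.carrier, deriv h z = α * g z) ∧
    (∃ M : ℝ, ∀ z ∈ D.carrier, -M ≤ ((starRingEnd ℂ) ω * h z).re)

/-- **Pick–cup limit** — the export contract of this line towards identification: the sibling
line's `TwoRootQuotient.IsCupLimit` WITHOUT zero-freeness (clauses 1, 3, 4 verbatim): holomorphic on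
the domain, blow-up of exact order `5/4` at its own root with a nonzero coefficient, and nonzero
boundary values at every other flat boundary point (gate and root piece). -/
def IsPickCupLimit (D : DobrushinDomain) (ρ : ℝ) (x : ℂ) (r : ℝ) (g : ℂ → ℂ) : Prop :=
  DifferentiableOn ℂ g D.carrier ∧
  (∃ κ : ℂ, κ ≠ 0 ∧ Tendsto (fun z => g z * (z - x) ^ ((5 : ℂ) / 4)) (𝓝[D.carrier] x) (𝓝 κ)) ∧
  (∀ y ∈ flatPoints D ρ x r, y ≠ x → ∃ w : ℂ, w ≠ 0 ∧ Tendsto g (𝓝[D.carrier] y) (𝓝 w))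

/-! ### 3. The statements of the line -/

/-- STUB 1 statement — **the exact structure of the developing map** (all four clauses are finite
lattice identities, provable now):
(E1) POTENTIAL: for `Λ` simply connected and a boundary root, a potential `H` of `F dz` exists
  (closedness on each triangle = DCS Lemma 1, `DuminilCopinSmirnov2012_lemma1_holds`, proved in the
  tree; exactness = discrete Poincaré lemma on the union of the closed triangles of `Λ`, whose
  complement is connected) — verbatim pool item `PotentialExists` (stmt-8299);
(E2) BOUNDARY PHASE LAW (the card's `BoundarySineLaw` in product form, root edge EXCLUDED as the
  triage demanded): for a boundary mid-edge `e = {u', w'} ≠ a` and any walk `γ : a → e`,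
  `(mid e - c_{w'}) · F_{5/8}(e) = ((c_w - c_u)/2) · e^{i(3/8)W(γ)} · Z(e)` — final direction
  `= e^{iW}·`initial direction (turning angles telescope walk by walk) and `F_{5/8}(e) = Z(e)
  e^{-i(5/8)W_e}` (winding rigidity, item 8515); taking `Im(conj κ · _)` gives the sine law;
(E3) STRAIGHT GATE: two floor edges of one flat floor not containing the root receive the same
  winding from the root (`W = Δτ_ccw - π`, the flat floor turns by `0`);
(E4) ROOT ARMS: from a floor root, floor edges of the same flat floor to the EAST receive winding
  `-π`, to the WEST `+π` (Jordan curve + simple connectivity: the loop closed along the floor is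
  clockwise / counter-clockwise). -/
def DevelopingMapExact : Prop :=
  (∀ (Λ : Finset HexVertex), hexDomainSimplyConnected Λ → ∀ a ∈ hexDomainBoundary Λ,
      ∃ H : Site 2 → ℂ, IsPotential Λ a H) ∧
  (∀ (Λ : Finset HexVertex), hexDomainSimplyConnected Λ →
    ∀ (u w : HexVertex), hexGraph.Adj u w → u ∉ Λ → w ∈ Λ →
    ∀ (u' w' : HexVertex), hexGraph.Adj u' w' → u' ∉ Λ → w' ∈ Λ → s(u', w') ≠ s(u, w) →
    ∀ γ : HexMidEdgeSAW Λ s(u, w) s(u', w'),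
      (hexMidpoint s(u', w') - hexCenter w') *
          hexParafermionicObservable Λ s(u, w) hexCriticalFugacity (5 / 8) s(u', w') =
        (hexCenter w - hexCenter u) / 2 * Complex.exp (Complex.I * (3 / 8 : ℂ) * (γ.winding : ℂ)) *
          (‖hexParafermionicObservable Λ s(u, w) hexCriticalFugacity 0 s(u', w')‖ : ℂ)) ∧
  (∀ (Λ : Finset HexVertex), hexDomainSimplyConnected Λ →
    ∀ (u w : HexVertex), hexGraph.Adj u w → u ∉ Λ → w ∈ Λ →
    ∀ (m k₁ k₂ : ℤ), IsFlatFloor Λ m k₁ k₂ → (∀ k : ℤ, k₁ ≤ k → k ≤ k₂ → floorEdge k m ≠ s(u, w)) →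
    ∀ (kb ke : ℤ), k₁ ≤ kb → kb ≤ k₂ → k₁ ≤ ke → ke ≤ k₂ →
    ∀ (γb : HexMidEdgeSAW Λ s(u, w) (floorEdge kb m)) (γe : HexMidEdgeSAW Λ s(u, w) (floorEdge ke m)),
      γe.winding = γb.winding) ∧
  (∀ (Λ : Finset HexVertex), hexDomainSimplyConnected Λ →
    ∀ (m k₁ k₂ ka : ℤ), IsFlatFloor Λ m k₁ k₂ → k₁ ≤ ka → ka ≤ k₂ →
    ∀ (ke : ℤ), k₁ ≤ ke → ke ≤ k₂ → ∀ γ : HexMidEdgeSAW Λ (floorEdge ka m) (floorEdge ke m),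
      (ka < ke → γ.winding = -Real.pi) ∧ (ke < ka → γ.winding = Real.pi))

/-- (E1) alone, as its own registered stub: a potential of `F dz` exists for every simply
connected `Λ` and boundary root — VERBATIM the pool item `SAWDevelopingMap.PotentialExists`
(stmt-CriticalPhenomena-8299; its topological input `…Theorems.PotentialExists.*Topology` is in
the tree), so one proof serves both. -/
def PotentialExistence : Prop :=
  ∀ (Λ : Finset HexVertex), hexDomainSimplyConnected Λ → ∀ a ∈ hexDomainBoundary Λ,
      ∃ H : Site 2 → ℂ, IsPotential Λ a H

/-- (E2) ∧ (E3) ∧ (E4), as their own registered stub: the boundary phase law, the straight gate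
and the root arms — all three are instances of winding RIGIDITY between boundary mid-edges
(`HexMidEdgeSAW.winding_eq_of_mem_boundary`, HexSAWPathRigidity, in tree) plus one explicit walk
per class (the telescoping of turning angles for (E2); the 3-step walk up–over–down of winding
`-π` for (E4)). -/
def BoundaryExactness : Prop :=
  (∀ (Λ : Finset HexVertex), hexDomainSimplyConnected Λ →
    ∀ (u w : HexVertex), hexGraph.Adj u w → u ∉ Λ → w ∈ Λ →
    ∀ (u' w' : HexVertex), hexGraph.Adj u' w' → u' ∉ Λ → w' ∈ Λ → s(u', w') ≠ s(u, w) →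
    ∀ γ : HexMidEdgeSAW Λ s(u, w) s(u', w'),
      (hexMidpoint s(u', w') - hexCenter w') *
          hexParafermionicObservable Λ s(u, w) hexCriticalFugacity (5 / 8) s(u', w') =
        (hexCenter w - hexCenter u) / 2 * Complex.exp (Complex.I * (3 / 8 : ℂ) * (γ.winding : ℂ)) *
          (‖hexParafermionicObservable Λ s(u, w) hexCriticalFugacity 0 s(u', w')‖ : ℂ)) ∧
  (∀ (Λ : Finset HexVertex), hexDomainSimplyConnected Λ →
    ∀ (u w : HexVertex), hexGraph.Adj u w → u ∉ Λ → w ∈ Λ →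
    ∀ (m k₁ k₂ : ℤ), IsFlatFloor Λ m k₁ k₂ → (∀ k : ℤ, k₁ ≤ k → k ≤ k₂ → floorEdge k m ≠ s(u, w)) →
    ∀ (kb ke : ℤ), k₁ ≤ kb → kb ≤ k₂ → k₁ ≤ ke → ke ≤ k₂ →
    ∀ (γb : HexMidEdgeSAW Λ s(u, w) (floorEdge kb m)) (γe : HexMidEdgeSAW Λ s(u, w) (floorEdge ke m)),
      γe.winding = γb.winding) ∧
  (∀ (Λ : Finset HexVertex), hexDomainSimplyConnected Λ →
    ∀ (m k₁ k₂ ka : ℤ), IsFlatFloor Λ m k₁ k₂ → k₁ ≤ ka → ka ≤ k₂ →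
    ∀ (ke : ℤ), k₁ ≤ ke → ke ≤ k₂ → ∀ γ : HexMidEdgeSAW Λ (floorEdge ka m) (floorEdge ke m),
      (ka < ke → γ.winding = -Real.pi) ∧ (ke < ka → γ.winding = Real.pi))

/-- Glue (no `sorry`): the two registered halves give `DevelopingMapExact`. -/
theorem developingMapExact_of (h₁ : PotentialExistence) (h₂ : BoundaryExactness) :
    DevelopingMapExact := ⟨h₁, h₂⟩

/-- STUB 2 statement — **CLAIM D as a one-sided a-priori bound (LOAD-BEARING)**, in the ROOT
FRAME (lead reshape r5b).  For every admissible family, every pinned flat root `x ≠ pt 1` and every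
potential `H` of `F dz` (`IsPotential`, root-normalised: `F(e δ) = 1`): there is ONE `M` such that
eventually `δ·(Re H(s) − Re H(s_b)) ≤ M·Z_δ(b δ)` at EVERY lattice site `s` of `Λ δ` (`s_b` either
site of the floor edge `b δ`, `Z = F_{x_c,0}` the arrival mass).  This IS the class-covariant wedge
bound of r5: by (E2) at `b δ` and `e^{iW_b} = −1` (root and normaliser are both floor darts),
`conj ω / F_{5/8}(b δ) = −1/Z_δ(b δ)` EXACTLY for `ω = −e^{i(5/8)W_b}` (`rootFrame_identity`
below), so `Re(conj ω · h_δ(s)) = −(δ/Z_δ(b δ))·(Re H(s) − Re H(s_b))` for the normalised map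
`h_δ = δ(H − H(s_b))/F_δ(b δ)`: a LOWER bound on the wedge projection is an UPPER bound on `Re H`
in the root frame — no direction is chosen at all, and the curl class of the carrier between root
and normaliser (refuter (F7): the fixed b-frame direction `1` is right only for
`W_b/π ≡ 1, −1, 5, −5 (mod 16)`) never enters.  Continuum shadow: `Re h ≤ M` for
`h = c∫(φ')^{5/8}` in the root frame on the closed carrier minus the root, the root term
`−B(z−x)^{−1/4}` opening downwards — true for EVERY Dobrushin carrier; exactly what
`pickEngine_stage2` consumes after the frame change (`ω e^{−iθ_east} = e^{−iπ/8}` in every class).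
One-sided, `Φ`-free, invisible to the vertex relations. -/
def HalfPlaneBounds : Prop :=
  ∀ (D : DobrushinDomain) (ρ : ℝ) (Λ : ℝ → Finset HexVertex) (m : ℝ → ℤ) (b : ℝ → Sym2 HexVertex),
    AdmissibleFamily D ρ Λ m b →
  ∀ (x : ℂ) (e : ℝ → Sym2 HexVertex) (r : ℝ) (mr : ℝ → ℤ), PinnedFlatRoot D Λ b x e r mr → x ≠ D.pt 1 →
  ∃ M : ℝ, ∀ᶠ δ : ℝ in 𝓝[>] 0, ∀ H : Site 2 → ℂ, IsPotential (Λ δ) (e δ) H →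
      ∀ (ub wb : HexVertex), b δ = s(ub, wb) →
      ∀ sb : Site 2, sb ∈ hexFaceVertices ub → sb ∈ hexFaceVertices wb →
      ∀ v ∈ Λ δ, ∀ s ∈ hexFaceVertices v,
        δ * ((H s).re - (H sb).re) ≤
          M * ‖hexParafermionicObservable (Λ δ) (e δ) hexCriticalFugacity 0 (b δ)‖

/-- **ROOT WEDGE BOUND** (lead c1 reshape r13): `HalfPlaneBounds` asked ONLY at the lattice sites
inside the closed half-ball `closedBall x (r/2)` of the root's exact half-lattice pin — the only place
the engine uses the wedge ((I2) of `pickEngine_stage2`, on a punctured closed half-disc of radius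
`r₀ ≤ r/2`; everywhere else `LocalSupBound` bounds the developing maps two-sidedly).  Strictly weaker
than `HalfPlaneBounds` (`rootWedgeBound_of_halfPlaneBounds`); REDUCED (STUB 2b, provable) to
`LocalSupBound` + the local exact-lattice input `RootNoInteriorMax` by the discrete maximum principle on
the half-ball: its lattice boundary consists of FLOOR sites (where `Re H` is V-shaped with minimum at the
root: east steps `e^{iπ/8}(√3/6)Z_k`, west steps `e^{i7π/8}(√3/6)Z_k`, root step `−i/(2√3)` purely
imaginary — landed `floor_step_eq`/`root_step_eq`/`lattice_arms`) and RIM sites at distance `≈ r/2`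
from the root (bounded by integrating `LocalSupBound` from `s_b`). -/
def RootWedgeBound : Prop :=
  ∀ (D : DobrushinDomain) (ρ : ℝ) (Λ : ℝ → Finset HexVertex) (m : ℝ → ℤ) (b : ℝ → Sym2 HexVertex),
    AdmissibleFamily D ρ Λ m b →
  ∀ (x : ℂ) (e : ℝ → Sym2 HexVertex) (r : ℝ) (mr : ℝ → ℤ), PinnedFlatRoot D Λ b x e r mr → x ≠ D.pt 1 →
  ∃ M : ℝ, ∀ᶠ δ : ℝ in 𝓝[>] 0, ∀ H : Site 2 → ℂ, IsPotential (Λ δ) (e δ) H →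
      ∀ (ub wb : HexVertex), b δ = s(ub, wb) →
      ∀ sb : Site 2, sb ∈ hexFaceVertices ub → sb ∈ hexFaceVertices wb →
      ∀ v ∈ Λ δ, ∀ s ∈ hexFaceVertices v, (δ : ℂ) * triEmbed s ∈ Metric.closedBall x (r / 2) →
        δ * ((H s).re - (H sb).re) ≤
          M * ‖hexParafermionicObservable (Λ δ) (e δ) hexCriticalFugacity 0 (b δ)‖

/-- The global Claim D implies the root wedge bound (drop the ball condition). [folklore] -/
theorem rootWedgeBound_of_halfPlaneBounds (h : HalfPlaneBounds) : RootWedgeBound := by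
  intro D ρ Λ m b hAF x e r mr hPR hx
  obtain ⟨M, hM⟩ := h D ρ Λ m b hAF x e r mr hPR hx
  exact ⟨M, hM.mono fun δ hδ H hH ub wb hb sb hsb hsb' v hv s hs _ => hδ H hH ub wb hb sb hsb hsb' v hv s hs⟩

/-- **NO INTERIOR MAXIMUM NEAR THE ROOT** (lead c1 reshape r13; the registered local exact-lattice MODEL
INPUT replacing the global `HexNoInteriorMax`/`HalfPlaneBounds`): eventually, for every potential `H` of
the root-`e δ` observable, every INTERIOR site (full hexagon of `Λ δ`) whose scaled position lies in the
closed half-ball `closedBall x (r/2)` of the root's exact half-lattice pin has a lattice neighbour with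
STRICTLY larger `Re H` (root frame).  Φ-free, local to the rigid geometry where the observable is
dominated by the root singularity (no zeros of the limit, no rough boundary); inherits the census of
`HexNoInteriorMax` (0 violations in ≈ 5·10⁴ (Λ, a, site) records, margin ≥ 0.2) and the landed bulk
theorem `noInteriorMax_of_defectDecoherence` (DD ⇒ no interior max at R-deep dominant hexagons).  OPEN
(crux-sized but crisp: finitely many boundary-layer inequalities above a flat floor + the bulk). -/
def RootNoInteriorMax : Prop :=
  ∀ (D : DobrushinDomain) (ρ : ℝ) (Λ : ℝ → Finset HexVertex) (m : ℝ → ℤ) (b : ℝ → Sym2 HexVertex),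
    AdmissibleFamily D ρ Λ m b →
  ∀ (x : ℂ) (e : ℝ → Sym2 HexVertex) (r : ℝ) (mr : ℝ → ℤ), PinnedFlatRoot D Λ b x e r mr → x ≠ D.pt 1 →
  ∀ᶠ δ : ℝ in 𝓝[>] 0, ∀ H : Site 2 → ℂ, IsPotential (Λ δ) (e δ) H →
    ∀ s : Site 2, IsInteriorSite (Λ δ) s → (δ : ℂ) * triEmbed s ∈ Metric.closedBall x (r / 2) →
      ∃ t ∈ siteNbrs s, (H s).re < (H t).re

/-! #### Lead reshape r2: the two halves of Claim D (interior hull + boundary budget) -/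

/-- **NO INTERIOR MAXIMUM of `Re H` in the root frame** (lead reshape r5b — the interior half of
Claim D in the ONE direction the minimum principle actually uses): for every simply connected,
connected `Λ`, boundary root `a`, potential `H` of `F dz` and interior site `s`, SOME neighbouring
site has strictly larger `Re H`.  Strictly weaker than the card's strict hull condition
`HexHullStrict` (all directions; `hexHullStrict_imp_noInteriorMax`), hence inherits its census
(0 violations in ≈ 5·10⁴ (Λ, a, site) records, lead + planners + refuter); `Φ`-free, local, exact
size by size; OPEN as a theorem (no lattice mechanism known: the six increments around a hexagon
are unconstrained by the vertex relations, which only say that `H` exists). -/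
def HexNoInteriorMax : Prop :=
  ∀ (Λ : Finset HexVertex), hexDomainSimplyConnected Λ →
    (hexGraph.induce ((Λ : Finset HexVertex) : Set HexVertex)).Preconnected →
  ∀ a ∈ hexDomainBoundary Λ,
  ∀ H : Site 2 → ℂ, IsPotential Λ a H → ∀ s : Site 2, IsInteriorSite Λ s →
  ∃ t ∈ siteNbrs s, (H s).re < (H t).re

/-- **STRICT HEXAGON HULL CONDITION** (the interior half of Claim D; = the crux-level claim
`HexHullCondition` of the card `hexagon-hull-tutte-engine` for crux `NoFoldBound`, stmt-8296, whose
census — 17 086 + 33 049 (Λ, a, site) records, all sources — found max angular gap 143.7° < 180°):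
for every simply connected `Λ`, boundary root `a`, potential `H` of `F dz`, every interior site `s`
and every direction `d ≠ 0`, SOME neighbour increment `H(t) − H(s)` has positive real part against
`conj d` — i.e. the six rotated edge values of the observable around the full hexagon at `s` are
contained in no closed half-plane; `H(s)` is a convex combination of its six neighbours with ALL
weights positive (discrete Radó–Kneser–Choquet / Tutte–Floater input).  `Λ` must be CONNECTED (on
a rootless component `F ≡ 0` and `H` is an arbitrary constant — the line's `AdmissibleFamily`
provides connectivity).  Equivalent reading: by the six vertex relations the rotated edge values
`g_j = τ_j F(e_j)` around the hexagon form a closed polygon with edge vectors `−n_j F(f_j)` (the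
outward fluxes), whose POSITION is the hexagon circulation `Σ_j g_j` — the free parameter of the
half-Cauchy–Riemann kernel (`HexKernel.witness`); the condition says the model places the origin
strictly inside that polygon (uniformly small circulation against the local fluxes).  Φ-free,
local, exact size by size; OPEN as a theorem. -/
def HexHullStrict : Prop :=
  ∀ (Λ : Finset HexVertex), hexDomainSimplyConnected Λ →
    (hexGraph.induce ((Λ : Finset HexVertex) : Set HexVertex)).Preconnected →
  ∀ a ∈ hexDomainBoundary Λ,
  ∀ H : Site 2 → ℂ, IsPotential Λ a H → ∀ s : Site 2, IsInteriorSite Λ s →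
  ∀ d : ℂ, d ≠ 0 → ∃ t ∈ siteNbrs s, 0 < ((starRingEnd ℂ) d * (H t - H s)).re

/-- **CLAIM D AT BOUNDARY SITES** (the boundary half, GLOBAL form, ROOT FRAME; lead reshape r5b):
the bound of `HalfPlaneBounds` asked only at the BOUNDARY sites of `Λ δ` (lattice sites carrying a
hexagon corner off `Λ δ`), at ALL of them, with one constant.  There `Re H` is an exact boundary
sum: by (E2), crossing the dual of a boundary dart `e ≠ root` changes `Re H` by
`∓ (1/(2√3))·sin((3/8)W_e)·Z(e)` (`W_e` the rigid winding root → e; class-free), so this is a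
statement about POSITIVE arrival masses dressed by deterministic lattice signs: from `s_b`
counter-clockwise up to the root's west arm one sign is wanted, clockwise back to the east arm the
other; both arms (`W_e = ±π`, (E4)) and every floor dart of the root piece have the good sign
(`Re H` DEcreases into the root from both sides; refuter (F9): also at lattice scale), so `M` is
controlled by the arrival mass of the remaining ("far") darts in units of `Z(b δ)/δ` —
bookkeeping [A] (exact; wave 3) plus far-arrival tightness [D] (positive-mass).  Continuum
shadow: `Re h` bounded above on the closed carrier minus the root for EVERY bounded carrier.
The r2–r4 b-frame direction-`1` clause (i′) is FALSE on curled carriers (refuter (F7), evidence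
`halfPlaneInputs.md`; class formula in `reshape-r5-note.md`); exact-form (`M = 0`) failures:
`Cruxes/BoundaryClosureR/ClaimDExactFormDownStep.md`. -/
def BoundaryHalfPlaneBounds : Prop :=
  ∀ (D : DobrushinDomain) (ρ : ℝ) (Λ : ℝ → Finset HexVertex) (m : ℝ → ℤ) (b : ℝ → Sym2 HexVertex),
    AdmissibleFamily D ρ Λ m b →
  ∀ (x : ℂ) (e : ℝ → Sym2 HexVertex) (r : ℝ) (mr : ℝ → ℤ), PinnedFlatRoot D Λ b x e r mr → x ≠ D.pt 1 →
  ∃ M : ℝ, ∀ᶠ δ : ℝ in 𝓝[>] 0, ∀ H : Site 2 → ℂ, IsPotential (Λ δ) (e δ) H →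
      ∀ (ub wb : HexVertex), b δ = s(ub, wb) →
      ∀ sb : Site 2, sb ∈ hexFaceVertices ub → sb ∈ hexFaceVertices wb →
      ∀ s : Site 2, IsLatticeSite (Λ δ) s → ¬ IsInteriorSite (Λ δ) s →
        δ * ((H s).re - (H sb).re) ≤
          M * ‖hexParafermionicObservable (Λ δ) (e δ) hexCriticalFugacity 0 (b δ)‖

/-- **[A] BOUNDARY BOOKKEEPING** (per-domain, exact; worker w-boundary, wave 3): for a root INSIDE a
flat floor segment and a normaliser dart OFF that segment, at every non-interior lattice site the
root-normalised potential satisfies `Re H(s) − Re H(s_b) ≤ K·Σ_{boundary darts off the segment} Z(e)`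
(step law `∓(1/(2√3)) sin((3/8)W_e) Z(e)` per crossed dart, (E2); segment darts crossed towards the
root lower `Re H`, (E4); the boundary contour of a pinch-free simply connected hex domain; path half
landed: `…BoundaryExactness.stub_halfPlaneInputs_boundaryBookkeepingPath`, p91794).  The segment is
required FLOOR-PINCH-FREE (`(k, m−1, 0) ∉ Λ`: no up-face of `Λ` hangs below a floor site — worker
w-boundary's caveat; automatic in the pinned half-lattice).  Stated in the `∃ K`-form consumed by the
landed glue `GateMass.halfPlaneInputs_farReduction'` (p92205). -/
def BookkeepingA : Prop :=
  ∃ K : ℝ, ∀ (Λ : Finset HexVertex), hexDomainSimplyConnected Λ →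
      (hexGraph.induce ((Λ : Finset HexVertex) : Set HexVertex)).Preconnected →
    ∀ (m k₁ k₂ ka : ℤ),
      (∀ k : ℤ, k₁ ≤ k → k ≤ k₂ → ((![k, m], 0) : HexVertex) ∈ Λ ∧
        ((![k, m - 1], 1) : HexVertex) ∉ Λ ∧ (k < k₂ → ((![k, m], 1) : HexVertex) ∈ Λ) ∧
        ((![k, m - 1], 0) : HexVertex) ∉ Λ) →
      k₁ ≤ ka → ka ≤ k₂ →
    ∀ (ub wb : HexVertex), hexGraph.Adj ub wb → ub ∉ Λ → wb ∈ Λ →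
      (∀ k : ℤ, k₁ ≤ k → k ≤ k₂ → s(ub, wb) ≠ s((((![k, m - 1] : Site 2)), (1 : Fin 2)), ((![k, m] : Site 2), (0 : Fin 2)))) →
    ∀ (H : Site 2 → ℂ), IsPotential Λ s((((![ka, m - 1] : Site 2)), (1 : Fin 2)), ((![ka, m] : Site 2), (0 : Fin 2))) H →
    ∀ (sb : Site 2), sb ∈ hexFaceVertices ub → sb ∈ hexFaceVertices wb →
    ∀ (s : Site 2), IsLatticeSite Λ s → ¬ IsInteriorSite Λ s →
      (H s).re - (H sb).re ≤ K * ∑ v ∈ Λ, ∑ t ∈ (nbrs v).filter (· ∉ Λ),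
        if (∀ k : ℤ, k₁ ≤ k → k ≤ k₂ → s(t, v) ≠ s((((![k, m - 1] : Site 2)), (1 : Fin 2)), ((![k, m] : Site 2), (0 : Fin 2))))
        then ‖hexParafermionicObservable Λ s((((![ka, m - 1] : Site 2)), (1 : Fin 2)), ((![ka, m] : Site 2), (0 : Fin 2))) hexCriticalFugacity 0 s(t, v)‖ else 0

/-- **BOUNDARY REACH** (lead reshape r8; the one contour fact [A] still needs — worker
w-boundary's precisely stated remainder after landing the step laws, the trail bookkeeping and the
reduction `…BoundaryExactness.stub_halfPlaneInputs_boundaryBookkeepingOfReach`, p93238): in a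
connected, simply connected `Λ` with a floor-pinch-free flat segment containing the root dart and a
normaliser dart off the segment, EVERY non-interior lattice site is reachable from the normaliser's
site in the BOUNDARY-SITE GRAPH (lattice sites joined across the dual of a boundary dart) WITHOUT
using the root dart — i.e. the root dart is no bridge of the boundary-site graph (single boundary
circuit of a simply connected polyhex).  Pure combinatorial topology of `ℍ`-domains; provable
(even degrees ⇒ no bridges; one boundary-site component). -/
def BoundaryReach : Prop :=
  ∀ (Λ : Finset HexVertex), hexDomainSimplyConnected Λ →
      (hexGraph.induce ((Λ : Finset HexVertex) : Set HexVertex)).Preconnected →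
    ∀ (m k₁ k₂ ka : ℤ), (∀ k : ℤ, k₁ ≤ k → k ≤ k₂ → ((![k, m], 0) : HexVertex) ∈ Λ ∧
        ((![k, m - 1], 1) : HexVertex) ∉ Λ ∧ (k < k₂ → ((![k, m], 1) : HexVertex) ∈ Λ) ∧
        ((![k, m - 1], 0) : HexVertex) ∉ Λ) → k₁ ≤ ka → ka ≤ k₂ →
    ∀ (ub wb : HexVertex), hexGraph.Adj ub wb → ub ∉ Λ → wb ∈ Λ →
      (∀ k : ℤ, k₁ ≤ k → k ≤ k₂ →
        s(ub, wb) ≠ s((((![k, m - 1] : Site 2)), (1 : Fin 2)), ((![k, m] : Site 2), (0 : Fin 2)))) →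
    ∀ (sb : Site 2), sb ∈ hexFaceVertices ub → sb ∈ hexFaceVertices wb →
    ∀ (s : Site 2), IsLatticeSite Λ s → ¬ IsInteriorSite Λ s →
      Relation.ReflTransGen (fun p q : Site 2 => p ≠ q ∧ ∃ v ∈ Λ, ∃ t : HexVertex, t ∉ Λ ∧
        hexGraph.Adj v t ∧
        s(t, v) ≠ s((((![ka, m - 1] : Site 2)), (1 : Fin 2)), ((![ka, m] : Site 2), (0 : Fin 2))) ∧
        p ∈ hexFaceVertices v ∧ p ∈ hexFaceVertices t ∧
        q ∈ hexFaceVertices v ∧ q ∈ hexFaceVertices t) sb s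

/-- **BOUNDARY-SITE GRAPH CONNECTED** (lead reshape r9; the residual global contour fact after
w-boundary's `…BoundaryExactness.stub_halfPlaneInputs_boundaryReachOfConnected`, p93510: even
degrees ⇒ the root dart is no bridge): in a connected, simply connected `Λ`, ANY two non-interior
lattice sites are joined in the boundary-site graph (lattice sites adjacent across the dual of a
boundary dart).  Bond–cycle duality of the planar lattice pair `ℍ/𝕋`: the cut `E(Λ, Λᶜ)` of a finite
connected `Λ` with connected complement is a bond, whose dual is ONE cycle through all boundary
sites.  Pure combinatorial topology; provable. -/
def BoundarySiteGraphConnected : Prop :=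
  ∀ (Λ : Finset HexVertex), hexDomainSimplyConnected Λ →
      (hexGraph.induce ((Λ : Finset HexVertex) : Set HexVertex)).Preconnected →
    ∀ (p q : Site 2), IsLatticeSite Λ p → ¬ IsInteriorSite Λ p → IsLatticeSite Λ q →
      ¬ IsInteriorSite Λ q →
      Relation.ReflTransGen (fun a b : Site 2 => a ≠ b ∧ ∃ v ∈ Λ, ∃ t : HexVertex, t ∉ Λ ∧
        hexGraph.Adj v t ∧ a ∈ hexFaceVertices v ∧ a ∈ hexFaceVertices t ∧
        b ∈ hexFaceVertices v ∧ b ∈ hexFaceVertices t) p q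

/-- **The boundary-site graph of a connected simply connected hex domain IS connected** — a
theorem of the tree (worker w-boundary). -/
theorem boundarySiteGraphConnected_holds : BoundarySiteGraphConnected :=
  Summit.CriticalPhenomena.SAWScalingLimit.Theorems.PickHalfPlane.BoundaryExactness.stub_halfPlaneInputs_boundarySiteGraphConnected

/-- **Reach from connectivity** — the landed parity/no-bridge argument (w-boundary, p93510). -/
theorem boundaryReach_of_connected (hC : BoundarySiteGraphConnected) : BoundaryReach :=
  Summit.CriticalPhenomena.SAWScalingLimit.Theorems.PickHalfPlane.BoundaryExactness.stub_halfPlaneInputs_boundaryReachOfConnected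
    hC

/-- **[A] from reach** — the landed bookkeeping (w-boundary, p91794/p92536/p93238). -/
theorem bookkeepingA_of_reach (hR : BoundaryReach) : BookkeepingA := by
  obtain ⟨K, hK⟩ :=
    Summit.CriticalPhenomena.SAWScalingLimit.Theorems.PickHalfPlane.BoundaryExactness.stub_halfPlaneInputs_boundaryBookkeepingOfReach
  exact ⟨K, fun Λ hΛ hco m k₁ k₂ ka hseg hka₁ hka₂ ub wb hadj hub hwb hoff H hH sb hsbu hsbw s hs hns =>
    hK Λ hΛ hco m k₁ k₂ ka hseg hka₁ hka₂ ub wb hadj hub hwb hoff H hH sb hsbu hsbw s hs hns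
      (hR Λ hΛ hco m k₁ k₂ ka hseg hka₁ hka₂ ub wb hadj hub hwb hoff sb hsbu hsbw s hs hns)⟩

/-- **[D] FAR-ARRIVAL TIGHTNESS** — NO LONGER REGISTERED (lead c1, reshape r11: PRESUMABLY FALSE in the
crux's generality; kept as the hypothesis of the landed reduction `boundaryHalfPlaneBounds_of` for
lattice-regular families).  Falsity mechanism (evidence `FarArrivalTight-false.md` on the item): for a
Dobrushin carrier with multifractal boundary (any quasicircle with non-trivial integral-means spectrum,
e.g. a snowflake arc between the two flat pieces), or for a smooth carrier discretised with a
lattice-fractal decoration of the free `o(1)` collar, the far sum `δ·Σ_far Z_δ(e)/Z_δ(b_δ)` is the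
`3/8`-integral mean `∫ |ψ'(u + iδ)|^{3/8} du` of the inverse uniformiser `ψ : ℍ → Ω`
(`Z_δ(e) ≍ δ^{5/4}|φ'|^{5/8}` edge by edge, `|dy| = |ψ'| du`), which diverges like `δ^{-β_ψ(3/8)}`,
`β_ψ` the integral-means spectrum (`> 0` off `0` for multifractal boundaries, Makarov); the bound it
served (`HalfPlaneBounds`) stays continuum-true because `h = c∫ψ'^{3/8}` converges absolutely along
INTERIOR hyperbolic geodesics (Koebe `|ψ'(u+iv)| ≤ 4·diam/v`, `∫₀ v^{-3/8} dv < ∞`), not along the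
boundary.  Original description (lead reshape r6): in units of the normaliser's
arrival mass, the total arrival mass of the boundary darts at macroscopic distance from the root is
`O(1/δ)`: `δ·Σ_{e ∈ ∂Λ_δ, δ·mid e ∉ ball(x, min(r,‖x − pt 1‖)/2)} Z_δ(e) ≤ C·Z_δ(b δ)` eventually.
Continuum shadow: `∫_{∂Ω ∖ B(x,r₀)} |φ'|^{5/8}|dy| < ∞` for every bounded carrier (Koebe; corner
singularities `|y−y₀|^{(π/α−1)5/8}` are integrable even at slit tips).  KNOWN RISK (lead, r10): the
statement is plausible for lattice-regular families but presumably FALSE for HAIRY admissible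
families — `1/δ` needles of `L(δ) → ∞` lattice lengths (macroscopic length `L δ → 0`, so exhaustion
and the pins are respected) carry tip masses enhanced like `L^{25/48}` (boundary-to-bulk crossover),
making the far sum `≫ Z(b δ)/δ`, while the bound it serves (`BoundaryHalfPlaneBounds`) stays true
there: single-valuedness of `H` (interior shortcuts across the needle bases, vertex relations across
a width-1 spine) cancels what the absolute sum of [A] counts.  If a refuter files that witness, the
repair is a cancellation-aware bookkeeping (route [A] through the lattice-scale hull of the boundary),
NOT a change of line; the registered conjunct would become the far mass of the hull contour. -/
def FarArrivalTight : Prop :=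
  ∀ (D : DobrushinDomain) (ρ : ℝ) (Λ : ℝ → Finset HexVertex) (m : ℝ → ℤ) (b : ℝ → Sym2 HexVertex),
    AdmissibleFamily D ρ Λ m b →
  ∀ (x : ℂ) (e : ℝ → Sym2 HexVertex) (r : ℝ) (mr : ℝ → ℤ), PinnedFlatRoot D Λ b x e r mr → x ≠ D.pt 1 →
  ∃ C : ℝ, ∀ᶠ δ : ℝ in 𝓝[>] 0,
    δ * (∑ v ∈ Λ δ, ∑ t ∈ (nbrs v).filter (· ∉ Λ δ),
        if (δ : ℂ) * hexMidpoint s(t, v) ∉ Metric.ball x (min r ‖x - D.pt 1‖ / 2)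
        then ‖hexParafermionicObservable (Λ δ) (e δ) hexCriticalFugacity 0 s(t, v)‖ else 0) ≤
      C * ‖hexParafermionicObservable (Λ δ) (e δ) hexCriticalFugacity 0 (b δ)‖

/-- `BoundaryHalfPlaneBounds` from reach + [D] — [A] is the landed bookkeeping, glue = the landed
`GateMass.halfPlaneInputs_farReduction'` (w-gatemass, p92205). -/
theorem boundaryHalfPlaneBounds_of (hD : FarArrivalTight) : BoundaryHalfPlaneBounds :=
  Summit.CriticalPhenomena.SAWScalingLimit.Theorems.PickHalfPlane.GateMass.halfPlaneInputs_farReduction'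
    (bookkeepingA_of_reach (boundaryReach_of_connected boundarySiteGraphConnected_holds)) hD

/-- STUB 3 statement — **positive-mass laws for boundary arrival masses** (`Z = F_{x_c,0}` from the
pinned root, lattice statements about POSITIVE, domain-monotone quantities; no cancellation;
lead reshape r3 after worker w-engine's `stub-misstated`: clause (a) is now the UNIFORM-IN-SCALE
two-sided DENSITY law on BOTH flat pieces, which is what Schwarz reflection / the non-degeneracy
of the boundary derivative `h'(y)` at every flat point consume — the per-window comparability of
r1/r2 allowed a trace density vanishing to even order):
(a) FLAT DENSITY LAW: for every centre `y` on the gate piece or on the root's own flat piece and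
  every `ρ₀` with `closedBall y ρ₀` inside the pinned ball and the root at distance `≥ 2ρ₀`, there
  is ONE `C` such that for all window radii `ρ' ≤ ρ₀`, eventually
  `C⁻¹ ρ' Z(b_δ) ≤ δ Σ_{e' ∈ ∂Λ_δ, δ·mid e' ∈ ball y ρ'} Z(e') ≤ C ρ' Z(b_δ)`; conformally the
  density is `(Φ_x'(y)/Φ_x'(b))^{5/8} dy`, continuous and positive on both flat pieces off `x`;
(b) ROOT-ARM DIVERGENCE (ratio form, no absolute exponent): the arrival mass on the root's own flat
  piece to the east at macroscopic distance `∈ (η, r/2)`, in units of `Z(b_δ)/δ`, exceeds any `A`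
  for `η` small — along the exact straight arm this is `Re(conj ω · h_δ) → +∞` at the root, i.e.
  the singularity survives in the limit (predicted `δ Σ_{η<kδ<r/2} k^{-5/4} / δ^{5/4} ≍ η^{-1/4}`). -/
def FlatMassLaws : Prop :=
  ∀ (D : DobrushinDomain) (ρ : ℝ) (Λ : ℝ → Finset HexVertex) (m : ℝ → ℤ) (b : ℝ → Sym2 HexVertex),
    AdmissibleFamily D ρ Λ m b →
  ∀ (x : ℂ) (e : ℝ → Sym2 HexVertex) (r : ℝ) (mr : ℝ → ℤ), PinnedFlatRoot D Λ b x e r mr → x ≠ D.pt 1 →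
  let Z : ℝ → Sym2 HexVertex → ℝ := fun δ z =>
    ‖hexParafermionicObservable (Λ δ) (e δ) hexCriticalFugacity 0 z‖
  (∀ (y : ℂ) (ρ₀ : ℝ), 0 < ρ₀ →
      (y.im = (D.pt 1).im ∧ Metric.closedBall y ρ₀ ⊆ Metric.ball (D.pt 1) ρ ∨
        y.im = x.im ∧ Metric.closedBall y ρ₀ ⊆ Metric.ball x r) →
      x ∉ Metric.closedBall y (2 * ρ₀) →
    ∃ C : ℝ, 0 < C ∧ ∀ ρ' : ℝ, 0 < ρ' → ρ' ≤ ρ₀ → ∀ᶠ δ : ℝ in 𝓝[>] 0,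
      C⁻¹ * ρ' * Z δ (b δ) ≤ δ * ∑ᶠ e' ∈ {e' : Sym2 HexVertex | e' ∈ hexDomainBoundary (Λ δ) ∧
          (δ : ℂ) * hexMidpoint e' ∈ Metric.ball y ρ'}, Z δ e' ∧
      δ * ∑ᶠ e' ∈ {e' : Sym2 HexVertex | e' ∈ hexDomainBoundary (Λ δ) ∧
          (δ : ℂ) * hexMidpoint e' ∈ Metric.ball y ρ'}, Z δ e' ≤ C * ρ' * Z δ (b δ)) ∧
  (∀ A : ℝ, ∃ η : ℝ, 0 < η ∧ η < r / 2 ∧ ∀ᶠ δ : ℝ in 𝓝[>] 0,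
      A * Z δ (b δ) ≤ δ * ∑ᶠ e' ∈ {e' : Sym2 HexVertex | e' ∈ hexDomainBoundary (Λ δ) ∧
          (δ : ℂ) * hexMidpoint e' ∈ Metric.ball x (r / 2) ∧
          x.re + η < ((δ : ℂ) * hexMidpoint e').re}, Z δ e')

/-- **(a\*\*) FLAT DENSITY LAW, pointwise** (worker w-gatemass's reduction of `FlatMassLaws` (a),
p90369/p90782): two-sided comparability `C⁻¹ Z(b δ) ≤ Z(floorEdge k) ≤ C Z(b δ)` of the floor-dart
arrival masses in every window `ball y ρ₀` on the gate piece or on the root piece, root excluded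
(`x ∉ closedBall y (2ρ₀)`), ONE `C` per window uniformly in δ.  Positive-mass law; OPEN. -/
def FlatDensityLaw : Prop :=
  ∀ (D : DobrushinDomain) (ρ : ℝ) (Λ : ℝ → Finset HexVertex) (m : ℝ → ℤ) (b : ℝ → Sym2 HexVertex),
    AdmissibleFamily D ρ Λ m b →
  ∀ (x : ℂ) (e : ℝ → Sym2 HexVertex) (r : ℝ) (mr : ℝ → ℤ), PinnedFlatRoot D Λ b x e r mr → x ≠ D.pt 1 →
    ∀ (y : ℂ) (ρ₀ : ℝ), 0 < ρ₀ → x ∉ Metric.closedBall y (2 * ρ₀) →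
      (y.im = (D.pt 1).im → Metric.closedBall y ρ₀ ⊆ Metric.ball (D.pt 1) ρ →
        ∃ C : ℝ, 0 < C ∧ ∀ᶠ δ : ℝ in 𝓝[>] 0, ∀ k : ℤ,
          (δ : ℂ) * hexMidpoint s((((![k, m δ - 1] : Site 2)), (1 : Fin 2)), ((![k, m δ] : Site 2), (0 : Fin 2))) ∈ Metric.ball y ρ₀ →
          C⁻¹ * ‖hexParafermionicObservable (Λ δ) (e δ) hexCriticalFugacity 0 (b δ)‖ ≤
              ‖hexParafermionicObservable (Λ δ) (e δ) hexCriticalFugacity 0 s((((![k, m δ - 1] : Site 2)), (1 : Fin 2)), ((![k, m δ] : Site 2), (0 : Fin 2)))‖ ∧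
            ‖hexParafermionicObservable (Λ δ) (e δ) hexCriticalFugacity 0 s((((![k, m δ - 1] : Site 2)), (1 : Fin 2)), ((![k, m δ] : Site 2), (0 : Fin 2)))‖ ≤
              C * ‖hexParafermionicObservable (Λ δ) (e δ) hexCriticalFugacity 0 (b δ)‖) ∧
      (y.im = x.im → Metric.closedBall y ρ₀ ⊆ Metric.ball x r →
        ∃ C : ℝ, 0 < C ∧ ∀ᶠ δ : ℝ in 𝓝[>] 0, ∀ k : ℤ,
          (δ : ℂ) * hexMidpoint s((((![k, mr δ - 1] : Site 2)), (1 : Fin 2)), ((![k, mr δ] : Site 2), (0 : Fin 2))) ∈ Metric.ball y ρ₀ →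
          C⁻¹ * ‖hexParafermionicObservable (Λ δ) (e δ) hexCriticalFugacity 0 (b δ)‖ ≤
              ‖hexParafermionicObservable (Λ δ) (e δ) hexCriticalFugacity 0 s((((![k, mr δ - 1] : Site 2)), (1 : Fin 2)), ((![k, mr δ] : Site 2), (0 : Fin 2)))‖ ∧
            ‖hexParafermionicObservable (Λ δ) (e δ) hexCriticalFugacity 0 s((((![k, mr δ - 1] : Site 2)), (1 : Fin 2)), ((![k, mr δ] : Site 2), (0 : Fin 2)))‖ ≤
              C * ‖hexParafermionicObservable (Λ δ) (e δ) hexCriticalFugacity 0 (b δ)‖)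

/-- **FLAT DENSITY LAW, lower half** (lead c1 reshape r12): the positive-mass LOWER bound
`C⁻¹ Z(b δ) ≤ Z(floorEdge k)` of `FlatDensityLaw` alone (boundary Harnack from below on the exact flat
pieces; the genuinely open half — model input). -/
def FlatDensityLower : Prop :=
  ∀ (D : DobrushinDomain) (ρ : ℝ) (Λ : ℝ → Finset HexVertex) (m : ℝ → ℤ) (b : ℝ → Sym2 HexVertex),
    AdmissibleFamily D ρ Λ m b →
  ∀ (x : ℂ) (e : ℝ → Sym2 HexVertex) (r : ℝ) (mr : ℝ → ℤ), PinnedFlatRoot D Λ b x e r mr → x ≠ D.pt 1 →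
    ∀ (y : ℂ) (ρ₀ : ℝ), 0 < ρ₀ → x ∉ Metric.closedBall y (2 * ρ₀) →
      (y.im = (D.pt 1).im → Metric.closedBall y ρ₀ ⊆ Metric.ball (D.pt 1) ρ →
        ∃ C : ℝ, 0 < C ∧ ∀ᶠ δ : ℝ in 𝓝[>] 0, ∀ k : ℤ,
          (δ : ℂ) * hexMidpoint s((((![k, m δ - 1] : Site 2)), (1 : Fin 2)), ((![k, m δ] : Site 2), (0 : Fin 2))) ∈ Metric.ball y ρ₀ →
          C⁻¹ * ‖hexParafermionicObservable (Λ δ) (e δ) hexCriticalFugacity 0 (b δ)‖ ≤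
              ‖hexParafermionicObservable (Λ δ) (e δ) hexCriticalFugacity 0 s((((![k, m δ - 1] : Site 2)), (1 : Fin 2)), ((![k, m δ] : Site 2), (0 : Fin 2)))‖) ∧
      (y.im = x.im → Metric.closedBall y ρ₀ ⊆ Metric.ball x r →
        ∃ C : ℝ, 0 < C ∧ ∀ᶠ δ : ℝ in 𝓝[>] 0, ∀ k : ℤ,
          (δ : ℂ) * hexMidpoint s((((![k, mr δ - 1] : Site 2)), (1 : Fin 2)), ((![k, mr δ] : Site 2), (0 : Fin 2))) ∈ Metric.ball y ρ₀ →
          C⁻¹ * ‖hexParafermionicObservable (Λ δ) (e δ) hexCriticalFugacity 0 (b δ)‖ ≤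
              ‖hexParafermionicObservable (Λ δ) (e δ) hexCriticalFugacity 0 s((((![k, mr δ - 1] : Site 2)), (1 : Fin 2)), ((![k, mr δ] : Site 2), (0 : Fin 2)))‖)

/-- **FLAT DENSITY LAW, upper half** (lead c1 reshape r12): the UPPER bound `Z(floorEdge k) ≤ C Z(b δ)`
of `FlatDensityLaw` alone — DERIVABLE from `LocalSupBound` (the two upper edges of the up-face over a
floor edge have midpoints in a compact of `carrier ∪ flat pieces` off the root, and the vertex relation
at that face bounds the floor value by their sum; on boundary edges `‖F_{5/8}‖ = Z`): STUB 3b. -/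
def FlatDensityUpper : Prop :=
  ∀ (D : DobrushinDomain) (ρ : ℝ) (Λ : ℝ → Finset HexVertex) (m : ℝ → ℤ) (b : ℝ → Sym2 HexVertex),
    AdmissibleFamily D ρ Λ m b →
  ∀ (x : ℂ) (e : ℝ → Sym2 HexVertex) (r : ℝ) (mr : ℝ → ℤ), PinnedFlatRoot D Λ b x e r mr → x ≠ D.pt 1 →
    ∀ (y : ℂ) (ρ₀ : ℝ), 0 < ρ₀ → x ∉ Metric.closedBall y (2 * ρ₀) →
      (y.im = (D.pt 1).im → Metric.closedBall y ρ₀ ⊆ Metric.ball (D.pt 1) ρ →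
        ∃ C : ℝ, 0 < C ∧ ∀ᶠ δ : ℝ in 𝓝[>] 0, ∀ k : ℤ,
          (δ : ℂ) * hexMidpoint s((((![k, m δ - 1] : Site 2)), (1 : Fin 2)), ((![k, m δ] : Site 2), (0 : Fin 2))) ∈ Metric.ball y ρ₀ →
          ‖hexParafermionicObservable (Λ δ) (e δ) hexCriticalFugacity 0 s((((![k, m δ - 1] : Site 2)), (1 : Fin 2)), ((![k, m δ] : Site 2), (0 : Fin 2)))‖ ≤
              C * ‖hexParafermionicObservable (Λ δ) (e δ) hexCriticalFugacity 0 (b δ)‖) ∧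
      (y.im = x.im → Metric.closedBall y ρ₀ ⊆ Metric.ball x r →
        ∃ C : ℝ, 0 < C ∧ ∀ᶠ δ : ℝ in 𝓝[>] 0, ∀ k : ℤ,
          (δ : ℂ) * hexMidpoint s((((![k, mr δ - 1] : Site 2)), (1 : Fin 2)), ((![k, mr δ] : Site 2), (0 : Fin 2))) ∈ Metric.ball y ρ₀ →
          ‖hexParafermionicObservable (Λ δ) (e δ) hexCriticalFugacity 0 s((((![k, mr δ - 1] : Site 2)), (1 : Fin 2)), ((![k, mr δ] : Site 2), (0 : Fin 2)))‖ ≤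
              C * ‖hexParafermionicObservable (Λ δ) (e δ) hexCriticalFugacity 0 (b δ)‖)


/-- `FlatDensityLaw` from its two halves (lead c1 reshape r12; constants combined by `max`). [folklore] -/
theorem flatDensityLaw_of (hl : FlatDensityLower) (hu : FlatDensityUpper) : FlatDensityLaw := by
  intro D ρ Λ m b hAF x e r mr hPR hx y ρ₀ hρ₀ hxy
  have HL := hl D ρ Λ m b hAF x e r mr hPR hx y ρ₀ hρ₀ hxy
  have HU := hu D ρ Λ m b hAF x e r mr hPR hx y ρ₀ hρ₀ hxy
  refine ⟨fun hy hsub => ?_, fun hy hsub => ?_⟩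
  · obtain ⟨Cl, hCl, hl'⟩ := HL.1 hy hsub
    obtain ⟨Cu, hCu, hu'⟩ := HU.1 hy hsub
    refine ⟨max Cl Cu, lt_max_of_lt_left hCl, ?_⟩
    filter_upwards [hl', hu'] with δ h1 h2 k hk
    refine ⟨le_trans ?_ (h1 k hk), (h2 k hk).trans ?_⟩
    · exact mul_le_mul_of_nonneg_right (inv_anti₀ hCl (le_max_left _ _)) (norm_nonneg _)
    · exact mul_le_mul_of_nonneg_right (le_max_right _ _) (norm_nonneg _)
  · obtain ⟨Cl, hCl, hl'⟩ := HL.2 hy hsub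
    obtain ⟨Cu, hCu, hu'⟩ := HU.2 hy hsub
    refine ⟨max Cl Cu, lt_max_of_lt_left hCl, ?_⟩
    filter_upwards [hl', hu'] with δ h1 h2 k hk
    refine ⟨le_trans ?_ (h1 k hk), (h2 k hk).trans ?_⟩
    · exact mul_le_mul_of_nonneg_right (inv_anti₀ hCl (le_max_left _ _)) (norm_nonneg _)
    · exact mul_le_mul_of_nonneg_right (le_max_right _ _) (norm_nonneg _)

/-- **(b\*) ROOT-ARM LAW, pointwise** (w-gatemass's reduction of `FlatMassLaws` (b), p90143): on the
root's own floor at macroscopic distance `∈ (η, r/2)` east of the root, `(Re(δ·mid) − Re x)·Z(floorEdge) ≥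
κ·Z(b δ)` eventually — the arm mass density decays no faster than `1/distance` in units of `Z(b δ)/δ`
(predicted `distance^{−5/4}·δ^{−1/4}`, much more).  Keep the `∀ η > 0, eventually` order (the
all-columns form is expected false for roots converging slower than `δ^{4/5}`).  Positive-mass; OPEN. -/
def RootArmLaw : Prop :=
  ∀ (D : DobrushinDomain) (ρ : ℝ) (Λ : ℝ → Finset HexVertex) (m : ℝ → ℤ) (b : ℝ → Sym2 HexVertex),
    AdmissibleFamily D ρ Λ m b →
  ∀ (x : ℂ) (e : ℝ → Sym2 HexVertex) (r : ℝ) (mr : ℝ → ℤ), PinnedFlatRoot D Λ b x e r mr → x ≠ D.pt 1 →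
    ∃ κ : ℝ, 0 < κ ∧ ∀ η : ℝ, 0 < η → ∀ᶠ δ : ℝ in 𝓝[>] 0, ∀ k : ℤ,
      (δ : ℂ) * hexMidpoint s((((![k, mr δ - 1] : Site 2)), (1 : Fin 2)), ((![k, mr δ] : Site 2), (0 : Fin 2))) ∈ Metric.ball x (r / 2) →
      η < ((δ : ℂ) * hexMidpoint s((((![k, mr δ - 1] : Site 2)), (1 : Fin 2)), ((![k, mr δ] : Site 2), (0 : Fin 2)))).re - x.re →
      κ * ‖hexParafermionicObservable (Λ δ) (e δ) hexCriticalFugacity 0 (b δ)‖ ≤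
        (((δ : ℂ) * hexMidpoint s((((![k, mr δ - 1] : Site 2)), (1 : Fin 2)), ((![k, mr δ] : Site 2), (0 : Fin 2)))).re - x.re) *
          ‖hexParafermionicObservable (Λ δ) (e δ) hexCriticalFugacity 0 s((((![k, mr δ - 1] : Site 2)), (1 : Fin 2)), ((![k, mr δ] : Site 2), (0 : Fin 2)))‖

/-- `FlatMassLaws` from the two pointwise laws — the landed glue (w-gatemass, p90782). -/
theorem flatMassLaws_of (hA : FlatDensityLaw) (hB : RootArmLaw) : FlatMassLaws :=
  Summit.CriticalPhenomena.SAWScalingLimit.Theorems.PickHalfPlane.GateMass.flatMassLaws_of_pointwise hA hB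

/-- STUB 4 statement — **the local `L¹` law** (the residual input shared by EVERY line of this crux,
Banach–Steinhaus-necessary for continuous test functions; triage r1-3 §3 "state the C¹/C² → C⁰ step
as its own stub"): on compacts of `Ω` the `b`-normalised observable has bounded `L¹` mass,
`δ² Σ_{δ·mid z ∈ K} |F_δ(z)| ≤ C_K |F_δ(b_δ)|` eventually.  (The route's `MassRatio` gives only
`C δ^{-3/4}` for the MASSES `Z ≥ |F|`; the bound needs the `δ^{25/48}`-cancellation of the phases —
the crux's failure mode #2, isolated; used here ONLY to pass from `C¹` to `C⁰` test functions.) -/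
def LocalL1Bound : Prop :=
  ∀ (D : DobrushinDomain) (ρ : ℝ) (Λ : ℝ → Finset HexVertex) (m : ℝ → ℤ) (b : ℝ → Sym2 HexVertex),
    AdmissibleFamily D ρ Λ m b →
  ∀ (x : ℂ) (e : ℝ → Sym2 HexVertex) (r : ℝ) (mr : ℝ → ℤ), PinnedFlatRoot D Λ b x e r mr → x ≠ D.pt 1 →
  ∀ K : Set ℂ, IsCompact K → K ⊆ D.carrier → ∃ C : ℝ, ∀ᶠ δ : ℝ in 𝓝[>] 0,
    δ ^ 2 * (∑ᶠ z ∈ {z : Sym2 HexVertex | z ∈ hexDomainMidEdges (Λ δ) ∧ (δ : ℂ) * hexMidpoint z ∈ K},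
        ‖hexParafermionicObservable (Λ δ) (e δ) hexCriticalFugacity (5 / 8) z‖) ≤
      C * ‖hexParafermionicObservable (Λ δ) (e δ) hexCriticalFugacity (5 / 8) (b δ)‖

/-- **LOCAL SUP BOUND** (lead reshape r10; the line's one POINTWISE regularity input, registered as a
conjunct of `stub_localL1Bound`): the normalised observable `F_δ/F_δ(b δ)` is uniformly bounded on
every compact of the carrier TOGETHER WITH the two flat pieces, away from the root.  Implies
`LocalL1Bound` (area count) and the L¹ law up to the flat pieces; gives equicontinuity of the
developing maps `h_δ` (|∇h_δ| = |F/F(b)|/(2√3)) up to the flat pieces, hence continuous extension of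
subsequential limits there — the source of the engine's (I1)/(I4) continuity clauses (the arm/line
conditions then pass from the exact lattice facts `rootArms`/`gate_re_eq_zero`, the linear growth
at the gate from `FlatDensityLaw`'s lower bound + reflection).  Continuum shadow: `|φ'|^{5/8}`-ratios
are bounded up to flat boundary arcs away from the root.  NOT necessary for the weak target (unlike
`LocalL1Bound`, p88459): a genuine no-spike regularity statement about the observable ratio at
every single mid-edge (bounded lattice-scale orientation factors are allowed); OPEN. -/
def LocalSupBound : Prop :=
  ∀ (D : DobrushinDomain) (ρ : ℝ) (Λ : ℝ → Finset HexVertex) (m : ℝ → ℤ) (b : ℝ → Sym2 HexVertex),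
    AdmissibleFamily D ρ Λ m b →
  ∀ (x : ℂ) (e : ℝ → Sym2 HexVertex) (r : ℝ) (mr : ℝ → ℤ), PinnedFlatRoot D Λ b x e r mr → x ≠ D.pt 1 →
  ∀ K : Set ℂ, IsCompact K → K ⊆ D.carrier ∪ flatPoints D ρ x r → x ∉ K →
    ∃ C : ℝ, ∀ᶠ δ : ℝ in 𝓝[>] 0, ∀ z ∈ hexDomainMidEdges (Λ δ), (δ : ℂ) * hexMidpoint z ∈ K →
      ‖hexParafermionicObservable (Λ δ) (e δ) hexCriticalFugacity (5 / 8) z‖ ≤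
        C * ‖hexParafermionicObservable (Λ δ) (e δ) hexCriticalFugacity (5 / 8) (b δ)‖

/-- STUB 5 conclusion — **interior Pick limits**: for every admissible family and every pinned flat
root other than the normalisation point, every mesh sequence has a subsequence along which the
normalised functionals converge weakly (continuous test functions) to an interior Pick limit. -/
def InteriorLimits : Prop :=
  ∀ (D : DobrushinDomain) (ρ : ℝ) (Λ : ℝ → Finset HexVertex) (m : ℝ → ℤ) (b : ℝ → Sym2 HexVertex),
    AdmissibleFamily D ρ Λ m b →
  ∀ (x : ℂ) (e : ℝ → Sym2 HexVertex) (r : ℝ) (mr : ℝ → ℤ), PinnedFlatRoot D Λ b x e r mr → x ≠ D.pt 1 →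
  ∀ ns : ℕ → ℝ, Tendsto ns atTop (𝓝[>] 0) →
    ∃ ms : ℕ → ℕ, StrictMono ms ∧ ∃ g : ℂ → ℂ,
      IsInteriorPickLimit D ρ x r g ∧ IsWeakLimit D Λ e b (ns ∘ ms) g

/-- STUB 6 conclusion — **Pick–cup limits**: the same with the export contract the identification
consumes (order `5/4` at the root with nonzero coefficient, nonzero boundary values at the other
flat points).  This is `TwoRootQuotient.CupLimits` with `IsCupLimit` replaced by `IsPickCupLimit`
(zero-freeness dropped). -/
def PickCupLimits : Prop :=
  ∀ (D : DobrushinDomain) (ρ : ℝ) (Λ : ℝ → Finset HexVertex) (m : ℝ → ℤ) (b : ℝ → Sym2 HexVertex),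
    AdmissibleFamily D ρ Λ m b →
  ∀ (x : ℂ) (e : ℝ → Sym2 HexVertex) (r : ℝ) (mr : ℝ → ℤ), PinnedFlatRoot D Λ b x e r mr → x ≠ D.pt 1 →
  ∀ ns : ℕ → ℝ, Tendsto ns atTop (𝓝[>] 0) →
    ∃ ms : ℕ → ℕ, StrictMono ms ∧ ∃ g : ℂ → ℂ, IsPickCupLimit D ρ x r g ∧ IsWeakLimit D Λ e b (ns ∘ ms) g

/-- **THE DEVELOPING MAPS CONVERGE** (lead c1 reshape r13 = seat -1's predicate, verbatim the
hypothesis of its landed `developingMapLimitHolomorphic`, p-id in `…DevelopingMapLimit.lean`): along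
the mesh sequence `ns`, `h` is continuous on `(carrier ∪ flat pieces) ∖ {x}` and is the locally uniform
limit there of the normalised developing maps `h_δ(s) = δ·(H s − H s_b)/F_δ(b δ)` (`H` any potential
of the root-`e δ` observable, `s_b` either site of the normaliser edge, lattice sites embedded by
`δ·triEmbed s`). -/
def DevelopingMapsConverge (D : DobrushinDomain) (ρ : ℝ) (Λ : ℝ → Finset HexVertex)
    (b : ℝ → Sym2 HexVertex) (x : ℂ) (e : ℝ → Sym2 HexVertex) (r : ℝ) (ns : ℕ → ℝ) (h : ℂ → ℂ) :
    Prop :=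
  ContinuousOn h ((D.carrier ∪ flatPoints D ρ x r) \ {x}) ∧
  (∀ K : Set ℂ, IsCompact K → K ⊆ (D.carrier ∪ flatPoints D ρ x r) \ {x} →
    ∀ ε : ℝ, 0 < ε → ∀ᶠ n : ℕ in atTop, ∀ H : Site 2 → ℂ, IsPotential (Λ (ns n)) (e (ns n)) H →
      ∀ (ub wb : HexVertex), b (ns n) = s(ub, wb) →
      ∀ sb : Site 2, sb ∈ hexFaceVertices ub → sb ∈ hexFaceVertices wb →
      ∀ s : Site 2, IsLatticeSite (Λ (ns n)) s → ((ns n : ℝ) : ℂ) * triEmbed s ∈ K →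
        ‖((ns n : ℝ) : ℂ) * (H s - H sb) /
              hexParafermionicObservable (Λ (ns n)) (e (ns n)) hexCriticalFugacity (5 / 8) (b (ns n)) -
            h (((ns n : ℝ) : ℂ) * triEmbed s)‖ < ε)

/-- STUB 5a conclusion (lead c1 reshape r13 = seat -1's stub 5a) — **compactness of the developing
maps**: for every admissible family, pinned flat root `x ≠ pt 1` and mesh sequence, some subsequence
carries a limit `h` with `DevelopingMapsConverge` (equicontinuity from `LocalSupBound` + Arzelà–Ascoli
on lattice functions; seat -1's `…DevelopingMapsCompact{Core,Steps}` are its landed lattice half). -/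
def DevelopingMapsCompact : Prop :=
  ∀ (D : DobrushinDomain) (ρ : ℝ) (Λ : ℝ → Finset HexVertex) (m : ℝ → ℤ) (b : ℝ → Sym2 HexVertex),
    AdmissibleFamily D ρ Λ m b →
  ∀ (x : ℂ) (e : ℝ → Sym2 HexVertex) (r : ℝ) (mr : ℝ → ℤ), PinnedFlatRoot D Λ b x e r mr → x ≠ D.pt 1 →
  ∀ ns : ℕ → ℝ, Tendsto ns atTop (𝓝[>] 0) →
    ∃ ms : ℕ → ℕ, StrictMono ms ∧ ∃ h : ℂ → ℂ, DevelopingMapsConverge D ρ Λ b x e r (ns ∘ ms) h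

/-- **ENGINE LIMIT** (lead c1 reshapes r11/r13; the hand-over to the boundary-data stub): along the
mesh sequence `ns`, the developing maps converge to `h` (`DevelopingMapsConverge`), `h` is holomorphic
on the carrier with `h' = α g` (`α ≠ 0`), and `g` is holomorphic and the weak limit of the normalised
functionals (continuous test functions). -/
def IsEngineLimit (D : DobrushinDomain) (ρ : ℝ) (Λ : ℝ → Finset HexVertex) (b : ℝ → Sym2 HexVertex)
    (x : ℂ) (e : ℝ → Sym2 HexVertex) (r : ℝ) (ns : ℕ → ℝ) (h g : ℂ → ℂ) (α : ℂ) : Prop :=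
  α ≠ 0 ∧ DifferentiableOn ℂ g D.carrier ∧ DifferentiableOn ℂ h D.carrier ∧
  (∀ z ∈ D.carrier, deriv h z = α * g z) ∧
  IsWeakLimit D Λ e b ns g ∧
  DevelopingMapsConverge D ρ Λ b x e r ns h

/-- STUB 5 conclusion (lead c1 reshape r11) — **engine limits exist along subsequences**: for every
admissible family, pinned flat root `x ≠ pt 1` and mesh sequence, some subsequence carries an engine
limit `(h, g, α)`. -/
def EngineLimits : Prop :=
  ∀ (D : DobrushinDomain) (ρ : ℝ) (Λ : ℝ → Finset HexVertex) (m : ℝ → ℤ) (b : ℝ → Sym2 HexVertex),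
    AdmissibleFamily D ρ Λ m b →
  ∀ (x : ℂ) (e : ℝ → Sym2 HexVertex) (r : ℝ) (mr : ℝ → ℤ), PinnedFlatRoot D Λ b x e r mr → x ≠ D.pt 1 →
  ∀ ns : ℕ → ℝ, Tendsto ns atTop (𝓝[>] 0) →
    ∃ ms : ℕ → ℕ, StrictMono ms ∧ ∃ (h g : ℂ → ℂ) (α : ℂ), IsEngineLimit D ρ Λ b x e r (ns ∘ ms) h g α

/-- STUB 6 conclusion (lead c1 reshape r11) — **boundary data of engine limits**: every engine limit
satisfies VERBATIM the hypotheses (I1)–(I4) of the landed `Engine.pickEngine_stage2`: a radius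
`0 < r₀ ≤ r`, continuity on the punctured closed half-disc at the root, the two straight arms through
one point `p` (east phase `θ`, west phase `θ − π/4`), a unimodular wedge direction `ω` compatible with
`θ` (`0 < re(ω e^{−iθ})`, `im(ω e^{−iθ}) < re(ω e^{−iθ})`), the wedge `−M ≤ re(ω̄ h)` there,
unboundedness of `h` at the root from inside the carrier, and at every flat point `y ≠ x` a closed
half-disc of continuity whose diameter is mapped into a line with at-least-linear normal growth. -/
def EngineBoundaryData : Prop :=
  ∀ (D : DobrushinDomain) (ρ : ℝ) (Λ : ℝ → Finset HexVertex) (m : ℝ → ℤ) (b : ℝ → Sym2 HexVertex),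
    AdmissibleFamily D ρ Λ m b →
  ∀ (x : ℂ) (e : ℝ → Sym2 HexVertex) (r : ℝ) (mr : ℝ → ℤ), PinnedFlatRoot D Λ b x e r mr → x ≠ D.pt 1 →
  ∀ ns : ℕ → ℝ, Tendsto ns atTop (𝓝[>] 0) →
  ∀ (h g : ℂ → ℂ) (α : ℂ), IsEngineLimit D ρ Λ b x e r ns h g α →
    ∃ (r₀ : ℝ) (p ω : ℂ) (θ M : ℝ), 0 < r₀ ∧ r₀ ≤ r ∧
      ContinuousOn h (({z : ℂ | x.im ≤ z.im} ∩ Metric.ball x r₀) \ {x}) ∧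
      (∀ z ∈ Metric.ball x r₀, z.im = x.im → x.re < z.re →
        ∃ s : ℝ, h z = p + Complex.exp ((θ : ℂ) * Complex.I) * s) ∧
      (∀ z ∈ Metric.ball x r₀, z.im = x.im → z.re < x.re →
        ∃ s : ℝ, h z = p + Complex.exp (((θ - Real.pi / 4 : ℝ) : ℂ) * Complex.I) * s) ∧
      ‖ω‖ = 1 ∧ 0 < (ω * Complex.exp (-((θ : ℂ) * Complex.I))).re ∧
      (ω * Complex.exp (-((θ : ℂ) * Complex.I))).im < (ω * Complex.exp (-((θ : ℂ) * Complex.I))).re ∧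
      (∀ z ∈ ({z : ℂ | x.im ≤ z.im} ∩ Metric.ball x r₀) \ {x}, -M ≤ ((starRingEnd ℂ) ω * h z).re) ∧
      (∀ A : ℝ, ∃ᶠ z in 𝓝[D.carrier] x, A ≤ ‖h z‖) ∧
      (∀ y ∈ ({z : ℂ | z.im = (D.pt 1).im} ∩ Metric.ball (D.pt 1) ρ) ∪
          ({z : ℂ | z.im = x.im} ∩ Metric.ball x r), y ≠ x →
        ∃ ρ' : ℝ, 0 < ρ' ∧ ∃ θ' : ℝ, ∃ p' : ℂ, ∃ c' : ℝ, 0 < c' ∧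
          ContinuousOn h ({z : ℂ | y.im ≤ z.im} ∩ Metric.ball y ρ') ∧
          (∀ z ∈ Metric.ball y ρ', z.im = y.im →
            (Complex.exp (-((θ' : ℂ) * Complex.I)) * (h z - p')).im = 0) ∧
          (∀ t : ℝ, 0 < t → t < ρ' → c' * t ≤
            |(Complex.exp (-((θ' : ℂ) * Complex.I)) * (h (y + (t : ℂ) * Complex.I) - p')).im|))

/-- STUB 7 conclusion — **identification** of every subsequential Pick–cup limit of the TARGET's
root with ONE universal constant: `g = c · exp((5/8)(L - L_b))` on the domain.
(`TwoRootQuotient.Identification` with `IsCupLimit` replaced by `IsPickCupLimit`.) -/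
def Identification : Prop :=
  ∃ c : ℂ, c ≠ 0 ∧
  ∀ (D : DobrushinDomain) (ρ : ℝ) (Λ : ℝ → Finset HexVertex) (m : ℝ → ℤ) (b : ℝ → Sym2 HexVertex),
    AdmissibleFamily D ρ Λ m b →
  ∀ (a : ℝ → Sym2 HexVertex) (r₀ : ℝ) (m₀ : ℝ → ℤ), PinnedFlatRoot D Λ b (D.pt 0) a r₀ m₀ →
  ∀ (Φ : ConformalEquiv D.carrier UpperHalfPlane.upperHalfPlaneSet) (L : ℂ → ℂ) (Lb : ℂ),
    Tendsto (fun z => ‖Φ z‖) (𝓝[D.carrier] (D.pt 0)) atTop → Φ.HasBoundaryValue (D.pt 1) 0 →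
    ContinuousOn L D.carrier → (∀ z ∈ D.carrier, Complex.exp (L z) = deriv Φ z) →
    Tendsto L (𝓝[D.carrier] (D.pt 1)) (𝓝 Lb) →
  ∀ ns : ℕ → ℝ, Tendsto ns atTop (𝓝[>] 0) →
  ∀ g : ℂ → ℂ, IsPickCupLimit D ρ (D.pt 0) r₀ g → IsWeakLimit D Λ a b ns g →
    ∀ z ∈ D.carrier, g z = c * Complex.exp ((5 / 8 : ℂ) * (L z - Lb))

/-- **GATE TRACE** (lead reshape r10; the open content of the identification half after worker
w-ident's landings p93268 `identification_of_modulusPhase`, p93380 `identification_gateReflection`,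
p94078 `identification_of_gateTrace`): ONE universal `c ≠ 0` such that every Pick–cup weak limit `g`
of the target's root satisfies `g·exp(−(5/8)(L − L_b)) → c` within the carrier at EVERY point of the
flat gate.  Content: (a) boundary regularity of the conformal data along the flat gate (Schwarz
reflection of `Φ`: `Im Φ → 0` there — Carathéodory-type, classical, not yet in the tree); (b) the
lattice trace of the Pick–cup limit (`‖w_y‖ = ‖c‖·|e^{(5/8)(L(y)−L_b)}|`, `arg w_y = arg c`) = the
sibling line's RootRatioLaw / FlatLocality / FlatTrace in Pick form + reciprocity (p84340) + arc
constancy (p87349), with auxiliary pinned roots at every gate point; zero-freeness enters only inside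
the two-root quotient. -/
def GateTrace : Prop :=
  ∃ c : ℂ, c ≠ 0 ∧
    ∀ (D : DobrushinDomain) (ρ : ℝ) (Λ : ℝ → Finset HexVertex) (m : ℝ → ℤ) (b : ℝ → Sym2 HexVertex),
      AdmissibleFamily D ρ Λ m b →
    ∀ (a : ℝ → Sym2 HexVertex) (r₀ : ℝ) (m₀ : ℝ → ℤ), PinnedFlatRoot D Λ b (D.pt 0) a r₀ m₀ →
    ∀ (Φ : ConformalEquiv D.carrier UpperHalfPlane.upperHalfPlaneSet) (L : ℂ → ℂ) (Lb : ℂ),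
      Tendsto (fun z => ‖Φ z‖) (𝓝[D.carrier] (D.pt 0)) atTop → Φ.HasBoundaryValue (D.pt 1) 0 →
      ContinuousOn L D.carrier → (∀ z ∈ D.carrier, Complex.exp (L z) = deriv Φ z) →
      Tendsto L (𝓝[D.carrier] (D.pt 1)) (𝓝 Lb) →
    ∀ ns : ℕ → ℝ, Tendsto ns atTop (𝓝[>] 0) →
    ∀ g : ℂ → ℂ, IsPickCupLimit D ρ (D.pt 0) r₀ g → IsWeakLimit D Λ a b ns g →
      ∀ y : ℂ, y.im = (D.pt 1).im → y ∈ Metric.ball (D.pt 1) ρ →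
        Tendsto (fun z => g z * Complex.exp (-((5 / 8 : ℂ) * (L z - Lb)))) (𝓝[D.carrier] y) (𝓝 c)

/-- `Identification` from the gate trace — the landed glue (w-ident, p94078: `L` is holomorphic,
then Schwarz reflection + identity theorem `identification_gateReflection`). -/
theorem identification_of_gateTrace (hG : GateTrace) : Identification :=
  Summit.CriticalPhenomena.SAWScalingLimit.Theorems.PickHalfPlane.Identification.identification_of_gateTrace hG

/-- **GATE BOUNDARY-VALUE LAW** (lead c1 reshape r12, adopting seat -1's landed reduction
`gateTrace_of_boundaryValueLaw`, p99342): the MODEL content of `GateTrace` — ONE universal `c ≠ 0`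
such that, for every admissible datum and every Pick–cup weak limit `g` of the target's root, at
every gate point `y ≠ D.pt 0` the boundary value `w` of `g` and the boundary value `L_y` of the
frame satisfy `w · exp(−(5/8)(L_y − L_b)) = c`, i.e. the gate values of the limit ARE
`c·(Φ'(y)/Φ'(b))^{5/8}` (Conjecture-2 strength on the flat gate: the sibling line's boundary arrival
profile in Pick form; crux-sized, OPEN).  The classical half of `GateTrace` (finite limits of `L` at
gate points off the root) is the landed `gateTrace_frameRegular` (p98312). -/
def GateBoundaryValueLaw : Prop :=
  ∃ c : ℂ, c ≠ 0 ∧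
    ∀ (D : DobrushinDomain) (ρ : ℝ) (Λ : ℝ → Finset HexVertex) (m : ℝ → ℤ) (b : ℝ → Sym2 HexVertex),
      AdmissibleFamily D ρ Λ m b →
    ∀ (a : ℝ → Sym2 HexVertex) (r₀ : ℝ) (m₀ : ℝ → ℤ), PinnedFlatRoot D Λ b (D.pt 0) a r₀ m₀ →
    ∀ (Φ : ConformalEquiv D.carrier UpperHalfPlane.upperHalfPlaneSet) (L : ℂ → ℂ) (Lb : ℂ),
      Tendsto (fun z => ‖Φ z‖) (𝓝[D.carrier] (D.pt 0)) atTop → Φ.HasBoundaryValue (D.pt 1) 0 →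
      ContinuousOn L D.carrier → (∀ z ∈ D.carrier, Complex.exp (L z) = deriv Φ z) →
      Tendsto L (𝓝[D.carrier] (D.pt 1)) (𝓝 Lb) →
    ∀ ns : ℕ → ℝ, Tendsto ns atTop (𝓝[>] 0) →
    ∀ g : ℂ → ℂ, IsPickCupLimit D ρ (D.pt 0) r₀ g → IsWeakLimit D Λ a b ns g →
      ∀ y : ℂ, y.im = (D.pt 1).im → y ∈ Metric.ball (D.pt 1) ρ → y ≠ D.pt 0 →
      ∀ w Ly : ℂ, Tendsto g (𝓝[D.carrier] y) (𝓝 w) → Tendsto L (𝓝[D.carrier] y) (𝓝 Ly) →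
        w * Complex.exp (-((5 / 8 : ℂ) * (Ly - Lb))) = c

/-- `GateTrace` from the gate boundary-value law — the landed reduction (seat -1, p99342) with the
landed frame regularity (p98312). -/
theorem gateTrace_of_law (hG : GateBoundaryValueLaw) : GateTrace :=
  Summit.CriticalPhenomena.SAWScalingLimit.Theorems.PickHalfPlane.Identification.gateTrace_of_boundaryValueLaw
    Summit.CriticalPhenomena.SAWScalingLimit.Theorems.PickHalfPlane.Identification.gateTrace_frameRegular hG

/-! ### 3′. Reshape r15 (lead c3, 2026-08-16 ~19Z): the TWO NECESSARY INPUTS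

The r14 composition needed four model inputs, three of which (`RootNoInteriorMax`,
`FlatDensityLower ∧ RootArmLaw`, `LocalSupBound`) serve only the boundary analysis of the Pick
engine (wedge, arms, flat values of the developing maps) and are NOT implied by the target.  The
line's own stage-1 machinery in `L¹` currency — all LANDED for `stub_pickEngine` (S1)/(S2):
weak-* subsequential limits from the local `L¹` law (`LocalL1.weakStarLimit_of_localL1`, p93817),
weak `∂̄`-closure from `ConjugateClassNegligible` (= DD + MR, `conjugateClassNegligible_of_exponent_cruxes`)
and Weyl's lemma on balls (`LocalL1.pickEngine_holomorphicWeakLimit`, p94468 / p91905), smooth →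
continuous tests (`pickEngine_repContinuous`, p94507) — produces HOLOMORPHIC subsequential weak
limits from the `L¹` law AT THE TARGET'S ROOT alone, once the local ball representatives are
patched into one holomorphic function on the carrier (`stub_holWeakLimits`, provable: uniqueness
on overlaps + a partition of unity on `tsupport ψ`); and the landed identification core
(`Identification.identification_of_gateTrace_core`, p94078) needs of a limit ONLY holomorphy and its
gate trace.  Hence the r15 composition

  `BoundaryClosureR ⇐ LocalL1Root ∧ GateTraceH`                      (`BoundaryClosureR_of`; DD, MR inside),

and BOTH inputs are consequences of the target:
  `HexObservableLimitR ⇒ LocalL1Root`  (Banach–Steinhaus: landed `stub_localL1Bound_necessity` p88459 +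
     existence of an admissible conformal datum `FrameDatumExists`, classical: `stub_localL1Root_necessity`,
     `stub_frameDatum`),
  `HexObservableLimitR ⇒ GateTraceH`   (uniqueness of weak limits: `stub_gateTraceH_necessity`),
so that, modulo the two exponent cruxes, the crux is EQUIVALENT to the conjunction of two inputs
each implied by its own conclusion (`target_iff`): nothing in the line is stronger than the target
any more.  The r14 inputs imply the r15 ones (`localL1Root_of_localSupBound`; the gate-trace
comparison needs the weak-limit uniqueness lemma of `stub_gateTraceH_necessity`). -/

/-- The two marked points of a Dobrushin domain are distinct. [folklore] -/
theorem pt_zero_ne_one (D : DobrushinDomain) : D.pt 0 ≠ D.pt 1 :=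
  fun h => absurd (D.pt_injective h) (by decide)

/-- **LOCAL `L¹` LAW AT THE TARGET'S ROOT** (r15 registered MODEL INPUT 1/2): `LocalL1Bound` asked only
for the root family pinned at `D.pt 0` — on every compact of the carrier the `b`-normalised
observable of the target's own root has eventually bounded `L¹` mass,
`δ² Σ_{δ·mid z ∈ K} |F_δ(z)| ≤ C_K |F_δ(b δ)|`.  NECESSARY for the target (Banach–Steinhaus on
`C(K)`, landed `LocalL1.stub_localL1Bound_necessity` p88459, given an admissible conformal datum —
`stub_localL1Root_necessity`); it is the `δ^{25/48}` phase cancellation of the parafermionic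
observable in AVERAGED form (the masses `Z ≥ |F|` have `δ²Σ_K Z/Z(b δ) ≍ δ^{-25/48}`), i.e. the
"no concentration" half of Conjecture 2's existence statement; OPEN. -/
def LocalL1Root : Prop :=
  ∀ (D : DobrushinDomain) (ρ : ℝ) (Λ : ℝ → Finset HexVertex) (m : ℝ → ℤ) (b : ℝ → Sym2 HexVertex),
    AdmissibleFamily D ρ Λ m b →
  ∀ (a : ℝ → Sym2 HexVertex) (r₀ : ℝ) (m₀ : ℝ → ℤ), PinnedFlatRoot D Λ b (D.pt 0) a r₀ m₀ →
  ∀ K : Set ℂ, IsCompact K → K ⊆ D.carrier → ∃ C : ℝ, ∀ᶠ δ : ℝ in 𝓝[>] 0,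
    δ ^ 2 * (∑ᶠ z ∈ {z : Sym2 HexVertex | z ∈ hexDomainMidEdges (Λ δ) ∧ (δ : ℂ) * hexMidpoint z ∈ K},
        ‖hexParafermionicObservable (Λ δ) (a δ) hexCriticalFugacity (5 / 8) z‖) ≤
      C * ‖hexParafermionicObservable (Λ δ) (a δ) hexCriticalFugacity (5 / 8) (b δ)‖

/-- `LocalL1Root` is the case `x = D.pt 0` of `LocalL1Bound`. [folklore] -/
theorem localL1Root_of_localL1Bound (h : LocalL1Bound) : LocalL1Root :=
  fun D ρ Λ m b hAF a r₀ m₀ hPR => h D ρ Λ m b hAF (D.pt 0) a r₀ m₀ hPR (pt_zero_ne_one D)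

/-- **HOLOMORPHIC WEAK LIMITS** (r15 engine output, consumed by `closingH`): for every admissible
family, root pinned at `D.pt 0` and mesh sequence `ns → 0+`, some subsequence of the normalised
functionals `N_{ns n}` converges weakly (continuous compactly supported tests in the carrier) to a
function HOLOMORPHIC on the carrier. -/
def HolWeakLimits : Prop :=
  ∀ (D : DobrushinDomain) (ρ : ℝ) (Λ : ℝ → Finset HexVertex) (m : ℝ → ℤ) (b : ℝ → Sym2 HexVertex),
    AdmissibleFamily D ρ Λ m b →
  ∀ (a : ℝ → Sym2 HexVertex) (r₀ : ℝ) (m₀ : ℝ → ℤ), PinnedFlatRoot D Λ b (D.pt 0) a r₀ m₀ →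
  ∀ ns : ℕ → ℝ, Tendsto ns atTop (𝓝[>] 0) →
    ∃ ms : ℕ → ℕ, StrictMono ms ∧ ∃ g : ℂ → ℂ,
      DifferentiableOn ℂ g D.carrier ∧ IsWeakLimit D Λ a b (ns ∘ ms) g

/-- **GATE TRACE OF HOLOMORPHIC WEAK LIMITS** (r15 registered MODEL INPUT 2/2): `GateTrace` with the
Pick–cup clauses of the limit DROPPED — ONE universal `c ≠ 0` such that for every admissible datum,
root pinned at `D.pt 0`, admissible conformal datum `(Φ, L, L_b)`, mesh sequence `ns` and every
function `g` HOLOMORPHIC on the carrier that is the weak limit of the normalised functionals along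
`ns`, `g · exp(−(5/8)(L − L_b)) → c` within the carrier at every point of the flat gate
`{im = im (pt 1)} ∩ B(pt 1, ρ)`.  NECESSARY for the target (`stub_gateTraceH_necessity`: the target
forces `g = c·exp((5/8)(L − L_b))` on the carrier by uniqueness of weak limits); together with
`LocalL1Root` (and DD, MR) SUFFICIENT (`BoundaryClosureR_of`).  By the landed identity-theorem glue it
is the ENTIRE identification content of DCS Conjecture 2 for subsequential limits (Riemann–Hilbert
data on all of `∂Ω`, or the two-root quotient); positive-mass currency: `GateMassProfile` of
`Cruxes/BoundaryClosureR/PROMOTE-c2.md` §2(4).  OPEN (conjecture strength). -/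
def GateTraceH : Prop :=
  ∃ c : ℂ, c ≠ 0 ∧
    ∀ (D : DobrushinDomain) (ρ : ℝ) (Λ : ℝ → Finset HexVertex) (m : ℝ → ℤ) (b : ℝ → Sym2 HexVertex),
      AdmissibleFamily D ρ Λ m b →
    ∀ (a : ℝ → Sym2 HexVertex) (r₀ : ℝ) (m₀ : ℝ → ℤ), PinnedFlatRoot D Λ b (D.pt 0) a r₀ m₀ →
    ∀ (Φ : ConformalEquiv D.carrier UpperHalfPlane.upperHalfPlaneSet) (L : ℂ → ℂ) (Lb : ℂ),
      Tendsto (fun z => ‖Φ z‖) (𝓝[D.carrier] (D.pt 0)) atTop → Φ.HasBoundaryValue (D.pt 1) 0 →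
      ContinuousOn L D.carrier → (∀ z ∈ D.carrier, Complex.exp (L z) = deriv Φ z) →
      Tendsto L (𝓝[D.carrier] (D.pt 1)) (𝓝 Lb) →
    ∀ ns : ℕ → ℝ, Tendsto ns atTop (𝓝[>] 0) →
    ∀ g : ℂ → ℂ, DifferentiableOn ℂ g D.carrier → IsWeakLimit D Λ a b ns g →
      ∀ y : ℂ, y.im = (D.pt 1).im → y ∈ Metric.ball (D.pt 1) ρ →
        Tendsto (fun z => g z * Complex.exp (-((5 / 8 : ℂ) * (L z - Lb)))) (𝓝[D.carrier] y) (𝓝 c)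

/-- `GateTraceH` implies the r10 `GateTrace` (a Pick–cup limit is in particular holomorphic). [folklore] -/
theorem gateTrace_of_gateTraceH (h : GateTraceH) : GateTrace := by
  obtain ⟨c, hc, H⟩ := h
  exact ⟨c, hc, fun D ρ Λ m b hAF a r₀ m₀ hPR Φ L Lb hΦ hΦb hL hexpL hLb ns hns g hg hw =>
    H D ρ Λ m b hAF a r₀ m₀ hPR Φ L Lb hΦ hΦb hL hexpL hLb ns hns g hg.1 hw⟩

/-- **IDENTIFICATION OF HOLOMORPHIC WEAK LIMITS** (r15 form of `Identification`): every holomorphic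
subsequential weak limit of the target's root is `c · exp((5/8)(L − L_b))` on the carrier, one
universal `c ≠ 0`. -/
def IdentificationH : Prop :=
  ∃ c : ℂ, c ≠ 0 ∧
  ∀ (D : DobrushinDomain) (ρ : ℝ) (Λ : ℝ → Finset HexVertex) (m : ℝ → ℤ) (b : ℝ → Sym2 HexVertex),
    AdmissibleFamily D ρ Λ m b →
  ∀ (a : ℝ → Sym2 HexVertex) (r₀ : ℝ) (m₀ : ℝ → ℤ), PinnedFlatRoot D Λ b (D.pt 0) a r₀ m₀ →
  ∀ (Φ : ConformalEquiv D.carrier UpperHalfPlane.upperHalfPlaneSet) (L : ℂ → ℂ) (Lb : ℂ),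
    Tendsto (fun z => ‖Φ z‖) (𝓝[D.carrier] (D.pt 0)) atTop → Φ.HasBoundaryValue (D.pt 1) 0 →
    ContinuousOn L D.carrier → (∀ z ∈ D.carrier, Complex.exp (L z) = deriv Φ z) →
    Tendsto L (𝓝[D.carrier] (D.pt 1)) (𝓝 Lb) →
  ∀ ns : ℕ → ℝ, Tendsto ns atTop (𝓝[>] 0) →
  ∀ g : ℂ → ℂ, DifferentiableOn ℂ g D.carrier → IsWeakLimit D Λ a b ns g →
    ∀ z ∈ D.carrier, g z = c * Complex.exp ((5 / 8 : ℂ) * (L z - Lb))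

/-- `IdentificationH` from `GateTraceH` — the landed analytic core (p94078: `L` is holomorphic,
`g·exp(−(5/8)(L − L_b))` is holomorphic and tends to `c` along the gate; Schwarz reflection + identity
theorem, `identification_gateReflection`), which uses of the limit only holomorphy. [folklore] -/
theorem identificationH_of_gateTraceH (hG : GateTraceH) : IdentificationH := by
  obtain ⟨c, hc, hGT⟩ := hG
  refine ⟨c, hc, ?_⟩
  intro D ρ Λ m b hAF a r₀ m₀ hPR Φ L Lb hΦ hΦb hL hexpL hLb ns hns g hg hw
  exact Summit.CriticalPhenomena.SAWScalingLimit.Theorems.PickHalfPlane.Identification.identification_of_gateTrace_core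
    D ρ Φ L Lb c g hAF.1 hAF.2.1 hL hexpL hg
    (hGT D ρ Λ m b hAF a r₀ m₀ hPR Φ L Lb hΦ hΦb hL hexpL hLb ns hns g hg hw)

/-- **EXISTENCE OF AN ADMISSIBLE CONFORMAL DATUM** (classical; registered provable stub
`stub_frameDatum`, used only for the necessity direction): for every Dobrushin domain flat near
`D.pt 1` there are a conformal equivalence `Φ : Ω → ℍₒ` with `‖Φ‖ → ∞` at `D.pt 0` and `Φ → 0` at
`D.pt 1`, a continuous branch `L` of `log Φ'`, and its finite limit `L_b` at `D.pt 1` (chordal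
uniformizer `MarkedDomain.exists_isChordalUniformizing_holds` + boundary correspondence + `z ↦ −1/z`;
holomorphic logarithm on the simply connected carrier; `gateTrace_frameRegular` at `y = D.pt 1`). -/
def FrameDatumExists : Prop :=
  ∀ (D : DobrushinDomain) (ρ : ℝ), 0 < ρ →
    D.carrier ∩ Metric.ball (D.pt 1) ρ = {z : ℂ | (D.pt 1).im < z.im} ∩ Metric.ball (D.pt 1) ρ →
    ∃ (Φ : ConformalEquiv D.carrier UpperHalfPlane.upperHalfPlaneSet) (L : ℂ → ℂ) (Lb : ℂ),
      Tendsto (fun z => ‖Φ z‖) (𝓝[D.carrier] (D.pt 0)) atTop ∧ Φ.HasBoundaryValue (D.pt 1) 0 ∧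
      ContinuousOn L D.carrier ∧ (∀ z ∈ D.carrier, Complex.exp (L z) = deriv Φ z) ∧
      Tendsto L (𝓝[D.carrier] (D.pt 1)) (𝓝 Lb)

/-- **Closing step, r15 (no `sorry`)**: holomorphic weak limits along subsequences of every mesh
sequence (`HolWeakLimits`) and their identification (`IdentificationH`) give the pinned target, by
`Filter.tendsto_of_subseq_tendsto` on the countably generated filter `𝓝[>] 0` (port of `closing`). -/
theorem closingH (hW : HolWeakLimits) (hI : IdentificationH) : HexObservableLimitR := by
  obtain ⟨c, hc, hId⟩ := hI
  refine ⟨c, hc, ?_⟩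
  intro D ρ Λ m a b Φ L Lb ψ F hρ hflat hadm hexh ha hb hΦ hΦb hL hexpL hLb hψc hψK hψD
  -- repackage the hypotheses
  have hAF : AdmissibleFamily D ρ Λ (m 1) b := by
    refine ⟨hρ, hflat 1, ?_, hexh, hb⟩
    filter_upwards [hadm] with δ hδ
    exact ⟨hδ.1, hδ.2.2.1, hδ.2.2.2.2.1, hδ.2.2.2.2.2.1, hδ.2.2.2.2.2.2 1⟩
  have hPR : PinnedFlatRoot D Λ b (D.pt 0) a ρ (m 0) := by
    refine ⟨hρ, hflat 0, ?_, ha⟩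
    filter_upwards [hadm] with δ hδ
    exact ⟨hδ.2.1, hδ.2.2.2.1, hδ.2.2.2.2.2.2 0⟩
  have hψ : IsTest D ψ := ⟨hψc, hψK, hψD⟩
  -- the subsequence principle on the countably generated filter `𝓝[>] 0`
  refine Filter.tendsto_of_subseq_tendsto fun ns hns => ?_
  obtain ⟨ms, hms, g, hg, hw⟩ := hW D ρ Λ (m 1) b hAF a ρ (m 0) hPR ns hns
  have hns' : Tendsto (ns ∘ ms) atTop (𝓝[>] 0) := hns.comp hms.tendsto_atTop
  have hid : ∀ z ∈ D.carrier, g z = c * Complex.exp ((5 / 8 : ℂ) * (L z - Lb)) :=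
    hId D ρ Λ (m 1) b hAF a ρ (m 0) hPR Φ L Lb hΦ hΦb hL hexpL hLb (ns ∘ ms) hns' g hg hw
  -- the limit density is `c · exp((5/8)(L - Lb))` on the domain and `ψ` vanishes off the domain
  have hint : ∫ z, ψ z * g z = c * ∫ z, ψ z * Complex.exp ((5 / 8 : ℂ) * (L z - Lb)) := by
    rw [← integral_const_mul]
    refine integral_congr_ae (Filter.Eventually.of_forall fun z => ?_)
    by_cases hz : z ∈ D.carrier
    · simp only [hid z hz]; ring
    · have hψz : ψ z = 0 := image_eq_zero_of_notMem_tsupport fun h => hz (hψD h)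
      simp only [hψz, zero_mul, mul_zero]
  have key := hw ψ hψ
  rw [hint] at key
  exact ⟨ms, key⟩

/-! ### 4. The registered stubs (the only `sorry`s of the file) -/

/-- STUB 1a — CLOSED (wave 1, p84543): the potential (E1) = pool item PotentialExists
(stmt-8299, closed by its owner: `Theorems.potentialExists_proof`), landed for this line as
`Theorems.PickHalfPlane.Potential.stub_potentialExistence` (unfolded signature). -/
theorem stub_potentialExistence : PotentialExistence :=
  Summit.CriticalPhenomena.SAWScalingLimit.Theorems.potentialExists_proof

/-- STUB 1b (M; provable now): boundary phase law (E2), straight gate (E3), root arms (E4). -/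
theorem stub_boundaryExactness : BoundaryExactness :=
  Summit.CriticalPhenomena.SAWScalingLimit.Theorems.PickHalfPlane.BoundaryExactness.stub_boundaryExactness

/-- STUB 1 assembled (no `sorry` of its own). -/
theorem stub_developingMapExact : DevelopingMapExact :=
  developingMapExact_of stub_potentialExistence stub_boundaryExactness

/- STUB 2a `stub_rootNoInteriorMax : RootNoInteriorMax` (r13–r14 MODEL INPUT) — RETIRED at r15 (no
longer a hypothesis of the composition; `RootNoInteriorMax` stays a hypothesis of
`boundaryClosureR_of_pickInputs`).  HISTORY: r11–r12 registered the global `HalfPlaneBounds` directly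
(its r6–r10 positive-mass leg `FarArrivalTight` being presumably false on fractal carriers); r13 localised
the wedge to the root's exact half-lattice ball and reduced it to this input. -/

/-- STUB 2b — CLOSED (p113388 + chain p108342/p108733/p112013/p112568, this seat's worker W5,
`…RootWedge{Escape,Chain,Station,Rim,OfNoMax}.lean`): the root wedge bound from `RootNoInteriorMax` and
`LocalSupBound` — discrete maximum principle for `Re H` over the lattice sites of the closed half-ball
`closedBall x (r/2)` above the root's floor: a maximum sits at a floor site (V-shape of `Re H` along the
floor, minimum at the root: landed `floor_step_eq`, `root_step_eq`, `lattice_arms`) or next to the rim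
(bounded by summing `|δ F/F(b)| ≤ C δ` along a lattice path from `s_b` inside a compact of
`carrier ∪ flat pieces` avoiding the root — `LocalSupBound`), cf. `re_maxPrinciple` in §4b. -/
theorem stub_rootWedgeOfNoMax : RootNoInteriorMax → LocalSupBound → RootWedgeBound :=
  Summit.CriticalPhenomena.SAWScalingLimit.Theorems.PickHalfPlane.RootWedge.rootWedgeBound_of_noInteriorMax

/- STUB 3a `stub_flatMassLaws : FlatDensityLower ∧ RootArmLaw` (r12–r14 MODEL INPUT, positive-mass
LOWER bounds: boundary Harnack from below / arm divergence) — RETIRED at r15 (hypothesis of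
`boundaryClosureR_of_pickInputs` only). -/

/-- STUB 3b — CLOSED (p105339, this seat's worker W4, `…BoundaryClosureRFlatDensityUpperOfSup.lean`):
the upper half of the flat density law from the local sup law (vertex relation at the up-face over each floor edge + `‖F_{5/8}‖ = Z` on boundary edges). -/
theorem stub_flatDensityUpperOfSup : LocalSupBound → FlatDensityUpper :=
  Summit.CriticalPhenomena.SAWScalingLimit.Theorems.PickHalfPlane.FlatDensityUpper.flatDensityUpper_of_localSupBound

/- STUB 4a `stub_localSupBound : LocalSupBound` (r11–r14 MODEL INPUT: the local sup law up to the
flat pieces) — RETIRED at r15 in favour of the NECESSARY `LocalL1Root` (registered `stub_localL1Root`);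
`LocalSupBound → LocalL1Root` is `localL1Root_of_localSupBound`. -/

/-- STUB 2 assembled (no `sorry`; lead c1 reshape r13, hypotheses explicit since r15): the root wedge
bound from STUBS 2a, 2b and 4a. -/
theorem stub_rootWedgeBound (h2 : RootNoInteriorMax) (h4 : LocalSupBound) : RootWedgeBound :=
  stub_rootWedgeOfNoMax h2 h4

/-- STUB 4b — CLOSED (p98268, `…BoundaryClosureRLocalL1OfSup.lean`, seat -1's worker; this seat's
worker W1 proved it independently, work/stubs/LocalL1OfSup.lean): the local `L¹` law from the local
sup law — count the mid-edges `z` of `Λ δ` with `δ·mid z ∈ K` (`δ²·# ≤ (14R+3)²`: brick coordinates of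
midpoints) and sum the pointwise bound (a compact `K ⊆ D.carrier` misses the root `x ∈ ∂D`). -/
theorem stub_localL1OfSup : LocalSupBound → LocalL1Bound :=
  Summit.CriticalPhenomena.SAWScalingLimit.Theorems.PickHalfPlane.LocalL1OfSup.localL1Bound_of_localSupBound

/-- STUB 5a — CLOSED (p116438 + p116065 abstract lattice Arzelà–Ascoli, p116128 Link, p116066 Flat; this seat's worker W6,
`…DevelopingMapsCompact{AA,Link,Flat,}.lean`; registered: `LocalSupBound → DevelopingMapsCompact`,
equicontinuity + Arzelà–Ascoli for the normalised developing maps; seat -1's workers hold its lattice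
half `…DevelopingMapsCompact{Core,Steps}`).
HISTORY — STUB 5 (r11) — **convergence of the engine**:
along a subsequence of every mesh sequence the normalised developing maps converge locally uniformly on
`(carrier ∪ flat pieces) ∖ {root}` to a continuous `h`, holomorphic on the carrier, with `h' = α g`,
`g` holomorphic and the weak limit of the functionals (`EngineLimits`).  Inputs: equicontinuity from
`LocalSupBound` (|∇h_δ| = |F/F(b)|/(2√3)) + Arzelà–Ascoli on lattice functions; the landed (S1)/(S2)
chain `pickEngine_holomorphicWeakLimit` (p94468: weak-* limit functional, weakly ∂̄-closed from
`ConjugateClassNegligible` = DD + MR via the proved `DecoherenceSynthesis`, holomorphic ball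
representatives by Weyl), `pickEngine_repContinuous` (p94507), patching across balls, and
`pickEngine_potentialByParts` (p94691) to identify `g = α⁻¹ h'`.
HISTORY of the r1–r10 single stub `stub_pickEngine` (now ASSEMBLED below from STUBS 5, 6 and the landed
stage 2; the intermediate `InteriorLimits` records the hand-over between its two stages).
STAGE 1 (Harnack, interior): Claim D (i) + almost-harmonicity on compacts from `DefectDecoherence` +
`MassRatio` (via the route's `DecoherenceSynthesis`: `‖∂̄h_δ‖_{L¹(K)} ≲ d^{-θ} δ^{θ-3/4} → 0`) give
Harnack up to an additive `o(1)` for the mollified `Re h_δ + M`; the ANCHOR (two-sided bound at a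
point above `b`) is the exact gate (`Re h_δ = 0` on the gate sites, (E2)+(E3)) + the gate flux
identity + `FlatMassLaws` (a); hence `sup_K |h_δ ∗ η_ε|` bounded, `h_δ → h` in `L¹_loc` along
subsequences (`LocalL1Bound` controls the sub-mollifier oscillation and upgrades `C¹` to `C⁰` test
functions), `g := α⁻¹ h'` holomorphic, lower bounds pass to the limit, and `g ≢ 0` from the lower
gate bound: `InteriorLimits`.  No degree theory, no area formula, no univalence.
STAGE 2 (Herglotz, up to the flat pieces): run the same engine up to the EXACT flat pieces
(boundary Harnack on the half-lattice) to get the boundary data of `h` in the limit — `Re h → 0` on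
the gate with `c t ≤ Re h(y+it) ≤ C t` (`FlatMassLaws` (a)), the two straight arms
`Im(conj(ω e^{±iπ/8}) h) = const` on the east/west rays at the root (E4) with `Re(conj ω · h) → +∞`
(`FlatMassLaws` (b)); then pure complex analysis: Schwarz reflection across the gate (`g(y) ≠ 0`
from the flux bounds) and across each arm, Herglotz growth for `conj ω · h + iM` near the root
(positive harmonic functions grow at most linearly in the uniformising variable ⇒ the exponent of
`h` at `x` is in `{-1/4, +1/4}` by the arm angle `π/4`, and divergence excludes `+1/4`), whence
`g (z-x)^{5/4} → κ ≠ 0`: `PickCupLimits`. -/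
theorem stub_developingMapsCompact : LocalSupBound → DevelopingMapsCompact :=
  Summit.CriticalPhenomena.SAWScalingLimit.Theorems.PickHalfPlane.DevelopingMaps.developingMapsCompact

/-- Glue (no `sorry`; lead c1 reshape r13): engine limits from the compactness of the developing maps
and seat -1's LANDED interior identification `developingMapLimitHolomorphic` (`…DevelopingMapLimit.lean`:
given `DevelopingMapsConverge`, the local `L¹` law and the exponent cruxes, `h` is holomorphic on the
carrier and the functionals converge to `∫ ψ·(α h')`, `α = 12 i`); `g := α h'`. -/
theorem engineLimits_of (h5a : DevelopingMapsCompact) (hL1 : LocalL1Bound) (hDD : DefectDecoherence)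
    (hMR : MassRatio) : EngineLimits := by
  obtain ⟨α, hα, H5b⟩ :=
    Summit.CriticalPhenomena.SAWScalingLimit.Theorems.PickHalfPlane.DevelopingMap.developingMapLimitHolomorphic
  intro D ρ Λ m b hAF x e r mr hPR hx ns hns
  obtain ⟨ms, hms, h, hconv⟩ := h5a D ρ Λ m b hAF x e r mr hPR hx ns hns
  have hns' : Tendsto (ns ∘ ms) atTop (𝓝[>] 0) := hns.comp hms.tendsto_atTop
  obtain ⟨hhol, hweak⟩ :=
    H5b hL1 hDD hMR D ρ Λ m b hAF x e r mr hPR hx (ns ∘ ms) hns' h hconv.1 hconv.2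
  refine ⟨ms, hms, h, fun z => α * deriv h z, α⁻¹, inv_ne_zero hα, ?_, hhol, fun z _ => ?_, hweak,
    hconv⟩
  · exact (((hhol.analyticOnNhd D.isOpen).deriv).differentiableOn).const_mul α
  · show deriv h z = α⁻¹ * (α * deriv h z)
    rw [← mul_assoc, inv_mul_cancel₀ hα, one_mul]

/-- STUB 5 assembled (no `sorry` of its own; lead c1 reshape r13): convergence of the engine from
STUB 5a and the landed 5b. -/
theorem stub_engineConvergence :
    DevelopingMapExact → HalfPlaneBounds → LocalL1Bound → LocalSupBound →
      DefectDecoherence → MassRatio → EngineLimits :=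
  fun _ _ hL1 hSup hDD hMR => engineLimits_of (stub_developingMapsCompact hSup) hL1 hDD hMR

/-- STUB 6 — CLOSED (p118906 + chain p117179 LatticeFrame, p117180 LimitFrame, p117465 FloorValue, p118178 Arms,
p118183 Divergence, p118381 FlatScale, p118634 Flat; this seat's worker W7, `…BoundaryDataTransfer*.lean`, on seat -1's
Lattice/Reflection/ArmsPrep) — **boundary data of the engine limits**: every engine limit `h` (locally uniform limit of the normalised developing maps up to
the flat pieces, off the root) satisfies the hypotheses (I1)–(I4) of the landed `pickEngine_stage2`:
two straight arms at the root through one point `p` ((E4)+(E2) pass to the limit; the winding class of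
`W_b` is eventually one of 8, pigeonhole along the sequence), the root wedge `−M ≤ re(ω̄ h)` on the
punctured closed half-disc of radius `r₀ ≤ r/2` (`RootWedgeBound` + `rootFrame_identity`, pointwise limit) with the rigid
compatibility `ω e^{−iθ} = e^{−iπ/8}` (`wedge_compat_of_rigid`), unboundedness at the root
(`RootArmLaw` + the floor step law: the east-arm sums dominate `Σ κ/j`), and at every other flat point a
line image (gate: `re h_δ = 0` exactly; root piece: the arms) with linear normal growth (tangential
bi-Lipschitz from `FlatDensityLaw`'s lower bound, then Schwarz reflection ⇒ `h'(y) ≠ 0`). -/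
theorem stub_engineBoundaryData :
    DevelopingMapExact → RootWedgeBound → FlatMassLaws → LocalSupBound → EngineBoundaryData :=
  Summit.CriticalPhenomena.SAWScalingLimit.Theorems.PickHalfPlane.BoundaryDataTransfer.engineBoundaryData

/-- Glue (no `sorry`; lead c1 reshape r11): engine limits with their boundary data are Pick–cup limits,
by the landed STAGE 2 (`pickEngine_stage2`: two-arm reflection, Casorati–Weierstrass, root order `5/4`,
flat values). -/
theorem pickCupLimits_of (hL : EngineLimits) (hB : EngineBoundaryData) : PickCupLimits := by
  intro D ρ Λ m b hAF x e r mr hPR hx ns hns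
  obtain ⟨ms, hms, h, g, α, hEL⟩ := hL D ρ Λ m b hAF x e r mr hPR hx ns hns
  have hns' : Tendsto (ns ∘ ms) atTop (𝓝[>] 0) := hns.comp hms.tendsto_atTop
  obtain ⟨r₀, p, ω, θ, M, hr₀, hr₀r, hcont, heast, hwest, hωn, hω₁, hω₂, hwedge, hdiv, hflat⟩ :=
    hB D ρ Λ m b hAF x e r mr hPR hx (ns ∘ ms) hns' h g α hEL
  obtain ⟨hα, -, hh, hderiv, hweak, -, -⟩ := hEL
  have key := Summit.CriticalPhenomena.SAWScalingLimit.Theorems.PickHalfPlane.Engine.pickEngine_stage2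
    D ρ x r r₀ h g α p ω θ M hAF.1 hAF.2.1 hPR.1 hPR.2.1 hr₀ hr₀r hα hh hderiv hcont heast hwest
    hωn hω₁ hω₂ hwedge hdiv hflat
  exact ⟨ms, hms, g, ⟨key.1, key.2.1, key.2.2⟩, hweak⟩

/-- STUB 5∘6 assembled (no `sorry` of its own; lead c1 reshape r11): the Pick engine in its registered
r10 shape, from the two engine stubs and the landed stage 2. -/
theorem stub_pickEngine :
    DevelopingMapExact → HalfPlaneBounds → FlatMassLaws → LocalL1Bound → LocalSupBound →
      DefectDecoherence → MassRatio → PickCupLimits :=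
  fun hE hH hF hL1 hSup hDD hMR =>
    pickCupLimits_of (stub_engineConvergence hE hH hL1 hSup hDD hMR)
      (stub_engineBoundaryData hE (rootWedgeBound_of_halfPlaneBounds hH) hF hSup)

/- STUB 7″ `stub_gateBoundaryValueLaw : GateBoundaryValueLaw` (r12–r14 MODEL INPUT) — RETIRED at r15
in favour of the NECESSARY `GateTraceH` (registered `stub_gateTraceH`); `GateBoundaryValueLaw` stays a
hypothesis of `boundaryClosureR_of_pickInputs`. -/

/-- STUB 7′ assembled (no `sorry`; lead c1 reshape r12, hypothesis explicit since r15): the gate trace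
from the gate boundary-value law by the landed reduction + frame regularity. -/
theorem stub_gateTrace (h7 : GateBoundaryValueLaw) : GateTrace :=
  gateTrace_of_law h7

/-- STUB 7 assembled (no `sorry`; lead reshape r10, hypothesis explicit since r15): identification of
every Pick–cup limit from the gate trace, by the landed glue. -/
theorem stub_identification (h7 : GateBoundaryValueLaw) : PickCupLimits → Identification :=
  fun _ => identification_of_gateTrace (stub_gateTrace h7)

/-! #### r15 registered stubs (lead c3): two MODEL INPUTS (both necessary for the target) + four
provable glue / necessity stubs -/

/-- STUB r15-1 (MODEL INPUT, necessary for the target): the local `L¹` law at the target's root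
(`LocalL1Root`).  OPEN — the averaged `δ^{25/48}` phase cancellation. -/
theorem stub_localL1Root : LocalL1Root := by
  sorry

/-- STUB r15-2 (MODEL INPUT, necessary for the target): the gate trace of holomorphic weak limits
(`GateTraceH`).  OPEN — the identification content of Conjecture 2. -/
theorem stub_gateTraceH : GateTraceH := by
  sorry

/-- STUB r15-3 — CLOSED (p121571, this seat's worker W1, `…BoundaryClosureRHolomorphicWeakLimits.lean`,
`LocalL1.holWeakLimits_of_localL1`; the r15 engine): holomorphic weak limits along subsequences from
`ConjugateClassNegligible` (= DD + MR) and the local `L¹` law at the root — the landed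
`LocalL1.pickEngine_holomorphicWeakLimit` (weak-* limit `L`, weak `∂̄`-closure, Weyl representatives
on balls `closedBall z₀ (3R) ⊆ Ω`) + PATCHING (two ball representatives agree on the overlap of their
representation balls: `∫ χ·(g₁ − g₂) = 0` for smooth `χ` ⇒ a.e. ⇒ everywhere by continuity,
`IsOpen.ae_eq_zero_of_integral_contDiff_smul_eq_zero`; `g z := g_z z` is then holomorphic) + the smooth →
continuous upgrade per ball (`pickEngine_repContinuous`, p94507) + a CONTINUOUS partition of unity on
`tsupport ψ` subordinate to the half-radius balls (`PartitionOfUnity.exists_isSubordinate`; finitely many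
members meet `tsupport ψ`, `LocallyFinite.finite_nonempty_inter_compact`) and additivity of `L`. -/
theorem stub_holWeakLimits : ConjugateClassNegligible → LocalL1Root → HolWeakLimits :=
  fun hCCN hL1 D ρ Λ m b hAF a r₀ m₀ hPR ns hns =>
    Summit.CriticalPhenomena.SAWScalingLimit.Theorems.PickHalfPlane.LocalL1.holWeakLimits_of_localL1 hCCN
      D ρ Λ m b hAF a r₀ m₀ hPR (hL1 D ρ Λ m b hAF a r₀ m₀ hPR) ns hns

/-- STUB r15-4 — CLOSED (p121923, worker W2, `…BoundaryClosureRGateTraceNecessity.lean`,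
`Identification.gateTraceH_of_target`, via the landed `weakLimit_eq_of_hexObservableLimitR` p83707; necessity of
input 2): the target identifies every holomorphic weak
limit — along `ns`, `N_{ns n}(ψ) → ∫ ψ g` (weak limit) and `→ c ∫ ψ e^{(5/8)(L − L_b)}` (target), so
`∫ ψ (g − c e^{…}) = 0` for all continuous compactly supported `ψ` in the carrier, hence (smooth real
`ψ`, `IsOpen.ae_eq_zero_of_integral_contDiff_smul_eq_zero`, continuity on the open carrier)
`g = c e^{(5/8)(L − L_b)}` on the carrier and the gate trace is the constant `c`
(`tendsto_nhdsWithin_congr`).  The constant of `GateTraceH` is the target's `c`. -/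
theorem stub_gateTraceH_necessity : HexObservableLimitR → GateTraceH :=
  Summit.CriticalPhenomena.SAWScalingLimit.Theorems.PickHalfPlane.Identification.gateTraceH_of_target

/-- STUB r15-5 — CLOSED (p122275, worker W3, `…BoundaryClosureRFrameDatum.lean`, `Identification.frameDatum_exists`,
reusing `ObservableToSLE.FloorRatio.exists_halfPlaneMap` / `exists_log_deriv` + `gateTrace_frameRegular`; classical):
an admissible conformal datum exists for every Dobrushin
domain flat near `D.pt 1` (`FrameDatumExists`). -/
theorem stub_frameDatum : FrameDatumExists :=
  Summit.CriticalPhenomena.SAWScalingLimit.Theorems.PickHalfPlane.Identification.frameDatum_exists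

/-- STUB r15-6 — CLOSED (p122434, worker W4, `…BoundaryClosureRLocalL1RootNecessity.lean`,
`LocalL1.localL1Root_of_target`; necessity of input 1): given a conformal datum (`FrameDatumExists`), the
target makes every normalised functional `N_δ(ψ)` convergent, hence eventually bounded, for every
continuous compactly supported `ψ` in the carrier; the normaliser is eventually nonzero
(`LocalL1.eventually_normaliser_ne_zero_of_bundles` / `stub_localL1Bound_normaliser`); Banach–Steinhaus in
the landed form `LocalL1.stub_localL1Bound_necessity` (p88459, `U = D.carrier`) gives `LocalL1Root`. -/
theorem stub_localL1Root_necessity : FrameDatumExists → HexObservableLimitR → LocalL1Root :=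
  Summit.CriticalPhenomena.SAWScalingLimit.Theorems.PickHalfPlane.LocalL1.localL1Root_of_target

/-! ### Name-keyed aliases of the stub statements (hypotheses of the composition) -/
namespace Registered

/-- Alias keyed by the registered stub name (MODEL INPUT, r15). -/
abbrev stub_localL1Root : Prop := LocalL1Root
/-- Alias keyed by the registered stub name (MODEL INPUT, r15). -/
abbrev stub_gateTraceH : Prop := GateTraceH
/-- Alias keyed by the registered stub name (provable glue, r15). -/
abbrev stub_holWeakLimits : Prop := ConjugateClassNegligible → LocalL1Root → HolWeakLimits
/-- Alias keyed by the registered stub name (provable, r15). -/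
abbrev stub_gateTraceH_necessity : Prop := HexObservableLimitR → GateTraceH
/-- Alias keyed by the registered stub name (provable, r15). -/
abbrev stub_frameDatum : Prop := FrameDatumExists
/-- Alias keyed by the registered stub name (provable, r15). -/
abbrev stub_localL1Root_necessity : Prop := FrameDatumExists → HexObservableLimitR → LocalL1Root

end Registered

/-! ### 4b. Exact consequences of the lattice stubs (sorry-free given the stubs; lead) -/

/-- **The gate lies on the imaginary axis** (the anchor of the engine, from (E2)+(E3)): on a flat
floor segment `k₁ … k₂` of row `m` that does not contain the root, for two floor edges `kb`, `k` of
the segment reached by walks from the root, the increment of ANY potential across `floorEdge k m`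
(which is `(mid − c_up)·F(floorEdge k m)`, see `IsPotential`) divided by `F(floorEdge kb m)` is
purely imaginary — so `Re h_δ` is constant (`= 0`) along the gate through `b_δ`.  Division by a
vanishing `F(b)` is the junk value `0`, for which the statement holds trivially. [folklore] -/
theorem gate_step_re_eq_zero (hB : BoundaryExactness) {Λ : Finset HexVertex}
    (hΛ : hexDomainSimplyConnected Λ) {u w : HexVertex} (huw : hexGraph.Adj u w) (hu : u ∉ Λ)
    (hw : w ∈ Λ) {m k₁ k₂ : ℤ} (hfl : IsFlatFloor Λ m k₁ k₂)
    (hroot : ∀ k : ℤ, k₁ ≤ k → k ≤ k₂ → floorEdge k m ≠ s(u, w))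
    {kb k : ℤ} (hkb₁ : k₁ ≤ kb) (hkb₂ : kb ≤ k₂) (hk₁ : k₁ ≤ k) (hk₂ : k ≤ k₂)
    (γb : HexMidEdgeSAW Λ s(u, w) (floorEdge kb m)) (γ : HexMidEdgeSAW Λ s(u, w) (floorEdge k m)) :
    ((hexMidpoint (floorEdge k m) - hexCenter (upFace k m)) *
        hexParafermionicObservable Λ s(u, w) hexCriticalFugacity (5 / 8) (floorEdge k m) /
      hexParafermionicObservable Λ s(u, w) hexCriticalFugacity (5 / 8) (floorEdge kb m)).re = 0 := by
  classical
  obtain ⟨hE2, hE3, -⟩ := hB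
  have hk := hfl k hk₁ hk₂
  have hb := hfl kb hkb₁ hkb₂
  have e2k := hE2 Λ hΛ u w huw hu hw (belowFace k m) (upFace k m) (adj_belowFace_upFace k m)
    hk.2.1 hk.1 (hroot k hk₁ hk₂) γ
  have e2b := hE2 Λ hΛ u w huw hu hw (belowFace kb m) (upFace kb m) (adj_belowFace_upFace kb m)
    hb.2.1 hb.1 (hroot kb hkb₁ hkb₂) γb
  have e3 : @HexMidEdgeSAW.winding Λ s(u, w) s(belowFace k m, upFace k m) γ =
      @HexMidEdgeSAW.winding Λ s(u, w) s(belowFace kb m, upFace kb m) γb :=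
    hE3 Λ hΛ u w huw hu hw m k₁ k₂ hfl hroot kb k hkb₁ hkb₂ hk₁ hk₂ γb γ
  -- both half-edge vectors are the same purely imaginary number `d`
  have hdk : hexMidpoint s(belowFace k m, upFace k m) - hexCenter (upFace k m) =
      (1 - 2 * triZeta) / 6 := hexMidpoint_floorEdge_sub k m
  have hdb : hexMidpoint s(belowFace kb m, upFace kb m) - hexCenter (upFace kb m) =
      (1 - 2 * triZeta) / 6 := hexMidpoint_floorEdge_sub kb m
  rw [hdk, e3] at e2k
  rw [hdb] at e2b
  rw [hexMidpoint_floorEdge_sub k m]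
  set d : ℂ := (1 - 2 * triZeta) / 6 with hd
  set Fk := hexParafermionicObservable Λ s(u, w) hexCriticalFugacity (5 / 8) s(belowFace k m, upFace k m)
  set Fb := hexParafermionicObservable Λ s(u, w) hexCriticalFugacity (5 / 8) s(belowFace kb m, upFace kb m)
  set A : ℂ := (hexCenter w - hexCenter u) / 2 *
    Complex.exp (Complex.I * (3 / 8 : ℂ) * (γb.winding : ℂ))
  set rk : ℝ := ‖hexParafermionicObservable Λ s(u, w) hexCriticalFugacity 0 s(belowFace k m, upFace k m)‖
  set rb : ℝ := ‖hexParafermionicObservable Λ s(u, w) hexCriticalFugacity 0 s(belowFace kb m, upFace kb m)‖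
  change d * Fk = A * (rk : ℂ) at e2k
  change d * Fb = A * (rb : ℂ) at e2b
  show (d * Fk / Fb).re = 0
  have hdre : d.re = 0 := by rw [hd]; simp [triZeta_re]
  have hdne : d ≠ 0 := by
    rw [hd]; apply div_ne_zero _ (by norm_num)
    intro h
    have := congrArg Complex.im h
    simp [triZeta_im] at this
  by_cases hFb : Fb = 0
  · simp [hFb]
  have hrb : (rb : ℂ) ≠ 0 := by
    intro h0
    apply hFb
    have : d * Fb = 0 := by rw [e2b, h0, mul_zero]
    exact (mul_eq_zero.1 this).resolve_left hdne
  have hA : A ≠ 0 := by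
    intro h0; apply hFb
    have : d * Fb = 0 := by rw [e2b, h0, zero_mul]
    exact (mul_eq_zero.1 this).resolve_left hdne
  -- `d Fk / Fb = d · (rk / rb)` and `d` is purely imaginary
  have key : d * Fk / Fb = d * ((rk : ℂ) / (rb : ℂ)) := by
    have hFb' : Fb = A * (rb : ℂ) / d := by
      rw [← e2b]; field_simp
    rw [e2k, hFb']
    field_simp
  rw [key, ← Complex.ofReal_div, Complex.mul_re, Complex.ofReal_re, Complex.ofReal_im, hdre]
  ring

/-- One step of ANY potential along the floor sites `(k, m) → (k+1, m)` of a flat floor is the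
half-edge increment `(mid − c_up)·F(floorEdge k m)` (the centre of `upFace k m` lies to the LEFT of
the eastward 𝕋-edge; orientation clause of `IsPotential`). [folklore] -/
theorem potential_floor_step {Λ : Finset HexVertex} {a : Sym2 HexVertex} {H : Site 2 → ℂ}
    (hH : IsPotential Λ a H) {k m : ℤ} (hup : upFace k m ∈ Λ) :
    H ![k + 1, m] - H ![k, m] = (hexMidpoint (floorEdge k m) - hexCenter (upFace k m)) *
      hexParafermionicObservable Λ a hexCriticalFugacity (5 / 8) (floorEdge k m) := by
  have h1 : (![k + 1, m] : Site 2) = ![k, m] + Pi.single 0 1 := by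
    ext i; fin_cases i <;> simp
  have hsv : (![k, m] : Site 2) ∈ hexFaceVertices (upFace k m) := by
    unfold upFace; rw [mem_hexFaceVertices_zero]; exact Or.inl rfl
  have htv : (![k + 1, m] : Site 2) ∈ hexFaceVertices (upFace k m) := by
    unfold upFace; rw [mem_hexFaceVertices_zero, h1]; exact Or.inr (Or.inl rfl)
  have hb : (![k, m - 1] : Site 2) + Pi.single 1 1 = ![k, m] := by
    ext i; fin_cases i <;> simp
  have hsw : (![k, m] : Site 2) ∈ hexFaceVertices (belowFace k m) := by
    unfold belowFace; rw [mem_hexFaceVertices_one]; exact Or.inr (Or.inl hb.symm)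
  have htw : (![k + 1, m] : Site 2) ∈ hexFaceVertices (belowFace k m) := by
    unfold belowFace; rw [mem_hexFaceVertices_one]
    refine Or.inr (Or.inr ?_)
    ext i; fin_cases i <;> simp
  have hne : (![k, m] : Site 2) ≠ ![k + 1, m] := by
    intro h; have := congrFun h 0; simp at this
  have hor : 0 < ((starRingEnd ℂ) (triEmbed ![k + 1, m] - triEmbed ![k, m]) *
      (hexCenter (upFace k m) - triEmbed ![k, m])).im := by
    rw [h1, triEmbed_add, triEmbed_single_zero]
    unfold upFace
    simp only [hexCenter, add_sub_cancel_left, Fin.val_zero, Nat.cast_zero, zero_add, one_mul,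
      map_one]
    simp [triZeta_im]
  have key := hH (upFace k m) hup (belowFace k m) (adj_belowFace_upFace k m).symm ![k, m] ![k + 1, m]
    hsv htv hsw htw hne hor
  rw [key]
  unfold floorEdge
  rw [Sym2.eq_swap]

/-- **`Re h_δ` is constant along the gate**: for ANY potential `H` of `F dz`, the real part of
`(H(k + n, m) − H(k, m))/F(b)` vanishes along a flat floor segment carrying `b = floorEdge kb m`
and not carrying the root (each step is `gate_step_re_eq_zero`, or `F = 0` on the step edge when no
walk reaches it). [folklore] -/
theorem gate_re_eq_zero (hB : BoundaryExactness) {Λ : Finset HexVertex}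
    (hΛ : hexDomainSimplyConnected Λ) {u w : HexVertex} (huw : hexGraph.Adj u w) (hu : u ∉ Λ)
    (hw : w ∈ Λ) {m k₁ k₂ : ℤ} (hfl : IsFlatFloor Λ m k₁ k₂)
    (hroot : ∀ k : ℤ, k₁ ≤ k → k ≤ k₂ → floorEdge k m ≠ s(u, w))
    {kb : ℤ} (hkb₁ : k₁ ≤ kb) (hkb₂ : kb ≤ k₂) (γb : HexMidEdgeSAW Λ s(u, w) (floorEdge kb m))
    {H : Site 2 → ℂ} (hH : IsPotential Λ s(u, w) H) :
    ∀ (n : ℕ) (k : ℤ), k₁ ≤ k → k + n ≤ k₂ + 1 →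
      ((H ![k + n, m] - H ![k, m]) /
        hexParafermionicObservable Λ s(u, w) hexCriticalFugacity (5 / 8) (floorEdge kb m)).re = 0 := by
  classical
  intro n
  induction n with
  | zero => intro k _ _; simp
  | succ n ih =>
    intro k hk hkn
    have hkn' : k + (n : ℤ) ≤ k₂ := by push_cast at hkn; omega
    have hsplit : H ![k + ((n + 1 : ℕ) : ℤ), m] - H ![k, m] =
        (H ![k + (n : ℤ) + 1, m] - H ![k + (n : ℤ), m]) + (H ![k + (n : ℤ), m] - H ![k, m]) := by
      push_cast; ring_nf
    rw [hsplit, add_div, Complex.add_re, ih k hk (by omega), add_zero,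
      potential_floor_step hH (hfl (k + n) (by omega) hkn').1]
    by_cases hne : Nonempty (HexMidEdgeSAW Λ s(u, w) (floorEdge (k + n) m))
    · exact gate_step_re_eq_zero ⟨hB.1, hB.2.1, hB.2.2⟩ hΛ huw hu hw hfl hroot hkb₁ hkb₂ (by omega) hkn'
        γb hne.some
    · rw [not_nonempty_iff] at hne
      simp [hexParafermionicObservable]

/-! #### The discrete minimum principle from the strict hull condition (lead reshape r2) -/

/-- **Discrete maximum principle for `Re H`** (one direction): if every interior site has a
neighbour with strictly larger `Re H`, the maximum of `Re H` over the lattice sites of `Λ` is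
attained at a NON-interior site. [folklore] -/
theorem re_maxPrinciple {Λ : Finset HexVertex} {H : Site 2 → ℂ}
    (hmax : ∀ s : Site 2, IsInteriorSite Λ s → ∃ t ∈ siteNbrs s, (H s).re < (H t).re)
    {s₀ : Site 2} (hs₀ : IsLatticeSite Λ s₀) :
    ∃ s : Site 2, IsLatticeSite Λ s ∧ ¬ IsInteriorSite Λ s ∧ (H s₀).re ≤ (H s).re := by
  classical
  set S : Finset (Site 2) := Λ.biUnion fun f => hexFaceVertices f with hS
  have hmemS : ∀ t : Site 2, t ∈ S ↔ IsLatticeSite Λ t := fun t => by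
    simp only [hS, Finset.mem_biUnion, IsLatticeSite]
  have hs₀S : s₀ ∈ S := (hmemS s₀).2 hs₀
  obtain ⟨s, hsS, hmx⟩ := S.exists_max_image (fun t => (H t).re) ⟨s₀, hs₀S⟩
  refine ⟨s, (hmemS s).1 hsS, fun hint => ?_, hmx s₀ hs₀S⟩
  obtain ⟨t, ht, hlt⟩ := hmax s hint
  have htS : t ∈ S := (hmemS t).2 (isLatticeSite_of_mem_siteNbrs hint ht)
  have hle := hmx t htS
  linarith

/-- The global no-interior-max statement implies the local one near the root. [folklore] -/
theorem rootNoInteriorMax_of_hexNoInteriorMax (h : HexNoInteriorMax) : RootNoInteriorMax := by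
  intro D ρ Λ m b hAF x e r mr hPR hx
  filter_upwards [hAF.2.2.1, hPR.2.2.1] with δ hδ hδ' H hH s hs _
  exact h (Λ δ) hδ.1 hδ.2.2.1 (e δ) hδ'.1 H hH s hs

/-- The card's strict hull condition (all directions) implies the one-direction condition the line
uses. -/
theorem hexHullStrict_imp_noInteriorMax (h : HexHullStrict) : HexNoInteriorMax := by
  intro Λ hΛ hco a ha H hH s hs
  obtain ⟨t, ht, hpos⟩ := h Λ hΛ hco a ha H hH s hs 1 one_ne_zero
  refine ⟨t, ht, ?_⟩
  rw [map_one, one_mul, Complex.sub_re] at hpos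
  linarith

/-- **Claim D from its two halves** (lead reshapes r2/r5b, sorry-free): no interior maximum of `Re H`
plus the boundary-site bound give `HalfPlaneBounds`, by the discrete maximum principle. [folklore] -/
theorem halfPlaneBounds_of (hMax : HexNoInteriorMax) (hB : BoundaryHalfPlaneBounds) :
    HalfPlaneBounds := by
  intro D ρ Λ m b hAF x e r mr hPR hx
  obtain ⟨M, hM⟩ := hB D ρ Λ m b hAF x e r mr hPR hx
  have hsc : ∀ᶠ δ : ℝ in 𝓝[>] 0, hexDomainSimplyConnected (Λ δ) := by
    filter_upwards [hAF.2.2.1] with δ hδ using hδ.1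
  have hco : ∀ᶠ δ : ℝ in 𝓝[>] 0,
      (hexGraph.induce ((Λ δ : Finset HexVertex) : Set HexVertex)).Preconnected := by
    filter_upwards [hAF.2.2.1] with δ hδ using hδ.2.2.1
  have hbd : ∀ᶠ δ : ℝ in 𝓝[>] 0, e δ ∈ hexDomainBoundary (Λ δ) := by
    filter_upwards [hPR.2.2.1] with δ hδ using hδ.1
  have hδpos : ∀ᶠ δ : ℝ in 𝓝[>] 0, 0 < δ := eventually_mem_nhdsWithin.mono fun δ hδ => hδ
  have hmax : ∀ᶠ δ : ℝ in 𝓝[>] 0, ∀ H : Site 2 → ℂ, IsPotential (Λ δ) (e δ) H →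
      ∀ s : Site 2, IsInteriorSite (Λ δ) s → ∃ t ∈ siteNbrs s, (H s).re < (H t).re := by
    filter_upwards [hsc, hco, hbd] with δ h1 h1' h2 H hH using hMax (Λ δ) h1 h1' (e δ) h2 H hH
  refine ⟨M, ?_⟩
  filter_upwards [hM, hmax, hδpos] with δ hδ hmx hδ0 H hH ub wb hb sb hsb hsb' v hv s hs
  obtain ⟨s₁, hl, hni, hle⟩ := re_maxPrinciple (hmx H hH) (s₀ := s) ⟨v, hv, hs⟩
  have key := hδ H hH ub wb hb sb hsb hsb' s₁ hl hni
  have hmono : δ * ((H s).re - (H sb).re) ≤ δ * ((H s₁).re - (H sb).re) :=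
    mul_le_mul_of_nonneg_left (by linarith) hδ0.le
  exact hmono.trans key

/-- The r2–r10 SUFFICIENT ROUTE to Claim D (sorry-free; no longer load-bearing after reshape r11):
no interior maximum of `Re H` + far-arrival tightness (through the landed bookkeeping [A]) give
`HalfPlaneBounds` — valid for the lattice-regular families where `FarArrivalTight` holds. [folklore] -/
theorem halfPlaneBounds_of_inputs (hMax : HexNoInteriorMax) (hD : FarArrivalTight) : HalfPlaneBounds :=
  halfPlaneBounds_of hMax (boundaryHalfPlaneBounds_of hD)

/-! #### The root frame (lead reshape r5b): `conj ω / F(b) = −1/Z(b)` exactly -/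

/-- The vertical vector of a floor dart: `c(upFace k m) − c(belowFace k m) = (2ζ − 1)/3 = i/√3`,
the same for every floor dart. [folklore] -/
theorem hexCenter_upFace_sub_belowFace (k m : ℤ) :
    hexCenter (upFace k m) - hexCenter (belowFace k m) = (2 * triZeta - 1) / 3 := by
  have h := hexMidpoint_floorEdge_sub k m
  unfold floorEdge at h
  rw [hexMidpoint_mk] at h
  linear_combination (-2 : ℂ) * h

/-- **The root-frame identity** (lead reshape r5b; the algebra behind the class-covariance of the
wedge direction): for a floor-dart root `a = floorEdge ka mr` and a floor-dart normaliser
`b = floorEdge kb m ≠ a` of a simply connected `Λ`, and ANY walk `γ : a → b`,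
`conj(−e^{i(5/8)W(γ)}) / F_{x_c,5/8}(b) = −1/Z(b)` with `Z(b) = ‖F_{x_c,0}(b)‖` — by the phase law
(E2) at `b` (`(mid_b − c_up)F(b) = ((c_up^a − c_below^a)/2)·e^{i(3/8)W}·Z(b)`, i.e.
`F(b) = −e^{i(3/8)W} Z(b)`) and `e^{iW} = −1` (`exp_winding_mul_dir`: the walk enters upwards and
leaves downwards).  Both sides vanish when `Z(b) = 0`.  Consequently
`Re(conj ω · δ(H s − H s_b)/F(b)) = −(δ/Z(b))·(Re H s − Re H s_b)`: the wedge bound in the frame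
of `b` is an upper bound on `Re H` in the frame of the root. [folklore] -/
theorem rootFrame_identity {Λ : Finset HexVertex} (hΛ : hexDomainSimplyConnected Λ)
    {ka mr kb m : ℤ} (hu : belowFace ka mr ∉ Λ) (hw : upFace ka mr ∈ Λ)
    (hu' : belowFace kb m ∉ Λ) (hw' : upFace kb m ∈ Λ) (hne : floorEdge kb m ≠ floorEdge ka mr)
    (γ : HexMidEdgeSAW Λ (floorEdge ka mr) (floorEdge kb m)) :
    (starRingEnd ℂ) (-Complex.exp (Complex.I * (5 / 8 : ℂ) * (γ.winding : ℂ))) /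
        hexParafermionicObservable Λ (floorEdge ka mr) hexCriticalFugacity (5 / 8) (floorEdge kb m) =
      -((‖hexParafermionicObservable Λ (floorEdge ka mr) hexCriticalFugacity 0 (floorEdge kb m)‖⁻¹ :
          ℝ) : ℂ) := by
  have huw := adj_belowFace_upFace ka mr
  have huw' := adj_belowFace_upFace kb m
  have hne' : s(belowFace kb m, upFace kb m) ≠ s(belowFace ka mr, upFace ka mr) := hne
  -- `e^{iW} = -1`
  have hdir : Complex.exp ((γ.winding : ℂ) * Complex.I) *
      (hexCenter (upFace ka mr) - hexCenter (belowFace ka mr)) =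
      hexCenter (belowFace kb m) - hexCenter (upFace kb m) :=
    BoundaryExactness.exp_winding_mul_dir huw hu huw' hu' hne' γ
  have hA := hexCenter_upFace_sub_belowFace ka mr
  have hB := hexCenter_upFace_sub_belowFace kb m
  rw [hA] at hdir
  have hv0 : ((2 * triZeta - 1) / 3 : ℂ) ≠ 0 := by
    intro h0
    have := congrArg Complex.im h0
    simp [Literature.Probability.LatticeModels.triZeta_im] at this
  have hexpW : Complex.exp ((γ.winding : ℂ) * Complex.I) = -1 := by
    have h2 : (Complex.exp ((γ.winding : ℂ) * Complex.I) + 1) * ((2 * triZeta - 1) / 3) = 0 := by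
      rw [add_mul, one_mul, hdir, ← hB]; ring
    rcases mul_eq_zero.1 h2 with h | h
    · linear_combination h
    · exact absurd h hv0
  -- (E2) at `b`: `F(b) = -e^{i(3/8)W} Z(b)`
  have hE2 : (hexMidpoint (floorEdge kb m) - hexCenter (upFace kb m)) *
      hexParafermionicObservable Λ (floorEdge ka mr) hexCriticalFugacity (5 / 8) (floorEdge kb m) =
      (hexCenter (upFace ka mr) - hexCenter (belowFace ka mr)) / 2 *
        Complex.exp (Complex.I * (3 / 8 : ℂ) * (γ.winding : ℂ)) *
        (‖hexParafermionicObservable Λ (floorEdge ka mr) hexCriticalFugacity 0 (floorEdge kb m)‖ : ℂ) :=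
    BoundaryExactness.boundaryExactness_phaseLaw Λ hΛ _ _ huw hu hw _ _ huw' hu' hw' hne' γ
  set Z : ℝ := ‖hexParafermionicObservable Λ (floorEdge ka mr) hexCriticalFugacity 0 (floorEdge kb m)‖
    with hZ
  set Fb : ℂ := hexParafermionicObservable Λ (floorEdge ka mr) hexCriticalFugacity (5 / 8)
    (floorEdge kb m) with hFb
  have hmid : hexMidpoint (floorEdge kb m) - hexCenter (upFace kb m) =
      -(((2 * triZeta - 1) / 3) / 2) := by
    rw [hexMidpoint_floorEdge_sub]; ring
  have hE2' : -(((2 * triZeta - 1) / 3) / 2) * Fb =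
      ((2 * triZeta - 1) / 3) / 2 * Complex.exp (Complex.I * (3 / 8 : ℂ) * (γ.winding : ℂ)) * Z := by
    have h := hE2
    rw [hmid, hexCenter_upFace_sub_belowFace] at h
    exact h
  have hFbval : Fb = -(Complex.exp (Complex.I * (3 / 8 : ℂ) * (γ.winding : ℂ)) * Z) := by
    have h3 : ((2 * triZeta - 1) / 3) / 2 *
        (Fb + Complex.exp (Complex.I * (3 / 8 : ℂ) * (γ.winding : ℂ)) * Z) = 0 := by
      linear_combination (-1 : ℂ) * hE2'
    rcases mul_eq_zero.1 h3 with h | h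
    · exact absurd h (div_ne_zero hv0 two_ne_zero)
    · linear_combination h
  -- conj of the wedge direction: `conj(-e^{i(5/8)W}) = -e^{-i(5/8)W}`
  have hconj : (starRingEnd ℂ) (-Complex.exp (Complex.I * (5 / 8 : ℂ) * (γ.winding : ℂ))) =
      -Complex.exp (-(Complex.I * (5 / 8 : ℂ) * (γ.winding : ℂ))) := by
    have hr : Complex.I * (5 / 8 : ℂ) * (γ.winding : ℂ) = ((5 / 8 * γ.winding : ℝ) : ℂ) * Complex.I := by
      push_cast; ring
    rw [map_neg, ← Complex.exp_conj, hr, map_mul, Complex.conj_ofReal, Complex.conj_I, mul_neg]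
  -- `e^{-i(5/8)W} = e^{i(3/8)W} · e^{-iW} = -e^{i(3/8)W}`
  have hkey : Complex.exp (-(Complex.I * (5 / 8 : ℂ) * (γ.winding : ℂ))) =
      -Complex.exp (Complex.I * (3 / 8 : ℂ) * (γ.winding : ℂ)) := by
    have : -(Complex.I * (5 / 8 : ℂ) * (γ.winding : ℂ)) =
        Complex.I * (3 / 8 : ℂ) * (γ.winding : ℂ) + -((γ.winding : ℂ) * Complex.I) := by ring
    rw [this, Complex.exp_add, Complex.exp_neg, hexpW]
    ring
  rw [hconj, hkey, hFbval]
  have hexp0 : Complex.exp (Complex.I * (3 / 8 : ℂ) * (γ.winding : ℂ)) ≠ 0 := Complex.exp_ne_zero _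
  by_cases hZ0 : Z = 0
  · simp [hZ0]
  · have hZc : (Z : ℂ) ≠ 0 := Complex.ofReal_ne_zero.2 hZ0
    push_cast
    field_simp

/-! #### The dressed boundary-arrival identity and the TAME one-sided bound (lead, cycle 1)

Consequences of (E2) (= `BoundaryExactness.1`) and of the vanishing total flux (summed DCS
Lemma 1, `hexFlux_eq_zero_of_satisfiesVertexRelations`): over the boundary darts `(v, t)`
(`v ∈ Λ`, `t ∉ Λ`) other than the root, `Σ (mid − c_v)F({v,t}) = (c_w − c_u)/2`, i.e. the
DRESSED arrival masses `e^{i(3/8)W_e} Z(e)` sum to ONE in every simply connected domain — the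
general-domain form of DCS's identity (5)/(2).  If all boundary windings lie in `[−π, π]` (a TAME
domain: no overturning arc), the walk class of winding `+π` (and that of `−π`) has mass at most
`1/(2cos(3π/8))` — the sharp half-plane one-sided constant (`Literature…HexSAWHalfSideArrival` is
the strip instance), which is exactly what makes Claim D hold with `M = 0` at the sites of the
root's own floor in tame domains. -/

section Dressed
open Literature.Barriers.CriticalPhenomena Literature.Barriers.CriticalPhenomena.HexGreen

/-- The critical observable satisfies the vertex relations (DCS Lemma 1, proved in the tree) —
in the `SatisfiesVertexRelations` vocabulary of the barrier file. [cite: DuminilCopinSmirnov2012, Lemma 1] -/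
theorem satisfiesVertexRelations_observable {Λ : Finset HexVertex} (hΛ : hexDomainSimplyConnected Λ)
    {a : Sym2 HexVertex} (ha : a ∈ hexDomainBoundary Λ) :
    SatisfiesVertexRelations Λ (hexParafermionicObservable Λ a hexCriticalFugacity (5 / 8)) :=
  (lemma1_iff.1 DuminilCopinSmirnov2012_lemma1_holds) Λ hΛ a ha

/-- **Total boundary flux, root split off**: for a boundary root `a = {u ∉ Λ, w ∈ Λ}` of a simply
connected `Λ`, the half-edge terms `(mid − c_v)·F({v,t})` over the boundary darts OTHER than the
root sum to `(c_w − c_u)/2` (the root dart contributes `(mid_a − c_w)·F(a) = (c_u − c_w)/2`,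
`F(a) = 1`, and the total flux vanishes). [cite: DuminilCopinSmirnov2012, §3 (proof of Lemma 2, eq. (2))] -/
theorem boundaryTerm_sum_eq {Λ : Finset HexVertex} (hΛ : hexDomainSimplyConnected Λ)
    {u w : HexVertex} (huw : hexGraph.Adj u w) (hu : u ∉ Λ) (hw : w ∈ Λ) :
    ∑ v ∈ Λ, ∑ t ∈ (nbrs v).filter (· ∉ Λ),
        (if v = w ∧ t = u then 0 else
          HexKernel.term (hexParafermionicObservable Λ s(u, w) hexCriticalFugacity (5 / 8)) v t) =
      (hexCenter w - hexCenter u) / 2 := by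
  classical
  set F := hexParafermionicObservable Λ s(u, w) hexCriticalFugacity (5 / 8) with hF
  have ha : s(u, w) ∈ hexDomainBoundary Λ :=
    ⟨(SimpleGraph.mem_edgeSet hexGraph).2 huw, u, w, rfl, hw, hu⟩
  have hflux : hexFlux Λ F = 0 :=
    hexFlux_eq_zero_of_satisfiesVertexRelations (satisfiesVertexRelations_observable hΛ ha)
  -- split every term into root part + rest
  have hsplit : ∀ v ∈ Λ, ∀ t ∈ (nbrs v).filter (· ∉ Λ), HexKernel.term F v t =
      (if v = w ∧ t = u then HexKernel.term F v t else 0) +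
      (if v = w ∧ t = u then 0 else HexKernel.term F v t) := by
    intro v _ t _; split_ifs <;> simp
  have hroot : ∑ v ∈ Λ, ∑ t ∈ (nbrs v).filter (· ∉ Λ),
      (if v = w ∧ t = u then HexKernel.term F v t else 0) = HexKernel.term F w u := by
    rw [Finset.sum_eq_single w, Finset.sum_eq_single u]
    · simp
    · intro t _ htu; rw [if_neg (fun h => htu h.2)]
    · intro hun
      exfalso; apply hun
      rw [Finset.mem_filter, mem_nbrs_iff]; exact ⟨huw.symm, hu⟩
    · intro v _ hvw
      exact Finset.sum_eq_zero fun t _ => by rw [if_neg (fun h => hvw h.1)]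
    · intro hwn; exact absurd hw hwn
  have hterm : HexKernel.term F w u = (hexCenter u - hexCenter w) / 2 := by
    rw [HexKernel.term, Sym2.eq_swap, hF, hexParafermionicObservable_self ha, mul_one, hexMidpoint_mk]
    ring
  have key : hexFlux Λ F = HexKernel.term F w u +
      ∑ v ∈ Λ, ∑ t ∈ (nbrs v).filter (· ∉ Λ),
        (if v = w ∧ t = u then 0 else HexKernel.term F v t) := by
    rw [hexFlux, ← hroot, ← Finset.sum_add_distrib]
    refine Finset.sum_congr rfl fun v hv => ?_
    rw [← Finset.sum_add_distrib]
    exact Finset.sum_congr rfl fun t ht => hsplit v hv t ht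
  rw [hflux, hterm] at key
  linear_combination -key

/-- **The dressed arrival identity**: with `A := (c_w − c_u)/2` (the root's inward half-edge),
each non-root boundary dart reached by a walk `γ` contributes `A·e^{i(3/8)W(γ)}·Z({v,t})` ((E2)),
unreached darts contribute `0`; hence `Σ_{darts ≠ root} D(v,t) = A` where
`D(v,t) := (mid − c_v)F({v,t})`, `‖D(v,t)‖ = ‖A‖·Z({v,t})`.  Here: the normalised real and
imaginary sums, `Σ Re(D/A) = 1` and `Σ Im(D/A) = 0`. [folklore] -/
theorem dressed_sum_re_im {Λ : Finset HexVertex}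
    (hΛ : hexDomainSimplyConnected Λ) {u w : HexVertex} (huw : hexGraph.Adj u w) (hu : u ∉ Λ)
    (hw : w ∈ Λ) :
    (∑ v ∈ Λ, ∑ t ∈ (nbrs v).filter (· ∉ Λ),
        (if v = w ∧ t = u then 0 else
          (HexKernel.term (hexParafermionicObservable Λ s(u, w) hexCriticalFugacity (5 / 8)) v t /
            ((hexCenter w - hexCenter u) / 2))).re) = 1 ∧
    (∑ v ∈ Λ, ∑ t ∈ (nbrs v).filter (· ∉ Λ),
        (if v = w ∧ t = u then 0 else
          (HexKernel.term (hexParafermionicObservable Λ s(u, w) hexCriticalFugacity (5 / 8)) v t /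
            ((hexCenter w - hexCenter u) / 2))).im) = 0 := by
  classical
  have hA : (hexCenter w - hexCenter u) / 2 ≠ 0 :=
    div_ne_zero (Summit.CriticalPhenomena.SAWScalingLimit.Theorems.SpinShift.hexCenter_sub_ne_zero_of_adj huw)
      two_ne_zero
  have key := boundaryTerm_sum_eq hΛ huw hu hw
  have key' : ∑ v ∈ Λ, ∑ t ∈ (nbrs v).filter (· ∉ Λ),
      (if v = w ∧ t = u then 0 else
        HexKernel.term (hexParafermionicObservable Λ s(u, w) hexCriticalFugacity (5 / 8)) v t /
          ((hexCenter w - hexCenter u) / 2)) = 1 := by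
    have : ∀ v t, (if v = w ∧ t = u then (0 : ℂ) else
        HexKernel.term (hexParafermionicObservable Λ s(u, w) hexCriticalFugacity (5 / 8)) v t /
          ((hexCenter w - hexCenter u) / 2)) =
        (if v = w ∧ t = u then 0 else
          HexKernel.term (hexParafermionicObservable Λ s(u, w) hexCriticalFugacity (5 / 8)) v t) /
          ((hexCenter w - hexCenter u) / 2) := by
      intro v t; split_ifs <;> simp
    simp_rw [this, ← Finset.sum_div, key, div_self hA]
  constructor
  · have h := congrArg Complex.re key'
    rw [Complex.re_sum] at h
    simp_rw [Complex.re_sum] at h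
    rw [Complex.one_re] at h
    rw [← h]
  · have h := congrArg Complex.im key'
    rw [Complex.im_sum] at h
    simp_rw [Complex.im_sum] at h
    rw [Complex.one_im] at h
    rw [← h]

/-- No walk from a boundary root returns to it with winding `π`: walks `a → a` are trivial
(`verts_eq_nil_of_mem_boundary`), of winding `0`. [folklore] -/
theorem not_exists_winding_eq_pi_self {Λ : Finset HexVertex} {a : Sym2 HexVertex}
    (ha : a ∈ hexDomainBoundary Λ) : ¬ ∃ γ : HexMidEdgeSAW Λ a a, γ.winding = Real.pi := by
  rintro ⟨γ, hγ⟩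
  have h0 := HexMidEdgeSAW.verts_eq_nil_of_mem_boundary ha γ
  have : γ = HexMidEdgeSAW.trivial (hexDomainBoundary_subset Λ ha) := HexMidEdgeSAW.ext h0
  rw [this, HexMidEdgeSAW.winding_trivial] at hγ
  exact Real.pi_ne_zero hγ.symm

/-- **TAME one-sided arrival bound (general simply connected domains).**  If every boundary
winding from the root lies in `[−π, π]` (no overturned boundary arc, as seen from the root), the
total critical arrival mass of the class of winding EXACTLY `+π` (for a floor root: the floor
edges west of the root, at any height of the ccw lift) is at most `1/(2cos(3π/8))` — the sharp
half-plane constant.  Proof: by (E2) each reached non-root dart has dressed value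
`D = e^{i(3/8)W} Z`; per dart `cos(3π/8)·Im D + sin(3π/8)·Re D = Z·sin((3/8)(W + π)) ≥ 0`, with
EQUALITY `= 2 sin(3π/8)cos(3π/8)·Z` on the `π`-class; summing, `Σ Re D = 1`, `Σ Im D = 0`
(`dressed_sum_re_im`) give `sin(3π/8) ≥ 2 sin(3π/8) cos(3π/8)·X`. [folklore] -/
theorem tame_piClass_mass_le (hB : BoundaryExactness) {Λ : Finset HexVertex}
    (hΛ : hexDomainSimplyConnected Λ) {u w : HexVertex} (huw : hexGraph.Adj u w) (hu : u ∉ Λ)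
    (hw : w ∈ Λ)
    (htame : ∀ v ∈ Λ, ∀ t : HexVertex, hexGraph.Adj v t → t ∉ Λ → ¬ (v = w ∧ t = u) →
      ∀ γ : HexMidEdgeSAW Λ s(u, w) s(t, v), γ.winding ∈ Set.Icc (-Real.pi) Real.pi) :
    ∑ v ∈ Λ, ∑ t ∈ (nbrs v).filter (· ∉ Λ),
        (if ∃ γ : HexMidEdgeSAW Λ s(u, w) s(t, v), γ.winding = Real.pi then
          ‖hexParafermionicObservable Λ s(u, w) hexCriticalFugacity 0 s(t, v)‖ else 0) ≤
      1 / (2 * Real.cos (3 * Real.pi / 8)) := by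
  classical
  set F := hexParafermionicObservable Λ s(u, w) hexCriticalFugacity (5 / 8) with hF
  set Z : HexVertex → HexVertex → ℝ := fun v t =>
    ‖hexParafermionicObservable Λ s(u, w) hexCriticalFugacity 0 s(t, v)‖ with hZ
  set A : ℂ := (hexCenter w - hexCenter u) / 2 with hAdef
  set c := Real.cos (3 * Real.pi / 8) with hc
  set sn := Real.sin (3 * Real.pi / 8) with hsn
  have hA : A ≠ 0 :=
    div_ne_zero (Summit.CriticalPhenomena.SAWScalingLimit.Theorems.SpinShift.hexCenter_sub_ne_zero_of_adj huw)
      two_ne_zero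
  have ha : s(u, w) ∈ hexDomainBoundary Λ :=
    ⟨(SimpleGraph.mem_edgeSet hexGraph).2 huw, u, w, rfl, hw, hu⟩
  have hc0 : 0 < c := Real.cos_pos_of_mem_Ioo ⟨by linarith [Real.pi_pos], by linarith [Real.pi_pos]⟩
  have hsn0 : 0 < sn := by
    rw [hsn]; exact Real.sin_pos_of_pos_of_lt_pi (by positivity) (by linarith [Real.pi_pos])
  -- the dressed value of a dart and the per-dart inequality
  set D : HexVertex → HexVertex → ℂ := fun v t =>
    if v = w ∧ t = u then 0 else HexKernel.term F v t / A with hD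
  have hdart : ∀ v ∈ Λ, ∀ t ∈ (nbrs v).filter (· ∉ Λ),
      2 * sn * c * (if ∃ γ : HexMidEdgeSAW Λ s(u, w) s(t, v), γ.winding = Real.pi then Z v t else 0)
        ≤ c * (D v t).im + sn * (D v t).re := by
    intro v hv t ht
    rw [Finset.mem_filter, mem_nbrs_iff] at ht
    obtain ⟨hvt, htΛ⟩ := ht
    by_cases hroot : v = w ∧ t = u
    · obtain ⟨rfl, rfl⟩ := hroot
      have : ¬ ∃ γ : HexMidEdgeSAW Λ s(t, v) s(t, v), γ.winding = Real.pi :=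
        not_exists_winding_eq_pi_self ha
      simp [hD, this]
    have hne : s(t, v) ≠ s(u, w) := by
      intro h
      rw [Sym2.eq_iff] at h
      rcases h with ⟨rfl, rfl⟩ | ⟨rfl, rfl⟩
      · exact hroot ⟨rfl, rfl⟩
      · exact hu hv
    -- the dressed value through (E2), for any walk
    have hE2 : ∀ γ : HexMidEdgeSAW Λ s(u, w) s(t, v),
        D v t = Complex.exp ((((3 : ℝ) / 8 * γ.winding : ℝ) : ℂ) * Complex.I) * (Z v t : ℂ) := by
      intro γ
      have key := hB.1 Λ hΛ u w huw hu hw t v hvt.symm htΛ hv hne γ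
      have hterm : HexKernel.term F v t = (hexMidpoint s(t, v) - hexCenter v) * F s(t, v) := by
        rw [HexKernel.term, Sym2.eq_swap]
      simp only [hD, if_neg hroot]
      rw [hterm, key, show Complex.I * (3 / 8 : ℂ) * (γ.winding : ℂ) =
        (((3 : ℝ) / 8 * γ.winding : ℝ) : ℂ) * Complex.I by push_cast; ring]
      field_simp
      rw [hAdef, hZ]
      ring
    by_cases hπ : ∃ γ : HexMidEdgeSAW Λ s(u, w) s(t, v), γ.winding = Real.pi
    · obtain ⟨γ, hγ⟩ := hπ
      rw [if_pos ⟨γ, hγ⟩, hE2 γ, hγ, Complex.re_mul_ofReal, Complex.im_mul_ofReal,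
        Complex.exp_ofReal_mul_I_re, Complex.exp_ofReal_mul_I_im,
        show (3 : ℝ) / 8 * Real.pi = 3 * Real.pi / 8 by ring]
      nlinarith [hc0, hsn0]
    · rw [if_neg hπ, mul_zero]
      by_cases hex : Nonempty (HexMidEdgeSAW Λ s(u, w) s(t, v))
      · obtain ⟨γ⟩ := hex
        have hW := htame v hv t hvt htΛ hroot γ
        rw [hE2 γ, Complex.re_mul_ofReal, Complex.im_mul_ofReal, Complex.exp_ofReal_mul_I_re,
          Complex.exp_ofReal_mul_I_im]
        have hZ0 : 0 ≤ Z v t := norm_nonneg _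
        have hsin : 0 ≤ Real.sin ((3 : ℝ) / 8 * γ.winding + 3 * Real.pi / 8) :=
          Real.sin_nonneg_of_nonneg_of_le_pi (by nlinarith [hW.1, Real.pi_pos])
            (by nlinarith [hW.2, Real.pi_pos])
        rw [Real.sin_add] at hsin
        have : c * (Real.sin ((3 : ℝ) / 8 * γ.winding) * Z v t) +
            sn * (Real.cos ((3 : ℝ) / 8 * γ.winding) * Z v t) =
            (Real.sin ((3 : ℝ) / 8 * γ.winding) * Real.cos (3 * Real.pi / 8) +
              Real.cos ((3 : ℝ) / 8 * γ.winding) * Real.sin (3 * Real.pi / 8)) * Z v t := by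
          rw [hc, hsn]; ring
        rw [this]
        exact mul_nonneg hsin hZ0
      · -- no walk: the observable vanishes on this edge
        have h0 : F s(t, v) = 0 := by
          rw [hF, hexParafermionicObservable]
          haveI : IsEmpty (HexMidEdgeSAW Λ s(u, w) s(t, v)) := not_nonempty_iff.1 hex
          exact Finset.sum_of_isEmpty _
        have : D v t = 0 := by
          simp only [hD, if_neg hroot, HexKernel.term, Sym2.eq_swap (a := v), h0, mul_zero, zero_div]
        rw [this]; simp
  -- sum the per-dart inequality
  have hsum := Finset.sum_le_sum fun v hv => Finset.sum_le_sum (hdart v hv)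
  have hreim := dressed_sum_re_im hΛ huw hu hw
  have hre : ∑ v ∈ Λ, ∑ t ∈ (nbrs v).filter (· ∉ Λ), (D v t).re = 1 := hreim.1
  have him : ∑ v ∈ Λ, ∑ t ∈ (nbrs v).filter (· ∉ Λ), (D v t).im = 0 := hreim.2
  have hR : ∑ v ∈ Λ, ∑ t ∈ (nbrs v).filter (· ∉ Λ), (c * (D v t).im + sn * (D v t).re) = sn := by
    simp_rw [Finset.sum_add_distrib, ← Finset.mul_sum, him, hre]; ring
  have hL : ∑ v ∈ Λ, ∑ t ∈ (nbrs v).filter (· ∉ Λ),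
      2 * sn * c * (if ∃ γ : HexMidEdgeSAW Λ s(u, w) s(t, v), γ.winding = Real.pi then Z v t else 0) =
      2 * sn * c * ∑ v ∈ Λ, ∑ t ∈ (nbrs v).filter (· ∉ Λ),
        (if ∃ γ : HexMidEdgeSAW Λ s(u, w) s(t, v), γ.winding = Real.pi then Z v t else 0) := by
    simp_rw [Finset.mul_sum]
  rw [hR, hL] at hsum
  rw [le_div_iff₀ (by positivity)]
  nlinarith [hsum, hsn0, hc0]

theorem piClass_mass_le_general (hB : BoundaryExactness) {Λ : Finset HexVertex}
    (hΛ : hexDomainSimplyConnected Λ) {u w : HexVertex} (huw : hexGraph.Adj u w) (hu : u ∉ Λ)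
    (hw : w ∈ Λ) :
    ∑ v ∈ Λ, ∑ t ∈ (nbrs v).filter (· ∉ Λ),
        (if ∃ γ : HexMidEdgeSAW Λ s(u, w) s(t, v), γ.winding = Real.pi then
          ‖hexParafermionicObservable Λ s(u, w) hexCriticalFugacity 0 s(t, v)‖ else 0) ≤
      1 / (2 * Real.cos (3 * Real.pi / 8)) +
      (∑ v ∈ Λ, ∑ t ∈ (nbrs v).filter (· ∉ Λ),
        (if ∃ γ : HexMidEdgeSAW Λ s(u, w) s(t, v), γ.winding ∉ Set.Icc (-Real.pi) Real.pi then
          ‖hexParafermionicObservable Λ s(u, w) hexCriticalFugacity 0 s(t, v)‖ else 0)) /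
        (2 * Real.sin (3 * Real.pi / 8) * Real.cos (3 * Real.pi / 8)) := by
  classical
  set F := hexParafermionicObservable Λ s(u, w) hexCriticalFugacity (5 / 8) with hF
  set Z : HexVertex → HexVertex → ℝ := fun v t =>
    ‖hexParafermionicObservable Λ s(u, w) hexCriticalFugacity 0 s(t, v)‖ with hZ
  set A : ℂ := (hexCenter w - hexCenter u) / 2 with hAdef
  set c := Real.cos (3 * Real.pi / 8) with hc
  set sn := Real.sin (3 * Real.pi / 8) with hsn
  have hA : A ≠ 0 :=
    div_ne_zero (Summit.CriticalPhenomena.SAWScalingLimit.Theorems.SpinShift.hexCenter_sub_ne_zero_of_adj huw)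
      two_ne_zero
  have ha : s(u, w) ∈ hexDomainBoundary Λ :=
    ⟨(SimpleGraph.mem_edgeSet hexGraph).2 huw, u, w, rfl, hw, hu⟩
  have hc0 : 0 < c := Real.cos_pos_of_mem_Ioo ⟨by linarith [Real.pi_pos], by linarith [Real.pi_pos]⟩
  have hsn0 : 0 < sn := by
    rw [hsn]; exact Real.sin_pos_of_pos_of_lt_pi (by positivity) (by linarith [Real.pi_pos])
  -- the dressed value of a dart and the per-dart inequality
  set D : HexVertex → HexVertex → ℂ := fun v t =>
    if v = w ∧ t = u then 0 else HexKernel.term F v t / A with hD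
  have hdart : ∀ v ∈ Λ, ∀ t ∈ (nbrs v).filter (· ∉ Λ),
      2 * sn * c * (if ∃ γ : HexMidEdgeSAW Λ s(u, w) s(t, v), γ.winding = Real.pi then Z v t else 0)
        - (if ∃ γ : HexMidEdgeSAW Λ s(u, w) s(t, v), γ.winding ∉ Set.Icc (-Real.pi) Real.pi
            then Z v t else 0)
        ≤ c * (D v t).im + sn * (D v t).re := by
    intro v hv t ht
    rw [Finset.mem_filter, mem_nbrs_iff] at ht
    obtain ⟨hvt, htΛ⟩ := ht
    by_cases hroot : v = w ∧ t = u
    · obtain ⟨rfl, rfl⟩ := hroot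
      have : ¬ ∃ γ : HexMidEdgeSAW Λ s(t, v) s(t, v), γ.winding = Real.pi :=
        not_exists_winding_eq_pi_self ha
      have hZ0 : 0 ≤ Z v t := norm_nonneg _
      have : 2 * sn * c * (0 : ℝ) - (if ∃ γ : HexMidEdgeSAW Λ s(t, v) s(t, v),
          γ.winding ∉ Set.Icc (-Real.pi) Real.pi then Z v t else 0) ≤ 0 := by
        split_ifs <;> nlinarith
      simpa [hD, not_exists_winding_eq_pi_self ha] using this
    have hne : s(t, v) ≠ s(u, w) := by
      intro h
      rw [Sym2.eq_iff] at h
      rcases h with ⟨rfl, rfl⟩ | ⟨rfl, rfl⟩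
      · exact hroot ⟨rfl, rfl⟩
      · exact hu hv
    -- the dressed value through (E2), for any walk
    have hE2 : ∀ γ : HexMidEdgeSAW Λ s(u, w) s(t, v),
        D v t = Complex.exp ((((3 : ℝ) / 8 * γ.winding : ℝ) : ℂ) * Complex.I) * (Z v t : ℂ) := by
      intro γ
      have key := hB.1 Λ hΛ u w huw hu hw t v hvt.symm htΛ hv hne γ
      have hterm : HexKernel.term F v t = (hexMidpoint s(t, v) - hexCenter v) * F s(t, v) := by
        rw [HexKernel.term, Sym2.eq_swap]
      simp only [hD, if_neg hroot]
      rw [hterm, key, show Complex.I * (3 / 8 : ℂ) * (γ.winding : ℂ) =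
        (((3 : ℝ) / 8 * γ.winding : ℝ) : ℂ) * Complex.I by push_cast; ring]
      field_simp
      rw [hAdef, hZ]
      ring
    by_cases hπ : ∃ γ : HexMidEdgeSAW Λ s(u, w) s(t, v), γ.winding = Real.pi
    · obtain ⟨γ, hγ⟩ := hπ
      rw [if_pos ⟨γ, hγ⟩, hE2 γ, hγ, Complex.re_mul_ofReal, Complex.im_mul_ofReal,
        Complex.exp_ofReal_mul_I_re, Complex.exp_ofReal_mul_I_im,
        show (3 : ℝ) / 8 * Real.pi = 3 * Real.pi / 8 by ring]
      have hZ0 : 0 ≤ Z v t := norm_nonneg _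
      have hbad : 0 ≤ (if ∃ γ : HexMidEdgeSAW Λ s(u, w) s(t, v),
          γ.winding ∉ Set.Icc (-Real.pi) Real.pi then Z v t else 0) := by
        split_ifs <;> simp [hZ0]
      nlinarith [hc0, hsn0, hbad]
    · rw [if_neg hπ, mul_zero]
      have hZ0 : 0 ≤ Z v t := norm_nonneg _
      by_cases hbadex : ∃ γ : HexMidEdgeSAW Λ s(u, w) s(t, v), γ.winding ∉ Set.Icc (-Real.pi) Real.pi
      · -- a bad dart: `c·Im D + s·Re D = Z sin(…) ≥ -Z`
        rw [if_pos hbadex]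
        obtain ⟨γ, -⟩ := hbadex
        rw [hE2 γ, Complex.re_mul_ofReal, Complex.im_mul_ofReal, Complex.exp_ofReal_mul_I_re,
          Complex.exp_ofReal_mul_I_im]
        have hcs : c * (Real.sin ((3 : ℝ) / 8 * γ.winding) * Z v t) +
            sn * (Real.cos ((3 : ℝ) / 8 * γ.winding) * Z v t) =
            Real.sin ((3 : ℝ) / 8 * γ.winding + 3 * Real.pi / 8) * Z v t := by
          rw [Real.sin_add, hc, hsn]; ring
        rw [hcs]
        nlinarith [Real.neg_one_le_sin ((3 : ℝ) / 8 * γ.winding + 3 * Real.pi / 8), hZ0]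
      rw [if_neg hbadex, sub_zero]
      by_cases hex : Nonempty (HexMidEdgeSAW Λ s(u, w) s(t, v))
      · obtain ⟨γ⟩ := hex
        have hW : γ.winding ∈ Set.Icc (-Real.pi) Real.pi := by
          by_contra h; exact hbadex ⟨γ, h⟩
        rw [hE2 γ, Complex.re_mul_ofReal, Complex.im_mul_ofReal, Complex.exp_ofReal_mul_I_re,
          Complex.exp_ofReal_mul_I_im]
        have hsin : 0 ≤ Real.sin ((3 : ℝ) / 8 * γ.winding + 3 * Real.pi / 8) :=
          Real.sin_nonneg_of_nonneg_of_le_pi (by nlinarith [hW.1, Real.pi_pos])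
            (by nlinarith [hW.2, Real.pi_pos])
        rw [Real.sin_add] at hsin
        have : c * (Real.sin ((3 : ℝ) / 8 * γ.winding) * Z v t) +
            sn * (Real.cos ((3 : ℝ) / 8 * γ.winding) * Z v t) =
            (Real.sin ((3 : ℝ) / 8 * γ.winding) * Real.cos (3 * Real.pi / 8) +
              Real.cos ((3 : ℝ) / 8 * γ.winding) * Real.sin (3 * Real.pi / 8)) * Z v t := by
          rw [hc, hsn]; ring
        rw [this]
        exact mul_nonneg hsin hZ0
      · -- no walk: the observable vanishes on this edge
        have h0 : F s(t, v) = 0 := by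
          rw [hF, hexParafermionicObservable]
          haveI : IsEmpty (HexMidEdgeSAW Λ s(u, w) s(t, v)) := not_nonempty_iff.1 hex
          exact Finset.sum_of_isEmpty _
        have : D v t = 0 := by
          simp only [hD, if_neg hroot, HexKernel.term, Sym2.eq_swap (a := v), h0, mul_zero, zero_div]
        rw [this]; simp
  -- sum the per-dart inequality
  have hsum := Finset.sum_le_sum fun v hv => Finset.sum_le_sum (hdart v hv)
  have hreim := dressed_sum_re_im hΛ huw hu hw
  have hre : ∑ v ∈ Λ, ∑ t ∈ (nbrs v).filter (· ∉ Λ), (D v t).re = 1 := hreim.1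
  have him : ∑ v ∈ Λ, ∑ t ∈ (nbrs v).filter (· ∉ Λ), (D v t).im = 0 := hreim.2
  have hR : ∑ v ∈ Λ, ∑ t ∈ (nbrs v).filter (· ∉ Λ), (c * (D v t).im + sn * (D v t).re) = sn := by
    simp_rw [Finset.sum_add_distrib, ← Finset.mul_sum, him, hre]; ring
  have hL : ∑ v ∈ Λ, ∑ t ∈ (nbrs v).filter (· ∉ Λ),
      (2 * sn * c * (if ∃ γ : HexMidEdgeSAW Λ s(u, w) s(t, v), γ.winding = Real.pi then Z v t else 0)
        - (if ∃ γ : HexMidEdgeSAW Λ s(u, w) s(t, v), γ.winding ∉ Set.Icc (-Real.pi) Real.pi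
            then Z v t else 0)) =
      2 * sn * c * (∑ v ∈ Λ, ∑ t ∈ (nbrs v).filter (· ∉ Λ),
        (if ∃ γ : HexMidEdgeSAW Λ s(u, w) s(t, v), γ.winding = Real.pi then Z v t else 0)) -
      ∑ v ∈ Λ, ∑ t ∈ (nbrs v).filter (· ∉ Λ),
        (if ∃ γ : HexMidEdgeSAW Λ s(u, w) s(t, v), γ.winding ∉ Set.Icc (-Real.pi) Real.pi
            then Z v t else 0) := by
    simp_rw [Finset.sum_sub_distrib, Finset.mul_sum]
  rw [hR, hL] at hsum
  set X := ∑ v ∈ Λ, ∑ t ∈ (nbrs v).filter (· ∉ Λ),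
    (if ∃ γ : HexMidEdgeSAW Λ s(u, w) s(t, v), γ.winding = Real.pi then Z v t else 0)
  set B := ∑ v ∈ Λ, ∑ t ∈ (nbrs v).filter (· ∉ Λ),
    (if ∃ γ : HexMidEdgeSAW Λ s(u, w) s(t, v), γ.winding ∉ Set.Icc (-Real.pi) Real.pi
      then Z v t else 0)
  have hsc : 0 < 2 * sn * c := by positivity
  rw [div_add_div _ _ (by positivity) hsc.ne', le_div_iff₀ (by positivity)]
  nlinarith [hsum, hsn0, hc0, mul_pos hsn0 hc0]

end Dressed

/-! #### The hull condition in terms of the six edge values (bridge to crux 8296's `HexHullCondition`) -/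

/-- `HexHullStrict` in edge-value form (the shape of crux 8296's `HexHullCondition`): for every
interior site and direction, some rotated edge value `edgeValue F s k = (mid(edge_k) − c(face_{k+1}))·F(edge_k)`
has positive real part against `conj d` (via the landed `hull_iff_edgeForm` / `potential_spoke`).
[folklore] -/
theorem hexHullStrict_iff_edgeForm :
    HexHullStrict ↔
    ∀ (Λ : Finset HexVertex), hexDomainSimplyConnected Λ →
      (hexGraph.induce ((Λ : Finset HexVertex) : Set HexVertex)).Preconnected →
    ∀ a ∈ hexDomainBoundary Λ, ∀ H : Site 2 → ℂ, IsPotential Λ a H →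
    ∀ s : Site 2, IsInteriorSite Λ s → ∀ d : ℂ, d ≠ 0 →
      ∃ k : Fin 6, 0 < ((starRingEnd ℂ) d *
        edgeValue (hexParafermionicObservable Λ a hexCriticalFugacity (5 / 8)) s k).re := by
  constructor
  · intro h Λ hΛ hco a ha H hH s hs d hd
    exact (hull_iff_edgeForm hH hs d).1 (h Λ hΛ hco a ha H hH s hs d hd)
  · intro h Λ hΛ hco a ha H hH s hs d hd
    exact (hull_iff_edgeForm hH hs d).2 (h Λ hΛ hco a ha H hH s hs d hd)


/-! ### 5. The sorry-free part: subsequence principle and the composition -/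

/-- **Closing step (no `sorry`)**: Pick–cup limits along subsequences of every mesh sequence
(`PickCupLimits`) and their identification with one universal constant (`Identification`) give the
pinned target, by `Filter.tendsto_of_subseq_tendsto` on the countably generated filter `𝓝[>] 0`.
(Port of `TwoRootQuotient.closing`.) -/
theorem closing (hC : PickCupLimits) (hI : Identification) : HexObservableLimitR := by
  obtain ⟨c, hc, hId⟩ := hI
  refine ⟨c, hc, ?_⟩
  intro D ρ Λ m a b Φ L Lb ψ F hρ hflat hadm hexh ha hb hΦ hΦb hL hexpL hLb hψc hψK hψD
  -- repackage the hypotheses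
  have hAF : AdmissibleFamily D ρ Λ (m 1) b := by
    refine ⟨hρ, hflat 1, ?_, hexh, hb⟩
    filter_upwards [hadm] with δ hδ
    exact ⟨hδ.1, hδ.2.2.1, hδ.2.2.2.2.1, hδ.2.2.2.2.2.1, hδ.2.2.2.2.2.2 1⟩
  have hPR : PinnedFlatRoot D Λ b (D.pt 0) a ρ (m 0) := by
    refine ⟨hρ, hflat 0, ?_, ha⟩
    filter_upwards [hadm] with δ hδ
    exact ⟨hδ.2.1, hδ.2.2.2.1, hδ.2.2.2.2.2.2 0⟩
  have h01 : D.pt 0 ≠ D.pt 1 := fun h => absurd (D.pt_injective h) (by decide)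
  have hψ : IsTest D ψ := ⟨hψc, hψK, hψD⟩
  -- the subsequence principle on the countably generated filter `𝓝[>] 0`
  refine Filter.tendsto_of_subseq_tendsto fun ns hns => ?_
  obtain ⟨ms, hms, g, hg, hw⟩ := hC D ρ Λ (m 1) b hAF (D.pt 0) a ρ (m 0) hPR h01 ns hns
  have hns' : Tendsto (ns ∘ ms) atTop (𝓝[>] 0) := hns.comp hms.tendsto_atTop
  have hid : ∀ z ∈ D.carrier, g z = c * Complex.exp ((5 / 8 : ℂ) * (L z - Lb)) :=
    hId D ρ Λ (m 1) b hAF a ρ (m 0) hPR Φ L Lb hΦ hΦb hL hexpL hLb (ns ∘ ms) hns' g hg hw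
  -- the limit density is `c · exp((5/8)(L - Lb))` on the domain and `ψ` vanishes off the domain
  have hint : ∫ z, ψ z * g z = c * ∫ z, ψ z * Complex.exp ((5 / 8 : ℂ) * (L z - Lb)) := by
    rw [← integral_const_mul]
    refine integral_congr_ae (Filter.Eventually.of_forall fun z => ?_)
    by_cases hz : z ∈ D.carrier
    · simp only [hid z hz]; ring
    · have hψz : ψ z = 0 := image_eq_zero_of_notMem_tsupport fun h => hz (hψD h)
      simp only [hψz, zero_mul, mul_zero]
  have key := hw ψ hψ
  rw [hint] at key
  exact ⟨ms, key⟩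

/-- **The composition (kernel-checked, no `sorry`)** — r15 (lead c3, 2026-08-16 ~19Z): the crux
`BoundaryClosureR` BY NAME from the TWO registered model inputs `LocalL1Root` (local `L¹` law at the
target's root) and `GateTraceH` (gate trace of holomorphic weak limits), both NECESSARY for the target,
through the engine stub `stub_holWeakLimits` (CLOSED, p121571): given the antecedents
`DefectDecoherence`, `MassRatio`, the node `ConjugateClassNegligible` holds
(`conjugateClassNegligible_of_exponent_cruxes`, landed), the `L¹` engine produces holomorphic weak
limits along subsequences, `identificationH_of_gateTraceH` identifies them with one universal
constant, and `closingH` concludes by the subsequence principle. -/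
theorem BoundaryClosureR_of
    (h1 : Registered.stub_localL1Root) (h2 : Registered.stub_gateTraceH) :
    Summit.CriticalPhenomena.SAWScalingLimit.Theses.SAWDefectDecoherence.BoundaryClosureR :=
  fun hDD hMR =>
    closingH
      (stub_holWeakLimits
        (Summit.CriticalPhenomena.SAWScalingLimit.Theorems.conjugateClassNegligible_of_exponent_cruxes hDD hMR) h1)
      (identificationH_of_gateTraceH h2)

/-- **The r14 composition (kernel-checked, no `sorry`; lead c1, 2026-08-16 ~18:3xZ; hypotheses explicit
since r15)**: the crux `BoundaryClosureR` BY NAME from the FOUR r14 model inputs about the critical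
hexagonal-lattice SAW observable — `RootNoInteriorMax` (no interior max of `Re H` in the root's
half-ball), `FlatDensityLower ∧ RootArmLaw` (positive-mass lower bounds on the flat pieces),
`LocalSupBound` (no-spike a-priori bound up to the flat pieces), `GateBoundaryValueLaw` (gate values of
the limit = `c(Φ'/Φ'(b))^{5/8}`) — through the Pick engine: STUBS 1a+1b assemble `DevelopingMapExact`;
STUB 5∘6 produces Pick–cup limits; STUB 7 identifies them; `closing` concludes. -/
theorem boundaryClosureR_of_pickInputs
    (h2 : RootNoInteriorMax) (h3 : FlatDensityLower ∧ RootArmLaw)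
    (h4 : LocalSupBound) (h7 : GateBoundaryValueLaw) :
    DefectDecoherence → MassRatio → HexObservableLimitR :=   -- = `BoundaryClosureR` unfolded (r14 record)
  fun hDD hMR =>
    have hE : DevelopingMapExact := developingMapExact_of stub_potentialExistence stub_boundaryExactness
    have hF : FlatMassLaws :=
      flatMassLaws_of (flatDensityLaw_of h3.1 (stub_flatDensityUpperOfSup h4)) h3.2
    have hP : PickCupLimits :=
      pickCupLimits_of
        (engineLimits_of (stub_developingMapsCompact h4) (stub_localL1OfSup h4) hDD hMR)
        (stub_engineBoundaryData hE (stub_rootWedgeOfNoMax h2 h4) hF h4)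
    closing hP (identification_of_gateTrace (gateTrace_of_law h7))

/-- The r14 sup input implies the r15 `L¹` input (`LocalSupBound → LocalL1Bound → LocalL1Root`). [folklore] -/
theorem localL1Root_of_localSupBound (h4 : LocalSupBound) : LocalL1Root :=
  localL1Root_of_localL1Bound (stub_localL1OfSup h4)

/-- **EQUIVALENCE modulo the exponent cruxes** (r15, hypothesis form): the engine, the datum and the two
necessity directions make the target `HexObservableLimitR` EQUIVALENT to `LocalL1Root ∧ GateTraceH` given
`DefectDecoherence` and `MassRatio`.  Unconditional form: `target_iff_inputs` below. -/
theorem target_iff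
    (hW : ConjugateClassNegligible → LocalL1Root → HolWeakLimits) (hF : FrameDatumExists)
    (hN1 : FrameDatumExists → HexObservableLimitR → LocalL1Root) (hN2 : HexObservableLimitR → GateTraceH)
    (hDD : DefectDecoherence) (hMR : MassRatio) :
    HexObservableLimitR ↔ (LocalL1Root ∧ GateTraceH) :=
  ⟨fun hX => ⟨hN1 hF hX, hN2 hX⟩, fun h =>
    closingH
      (hW (Summit.CriticalPhenomena.SAWScalingLimit.Theorems.conjugateClassNegligible_of_exponent_cruxes
        hDD hMR) h.1)
      (identificationH_of_gateTraceH h.2)⟩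

/-- **The two r15 inputs are NECESSARY for the target** (sorry-free since the wave-1 landings
p121923/p122275/p122434): `HexObservableLimitR → LocalL1Root ∧ GateTraceH`. -/
theorem inputs_of_target (hX : HexObservableLimitR) : LocalL1Root ∧ GateTraceH :=
  ⟨stub_localL1Root_necessity stub_frameDatum hX, stub_gateTraceH_necessity hX⟩

/-- **The two r15 inputs are SUFFICIENT for the target given the exponent cruxes** (sorry-free since
p121571): `DefectDecoherence → MassRatio → LocalL1Root → GateTraceH → HexObservableLimitR`. -/
theorem target_of_inputs (hDD : DefectDecoherence) (hMR : MassRatio) (h1 : LocalL1Root) (h2 : GateTraceH) :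
    HexObservableLimitR :=
  closingH
    (stub_holWeakLimits
      (Summit.CriticalPhenomena.SAWScalingLimit.Theorems.conjugateClassNegligible_of_exponent_cruxes hDD hMR) h1)
    (identificationH_of_gateTraceH h2)

/-- **EQUIVALENCE modulo the exponent cruxes, unconditional form** (r15; kernel-checked, no `sorry`,
no hypotheses beyond the two cruxes): `DefectDecoherence → MassRatio → (HexObservableLimitR ↔
LocalL1Root ∧ GateTraceH)` — the crux `BoundaryClosureR` is EXACTLY the conjunction of the local `L¹`
law at the root and the gate trace of holomorphic weak limits. -/
theorem target_iff_inputs (hDD : DefectDecoherence) (hMR : MassRatio) :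
    HexObservableLimitR ↔ (LocalL1Root ∧ GateTraceH) :=
  ⟨inputs_of_target, fun h => target_of_inputs hDD hMR h.1 h.2⟩

/-- **The crux is equivalent to its two inputs read conditionally** (r15, no `sorry`):
`BoundaryClosureR ↔ (DefectDecoherence → MassRatio → LocalL1Root ∧ GateTraceH)`. -/
theorem boundaryClosureR_iff_inputs :
    Summit.CriticalPhenomena.SAWScalingLimit.Theses.SAWDefectDecoherence.BoundaryClosureR ↔
      (DefectDecoherence → MassRatio → LocalL1Root ∧ GateTraceH) :=
  ⟨fun hBC hDD hMR => inputs_of_target (hBC hDD hMR),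
    fun h hDD hMR => (target_iff_inputs hDD hMR).2 (h hDD hMR)⟩

/-- Wiring check (r15): the registered stubs feed `BoundaryClosureR_of` as stated. -/
example : Summit.CriticalPhenomena.SAWScalingLimit.Theses.SAWDefectDecoherence.BoundaryClosureR :=
  BoundaryClosureR_of stub_localL1Root stub_gateTraceH

/-- Wiring check (r15): the equivalence from the registered stubs. -/
example (hDD : DefectDecoherence) (hMR : MassRatio) : HexObservableLimitR ↔ (LocalL1Root ∧ GateTraceH) :=
  target_iff stub_holWeakLimits stub_frameDatum stub_localL1Root_necessity stub_gateTraceH_necessity hDD hMR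

end Summit.CriticalPhenomena.SAWScalingLimit.Cruxes.BoundaryClosureR.PickHalfPlane

end
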